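import Summits.QuantumFields.YangMills.Theorems.BalabanLadderIRFrameCells
import Literature.MathematicalPhysics.QuantumFieldTheory.LatticeGaugeShenZhuZhuProofs
import Literature.MathematicalPhysics.QuantumLattice.LatticeGaugeDLRBoxKernels
import Literature.Probability.LatticeModels.CoarseCellMixingDefectsAnnealed
import Summits.QuantumFields.YangMills.Theorems.IR.Negative.OnsetMixingTypicalFalseOfMassWire
import Summits.QuantumFields.YangMills.Theorems.OneCertifiedCubeFiniteSizeCriterionTorus
import Summits.QuantumFields.YangMills.Cruxes.IR.Lines.birth

/-!
# Crux-ideate seat `ym-cruxidea-19354-1` (−1, lens TRANSFER), GEN 7 — (A) the TWO-RADIUS INTERSECTION family: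
# clause (i) AT ALL CENTRES is FREE from per-frame two-tier data; (B) the engine stub E^c of the re-cut U^c is PROVED
# OUTRIGHT (box port P1–P4 + tree engine + cube-frame funnel), so `IR ⇐ I^c ∧ X^c` (§10 `ir_of_onset_af`)
# (desk sketch; count-neutral; NOT a skeleton; zero `sorry`, standard axioms)

Crux `stmt-QuantumFields-19354` = `BalabanLadder.IR`; slot of record «af-pincer-U» (`p2-g28-files/line-af-pincer-U.reg.lean`
sha16 fc8c6b10a3fbcbe2; stubs `stub_onsetU : OnsetMixingTypicalUKP` (I^U), `stub_typCriterionU : TypCriterionUKP` (E^U),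
`stub_afOnsetU : AFToOnsetUKP` (X^U)) UNTOUCHED by this file (nothing registered).  Companion memo: HOME `MEMO-g7-two-recuts.md`.

CONTEXT.  GEN 6 (`Sketch-g6-port.lean` 6593698f03a93047, `MEMO-g6-port-map.md`) showed that the PORT of the engine stub E
onto the tree's block-Markov defect engine consumes clause (i) «sub-region mixing ≤ ε» at EVERY centre cell of the frame for
ONE typical family (`IsGoodFS.fs` is consulted at every cell; owner R62 (3′) confirms), whereas the registered format U
offers, per frame, `∃ Typ` with (i) at the centre cell `0` only — the datum «(i) at all centres» (`TypShellCondUKPc`, U^c).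
The cplan seat's g7 supplier architecture ARCH-C (`Sketch-g7-supplier.lean` §D) produces, per frame, TWO TIERS `R` (rough,
ANY-EXTERIOR single-cell rare) and `M` (mild, single-cell rare GIVEN `R`-typical radius-1 neighbours) with (i) at centre `0`
for `R ∩ M`, and two typed tower targets `TwoTierTowerConst` / `TwoTierTorusConst` turning tiered single-cell rarity into
the joint clauses (ii_U) / (iii_U).

THE G7 FINDING (this file, zero `sorry`).  From EXACTLY that per-frame tiered data — WITHOUT any covariance of the
supplied families under frame shifts — ONE family with clause (i) at ALL centres and tiered single-cell rarity is built on
every frame, so the two tower targets deliver U^c and not merely U: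

* §2 the TWO-RADIUS INTERSECTION family.  Index the data supplied on the shifted frames `shiftFrame w c₀` by their centre
  `c₀` (in `w`-coordinates: `R' c₀ c := R_{c₀} (c − c₀)`).  Put
  `interR c := ⋂ {R' c₀ c : ‖c₀ − c‖∞ ≤ 2n+2}` and `interM c := ⋂ {M' c₀ c : ‖c₀ − c‖∞ ≤ 2n+1}`.
  PROVED: (a) measurable, cell-local; (b) `ClauseIAll` for `interR ∩ interM` (a window-plus-shell cell of centre `c₀`
  is within `2n+1` of `c₀`, so both intersections contain the `c₀`-th factors there); (c) `SupCellRarityAt interR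
  ((4n+5)⁴ δR)` (union bound — any exterior); (d) `CondCellRarityAt interR interM ((4n+3)⁴ δM)` — the point: the
  GUARD CLOSES because the rough radius exceeds the mild radius by one (a radius-1 neighbour `c'` of `c` and a centre
  `c₀` within `2n+1` of `c` satisfy `‖c₀ − c'‖∞ ≤ 2n+2`, so `ζ ∈ interR c'` supplies `ζ ∈ R' c₀ c'`, the guard of the
  `c₀`-th conditional rarity).  With ONE radius (or with the self-guarded joint clause (ii_U) as the only rarity datum)
  the guard regresses outward by one cell per step and never closes (HOME NOTES C54).
* §3 PROVED `typShellCondUKPc_of_clauseI_twoTier`: cplan's ARCH-C adapter hypotheses VERBATIM (per mesh-`b` frame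
  `∃ R M`, measurable, cell-local, (i) at centre `0` for `R ∩ M`, `SupCellRarityAt R δR`, `CondCellRarityAt R M δM`) with
  budgets `(4n+5)⁴ δR ≤ C δ^k`, `(4n+3)⁴ δM ≤ C δ^k` (harmless: the suppliers give every `δ > 0`), plus
  `TwoTierTowerConst k C` and `TwoTierTorusConst k C` ⟹ `TypShellCondUKPc ρ β b n ε δ` (U^c = U + (i) at ALL centres).
  COROLLARY: the re-cut U → U^c costs the supplier side NOTHING beyond what ARCH-C already owes for U (T2a, T2b), and it is
  exactly what the consumer-side port (g6 §3–§5, architecture δ') needs.  ARCH-AE (any-exterior classes) is the case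
  `R := univ`-guard-free and is covered a fortiori (§3 `typShellCondUKPc_of_clauseI_supCellRarityAt_twoTier`).
* §1 is the clause vocabulary VERBATIM from g6 §1 (`IsFrame … TypShellCondUKPc`, mirror `TypShellCondUKP`,
  `typShellCondUKP_of_UKPc`) and from cplan g7 (`SupCellRarityAt`, `CondCellRarityAt`, `TwoTierTowerConst`,
  `TwoTierTorusConst`), so that the file is self-contained (desk files are not importable).

THE G7 CONSUMER SIDE (B): E^c = `TypCriterionUKPc` (g6 §2: the slot's `TypCriterionUKP` with `TypShellCondUKP ↦
TypShellCondUKPc`) is PROVED OUTRIGHT — `typCriterionUKPc_holds` (§9d), axioms `propext, Classical.choice, Quot.sound`: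

* §4 the g6 box instance VERBATIM (`boxCells`, `boxSpec` = ℤ⁴ kernels in the padded exterior restricted to the box links,
  coarse torus `boxMod` with phantom layers, `boxGood`, obligations `BoxP1 … BoxP4`) + bookkeeping; §5 PROVED
  `boxP4_of_clauseIIukp` (UKP Peierls rarity of the defect family from clause (ii_U), any padding typical on the rind's
  outer neighbours); §6 PROVED `boxP3_of_clauseIAll` (`IsGoodFS` from clause (i) at ALL centres — the U^c datum); §7 PROVED
  `boxP2_of_frame` (block-Markov leak `0`: DLR consistency + cell-locality of the kernels), `boxP1_of_continuous`
  (`IsSpecification`), `boxInstance_of_clauses`.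
* §8 PROVED `uniform_influence_markov_defects` (g6 §4 verbatim: the ν-free two-exterior form of the tree engine
  `annealed_influence_markov_defects`), `enginePortT_holds : EnginePortT` (per-box uniform influence
  `≤ C₁ e^{#Δf} #rind θ^D`, `θ = e^{-κₑ}`, from `TypShellCondUKPc` via §4–§7 + a typical padding `exists_typical_pad`) and
  `typCriterionUKPc_of_torusBookkeeping : TorusBookkeepingT → TypCriterionUKPc`.
* §9 PROVED `TorusBookkeepingT` (`torusBookkeepingT_holds`): (9a) the cube `[-L,L]⁴ × univ` is the inner link set of a
  mesh-`b` frame box (`cubeFrame`, `regionEdges_cubeFrame`; distance-to-rind `≥ (L+1-R_A)/(2b) - 1`, `dist_supp_rind`);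
  (9b) `cubeInfluence_of_boxUniformInfluence`: cube influence `≤ cubeConst · e^{-(λ/4b) L}` for every bounded local
  observable (rescaled into `[0,1]`), `λ = -log θ`, constants uniform in `β, b`; (9c) `corr_le_of_cubeInfluence`: the
  tree funnel `NonSimplyConnectedLatticeGap.clustering_of_boxInfluenceDecay_at` with its constant exposed; (9d) `κ := λ/4`,
  `s₀ := 0`, `T2`/second countability from the faithful continuous `ρ`.
* §10 the slot's generic seams and the reshaped triple (g6 §0/§2 VERBATIM) and the HEADLINE
  `ir_of_onset_af : OnsetMixingTypicalUKPc → AFToOnsetTUKPc → BalabanLadder.IR` — under the re-cut `U ↦ U^c` the crux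
  needs only the supplier stub I^c and the AF stub X^c; the engine stub is discharged.  (I^c ⇒ I_T, so I^c inherits I_T's
  typed bet `¬ MassWire` of `IR/Negative/OnsetMixingTypicalFalseOfMassWire`; nothing here touches that.)
-/

set_option autoImplicit false

noncomputable section

open Filter Topology MeasureTheory
open scoped ENNReal
open Literature.MathematicalPhysics.QuantumFieldTheory Literature.MathematicalPhysics.QuantumLattice
open Literature.Probability.LatticeModels
open Summit.QuantumFields.YangMills.Cruxes.IR.Tempered (cellEdges windowCells regionEdges)
open Summit.QuantumFields.YangMills.Cruxes.IR.ShellTempered (windowCellsPlus)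
open Summit.QuantumFields.YangMills.Cruxes.IR.CellTempered.Engine (shiftFrame shiftFrame_mesh cellEdges_shiftFrame
  regionEdges_shiftFrame frameCell frameCell_eq_iff mem_cellEdges_frameCell frame_hC1 frameIdx_le lt_frameIdx_succ
  frame_add_nat_le)

namespace Summit.QuantumFields.YangMills.Cruxes.IR.AfPincerT.PortG7

variable {G : Type} [Group G] [TopologicalSpace G] [IsTopologicalGroup G] [CompactSpace G]
  [MeasurableSpace G] [BorelSpace G]

/-! ## §1 Clause vocabulary (VERBATIM copies: g6 §1 and cplan g7 §A/§D) -/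

section Format

/-- A mesh-`b` frame: `b ≤ w i (j+1) − w i j ≤ 2b` (the slot's binder, named). [g6 §1] -/
def IsFrame (b : ℕ) (w : Fin 4 → ℤ → ℤ) : Prop :=
  ∀ i j, w i j + ((b : ℕ) : ℤ) ≤ w i (j + 1) ∧ w i (j + 1) ≤ w i j + 2 * ((b : ℕ) : ℤ)

/-- Every `Typ c` is measurable and read off the cell's own edges. [g6 §1] -/
def TypLocal (w : Fin 4 → ℤ → ℤ) (Typ : (Fin 4 → ℤ) → Set (LGConfig 4 G)) : Prop :=
  (∀ c, MeasurableSet (Typ c)) ∧ (∀ c, DependsOn (fun σ : LGConfig 4 G => σ ∈ Typ c) ↑(cellEdges w c))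

/-- Clause (i) of the slot VERBATIM (= cplan `ClauseIAt`, = disprover `FixedMesh.ClauseI`): sub-region mixing `≤ ε` at
the CENTRE cell `0`. [g6 §1] -/
def ClauseI {N : ℕ} (ρ : G →* Matrix (Fin N) (Fin N) ℂ) (β : ℝ) (w : Fin 4 → ℤ → ℤ) (n : ℕ) (ε : ℝ)
    (Typ : (Fin 4 → ℤ) → Set (LGConfig 4 G)) : Prop :=
  ∀ Y : Finset (Fin 4 → ℤ), Y ⊆ windowCells n → (0 : Fin 4 → ℤ) ∈ Y →
    ∀ σ σ' : LGConfig 4 G,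
      (∀ c ∈ windowCellsPlus n, c ∉ Y → σ ∈ Typ c ∧ σ' ∈ Typ c) →
      (∀ c ∈ windowCellsPlus n, c ∉ Y → c ∈ windowCells n → ∀ e ∈ cellEdges w c, σ e = σ' e) →
      ∀ f : LGConfig 4 G → ℝ, IsCylinder f (cellEdges w 0) → Measurable f → (∀ U, 0 ≤ f U ∧ f U ≤ 1) →
        |(∫ U, f U ∂(ymSpecification ρ β (regionEdges w Y) σ)) -
          ∫ U, f U ∂(ymSpecification ρ β (regionEdges w Y) σ')| ≤ ε

/-- **Clause (i) AT EVERY CENTRE** for one family: (i) for the shifted frame `shiftFrame w c₀` and the re-indexed family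
`c ↦ Typ (c + c₀)`, for all `c₀`. [g6 §1] -/
def ClauseIAll {N : ℕ} (ρ : G →* Matrix (Fin N) (Fin N) ℂ) (β : ℝ) (w : Fin 4 → ℤ → ℤ) (n : ℕ) (ε : ℝ)
    (Typ : (Fin 4 → ℤ) → Set (LGConfig 4 G)) : Prop :=
  ∀ c₀ : Fin 4 → ℤ, ClauseI ρ β (shiftFrame w c₀) n ε (fun c => Typ (c + c₀))

/-- Clause (ii) in UKP form (slot U VERBATIM). [g6 §1] -/
def ClauseIIukp {N : ℕ} (ρ : G →* Matrix (Fin N) (Fin N) ℂ) (β : ℝ) (w : Fin 4 → ℤ → ℤ) (δ : ℝ)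
    (Typ : (Fin 4 → ℤ) → Set (LGConfig 4 G)) : Prop :=
  ∀ F F' : Finset (Fin 4 → ℤ), F ⊆ F' → F.Nonempty → ∀ ζ : LGConfig 4 G,
    (∀ c ∈ F, ∀ c' : Fin 4 → ℤ, (∀ i, |c' i - c i| ≤ 1) → c' ∈ F' ∨ ζ ∈ Typ c') →
      (ymSpecification ρ β (regionEdges w F') ζ) {σ : LGConfig 4 G | ∀ c ∈ F, σ ∉ Typ c} ≤
        ENNReal.ofReal (δ ^ F.card)

/-- Clause (iii) of the slot VERBATIM (torus anchor). [g6 §1] -/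
def ClauseIII {N : ℕ} (ρ : G →* Matrix (Fin N) (Fin N) ℂ) (β : ℝ) (w : Fin 4 → ℤ → ℤ) (b : ℕ) (δ : ℝ)
    (Typ : (Fin 4 → ℤ) → Set (LGConfig 4 G)) : Prop :=
  ∀ S : ℕ, 4 * b ≤ 2 * S + 1 → ∀ F : Finset (Fin 4 → ℤ), F.Nonempty →
    (∀ c ∈ F, ∀ i, -(S : ℤ) ≤ w i (c i) ∧ w i (c i + 1) ≤ (S : ℤ) + 1) →
      (wilsonMeasure (d := 4) (L := 2 * S + 1) ρ β)
          {V : GaugeConfig 4 (2 * S + 1) G | ∀ c ∈ F, torusLift (2 * S + 1) V ∉ Typ c} ≤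
        ENNReal.ofReal (δ ^ F.card)

/-- **U^c — format U with clause (i) at all centres** (g6 §1 VERBATIM): per frame ONE family with locality, (i) at EVERY
centre, (ii) UKP, (iii). -/
def TypShellCondUKPc {N : ℕ} (ρ : G →* Matrix (Fin N) (Fin N) ℂ) (β : ℝ) (b n : ℕ) (ε δ : ℝ) : Prop :=
  ∀ w : Fin 4 → ℤ → ℤ, IsFrame b w →
    ∃ Typ : (Fin 4 → ℤ) → Set (LGConfig 4 G),
      TypLocal w Typ ∧ ClauseIAll ρ β w n ε Typ ∧ ClauseIIukp ρ β w δ Typ ∧ ClauseIII ρ β w b δ Typ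

/-- MIRROR of the REGISTERED slot-U format `AfPincerU.TypShellCondUKP` (`line-af-pincer-U.reg.lean` :171, VERBATIM). [g6 §1] -/
def TypShellCondUKP {N : ℕ} (ρ : G →* Matrix (Fin N) (Fin N) ℂ) (β : ℝ) (b n : ℕ) (ε δ : ℝ) : Prop :=
  ∀ w : Fin 4 → ℤ → ℤ, (∀ i j, w i j + ((b : ℕ) : ℤ) ≤ w i (j + 1) ∧ w i (j + 1) ≤ w i j + 2 * ((b : ℕ) : ℤ)) →
    ∃ Typ : (Fin 4 → ℤ) → Set (LGConfig 4 G),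
      (∀ c, MeasurableSet (Typ c)) ∧ (∀ c, DependsOn (fun σ : LGConfig 4 G => σ ∈ Typ c) ↑(cellEdges w c)) ∧
      (∀ Y : Finset (Fin 4 → ℤ), Y ⊆ windowCells n → (0 : Fin 4 → ℤ) ∈ Y →
        ∀ σ σ' : LGConfig 4 G,
          (∀ c ∈ windowCellsPlus n, c ∉ Y → σ ∈ Typ c ∧ σ' ∈ Typ c) →
          (∀ c ∈ windowCellsPlus n, c ∉ Y → c ∈ windowCells n → ∀ e ∈ cellEdges w c, σ e = σ' e) →
          ∀ f : LGConfig 4 G → ℝ, IsCylinder f (cellEdges w 0) → Measurable f → (∀ U, 0 ≤ f U ∧ f U ≤ 1) →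
            |(∫ U, f U ∂(ymSpecification ρ β (regionEdges w Y) σ)) -
              ∫ U, f U ∂(ymSpecification ρ β (regionEdges w Y) σ')| ≤ ε) ∧
      (∀ F F' : Finset (Fin 4 → ℤ), F ⊆ F' → F.Nonempty → ∀ ζ : LGConfig 4 G,
        (∀ c ∈ F, ∀ c' : Fin 4 → ℤ, (∀ i, |c' i - c i| ≤ 1) → c' ∈ F' ∨ ζ ∈ Typ c') →
          (ymSpecification ρ β (regionEdges w F') ζ) {σ : LGConfig 4 G | ∀ c ∈ F, σ ∉ Typ c} ≤
            ENNReal.ofReal (δ ^ F.card)) ∧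
      (∀ S : ℕ, 4 * b ≤ 2 * S + 1 → ∀ F : Finset (Fin 4 → ℤ), F.Nonempty →
        (∀ c ∈ F, ∀ i, -(S : ℤ) ≤ w i (c i) ∧ w i (c i + 1) ≤ (S : ℤ) + 1) →
          (wilsonMeasure (d := 4) (L := 2 * S + 1) ρ β)
              {V : GaugeConfig 4 (2 * S + 1) G | ∀ c ∈ F, torusLift (2 * S + 1) V ∉ Typ c} ≤
            ENNReal.ofReal (δ ^ F.card))

omit [IsTopologicalGroup G] [CompactSpace G] [BorelSpace G] in
/-- The unshifted frame. [g6 §1] -/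
theorem shiftFrame_zero (w : Fin 4 → ℤ → ℤ) : shiftFrame w 0 = w := by
  funext i j
  simp [shiftFrame]

/-- `U^c ⇒ U` (g6 §1): the only difference is clause (i) — at every centre (U^c) vs at the centre `0` (U). -/
theorem typShellCondUKP_of_UKPc {N : ℕ} {ρ : G →* Matrix (Fin N) (Fin N) ℂ} {β : ℝ} {b n : ℕ} {ε δ : ℝ}
    (hU : TypShellCondUKPc ρ β b n ε δ) : TypShellCondUKP ρ β b n ε δ := by
  intro w hw
  obtain ⟨Typ, ⟨hm, hd⟩, hi, hii, hiii⟩ := hU w hw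
  refine ⟨Typ, hm, hd, ?_, hii, hiii⟩
  have h := hi 0
  have hT : (fun c : Fin 4 → ℤ => Typ (c + 0)) = Typ := by funext c; rw [add_zero]
  rw [shiftFrame_zero, hT] at h
  exact h

/-- **Single-cell ANY-EXTERIOR rarity** of `Typ` at budget `δ` on the frame `w` (cplan g7 §A VERBATIM). -/
def SupCellRarityAt {N : ℕ} (ρ : G →* Matrix (Fin N) (Fin N) ℂ) (β : ℝ) (w : Fin 4 → ℤ → ℤ)
    (Typ : (Fin 4 → ℤ) → Set (LGConfig 4 G)) (δ : ℝ) : Prop :=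
  ∀ (c : Fin 4 → ℤ) (ζ : LGConfig 4 G), (ymSpecification ρ β (regionEdges w {c}) ζ) (Typ c)ᶜ ≤ ENNReal.ofReal δ

/-- **Conditional (guarded) single-cell rarity of the mild tier** (cplan g7 §D VERBATIM): resampling ONE cell `c` with an
exterior whose radius-1 neighbours `c' ≠ c` are `R`-typical, «`R`-typical but `M`-atypical at `c`» has probability `≤ δM`. -/
def CondCellRarityAt {N : ℕ} (ρ : G →* Matrix (Fin N) (Fin N) ℂ) (β : ℝ) (w : Fin 4 → ℤ → ℤ)
    (R M : (Fin 4 → ℤ) → Set (LGConfig 4 G)) (δM : ℝ) : Prop :=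
  ∀ (c : Fin 4 → ℤ) (ζ : LGConfig 4 G), (∀ c' : Fin 4 → ℤ, (∀ i, |c' i - c i| ≤ 1) → c' ≠ c → ζ ∈ R c') →
    (ymSpecification ρ β (regionEdges w {c}) ζ) (R c ∩ (M c)ᶜ) ≤ ENNReal.ofReal δM

/-- Budget monotonicity (cplan). -/
theorem supCellRarityAt_mono_budget {N : ℕ} {ρ : G →* Matrix (Fin N) (Fin N) ℂ} {β : ℝ} {w : Fin 4 → ℤ → ℤ}
    {Typ : (Fin 4 → ℤ) → Set (LGConfig 4 G)} {δ δ' : ℝ} (h : δ ≤ δ') (hT : SupCellRarityAt ρ β w Typ δ) :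
    SupCellRarityAt ρ β w Typ δ' :=
  fun c ζ => (hT c ζ).trans (ENNReal.ofReal_le_ofReal h)

/-- Budget monotonicity, conditional version. -/
theorem condCellRarityAt_mono_budget {N : ℕ} {ρ : G →* Matrix (Fin N) (Fin N) ℂ} {β : ℝ} {w : Fin 4 → ℤ → ℤ}
    {R M : (Fin 4 → ℤ) → Set (LGConfig 4 G)} {δ δ' : ℝ} (h : δ ≤ δ') (hT : CondCellRarityAt ρ β w R M δ) :
    CondCellRarityAt ρ β w R M δ' :=
  fun c ζ hg => (hT c ζ hg).trans (ENNReal.ofReal_le_ofReal h)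

/-- An any-exterior-rare mild tier is conditionally rare for every rough tier (cplan; guard unused). -/
theorem condCellRarityAt_of_supCellRarityAt {N : ℕ} {ρ : G →* Matrix (Fin N) (Fin N) ℂ} {β : ℝ} {w : Fin 4 → ℤ → ℤ}
    (R : (Fin 4 → ℤ) → Set (LGConfig 4 G)) {M : (Fin 4 → ℤ) → Set (LGConfig 4 G)} {δM : ℝ}
    (h : SupCellRarityAt ρ β w M δM) : CondCellRarityAt ρ β w R M δM :=
  fun c ζ _ => (measure_mono Set.inter_subset_right).trans (h c ζ)

/-- **Two-tier hereditary tower at constants `(k, C)`** (cplan g7 §D VERBATIM; target T2a `TwoTierTowerLemma` supplies it). -/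
def TwoTierTowerConst (k : ℕ) (C : ℝ) {N : ℕ} (ρ : G →* Matrix (Fin N) (Fin N) ℂ) (β : ℝ) (b : ℕ) : Prop :=
  ∀ w : Fin 4 → ℤ → ℤ, (∀ i j, w i j + ((b : ℕ) : ℤ) ≤ w i (j + 1) ∧ w i (j + 1) ≤ w i j + 2 * ((b : ℕ) : ℤ)) →
    ∀ R M : (Fin 4 → ℤ) → Set (LGConfig 4 G),
      (∀ c, MeasurableSet (R c)) → (∀ c, MeasurableSet (M c)) →
      (∀ c, DependsOn (fun σ : LGConfig 4 G => σ ∈ R c) ↑(cellEdges w c)) →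
      (∀ c, DependsOn (fun σ : LGConfig 4 G => σ ∈ M c) ↑(cellEdges w c)) →
      ∀ δ : ℝ, 0 ≤ δ → δ ≤ 1 →
        SupCellRarityAt ρ β w R (C * δ ^ k) → CondCellRarityAt ρ β w R M (C * δ ^ k) →
          ∀ F F' : Finset (Fin 4 → ℤ), F ⊆ F' → ∀ ζ : LGConfig 4 G,
            (∀ c ∈ F, ∀ c' : Fin 4 → ℤ, (∀ i, |c' i - c i| ≤ 1) → c' ∈ F' ∨ ζ ∈ R c') →
              (ymSpecification ρ β (regionEdges w F') ζ) {σ : LGConfig 4 G | ∀ c ∈ F, σ ∉ R c ∩ M c} ≤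
                ENNReal.ofReal (δ ^ F.card)

/-- **Two-tier torus anchor at constants `(k, C)`** (cplan g7 §D VERBATIM; target T2b `TwoTierTorusLemma` supplies it). -/
def TwoTierTorusConst (k : ℕ) (C : ℝ) {N : ℕ} (ρ : G →* Matrix (Fin N) (Fin N) ℂ) (β : ℝ) (b : ℕ) : Prop :=
  ∀ w : Fin 4 → ℤ → ℤ, (∀ i j, w i j + ((b : ℕ) : ℤ) ≤ w i (j + 1) ∧ w i (j + 1) ≤ w i j + 2 * ((b : ℕ) : ℤ)) →
    ∀ R M : (Fin 4 → ℤ) → Set (LGConfig 4 G),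
      (∀ c, MeasurableSet (R c)) → (∀ c, MeasurableSet (M c)) →
      (∀ c, DependsOn (fun σ : LGConfig 4 G => σ ∈ R c) ↑(cellEdges w c)) →
      (∀ c, DependsOn (fun σ : LGConfig 4 G => σ ∈ M c) ↑(cellEdges w c)) →
      ∀ δ : ℝ, 0 ≤ δ → δ ≤ 1 →
        SupCellRarityAt ρ β w R (C * δ ^ k) → CondCellRarityAt ρ β w R M (C * δ ^ k) →
          ∀ S : ℕ, 4 * b ≤ 2 * S + 1 → ∀ F : Finset (Fin 4 → ℤ), F.Nonempty →
            (∀ c ∈ F, ∀ i, -(S : ℤ) ≤ w i (c i) ∧ w i (c i + 1) ≤ (S : ℤ) + 1) →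
              (wilsonMeasure (d := 4) (L := 2 * S + 1) ρ β)
                  {V : GaugeConfig 4 (2 * S + 1) G | ∀ c ∈ F, torusLift (2 * S + 1) V ∉ R c ∩ M c} ≤
                ENNReal.ofReal (δ ^ F.card)

end Format

/-! ## §2 The two-radius intersection family (NEW, all PROVED) -/

section TwoRadius

/-- The sup-ball of cell indices of radius `r` about `c`. -/
def ball (r : ℕ) (c : Fin 4 → ℤ) : Finset (Fin 4 → ℤ) :=
  Fintype.piFinset fun i => Finset.Icc (c i - r) (c i + r)

omit [Group G] [TopologicalSpace G] [IsTopologicalGroup G] [CompactSpace G] [MeasurableSpace G] [BorelSpace G] in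
theorem mem_ball {r : ℕ} {c c₀ : Fin 4 → ℤ} : c₀ ∈ ball r c ↔ ∀ i, |c₀ i - c i| ≤ r := by
  simp only [ball, Fintype.mem_piFinset, Finset.mem_Icc, abs_le]
  refine forall_congr' fun i => ?_
  constructor <;> rintro ⟨h1, h2⟩ <;> constructor <;> linarith

omit [Group G] [TopologicalSpace G] [IsTopologicalGroup G] [CompactSpace G] [MeasurableSpace G] [BorelSpace G] in
theorem card_ball (r : ℕ) (c : Fin 4 → ℤ) : (ball r c).card = (2 * r + 1) ^ 4 := by
  rw [ball, Fintype.card_piFinset]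
  have h : ∀ i, (Finset.Icc (c i - r) (c i + r)).card = 2 * r + 1 := by
    intro i
    rw [Int.card_Icc]
    have : c i + ↑r + 1 - (c i - ↑r) = ((2 * r + 1 : ℕ) : ℤ) := by push_cast; ring
    rw [this, Int.toNat_natCast]
  simp only [h, Finset.prod_const, Finset.card_univ, Fintype.card_fin]

omit [Group G] [TopologicalSpace G] [IsTopologicalGroup G] [CompactSpace G] [MeasurableSpace G] [BorelSpace G] in
theorem ball_mono {r r' : ℕ} (h : r ≤ r') (c : Fin 4 → ℤ) : ball r c ⊆ ball r' c := by
  intro c₀ hc₀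
  rw [mem_ball] at hc₀ ⊢
  exact fun i => (hc₀ i).trans (by exact_mod_cast h)

omit [Group G] [TopologicalSpace G] [IsTopologicalGroup G] [CompactSpace G] [MeasurableSpace G] [BorelSpace G] in
/-- A centre within `r` of `c` is within `r + 1` of every radius-1 neighbour `c'` of `c` (the guard closure). -/
theorem mem_ball_of_near {r : ℕ} {c c' c₀ : Fin 4 → ℤ} (h : c₀ ∈ ball r c) (hc' : ∀ i, |c' i - c i| ≤ 1) :
    c₀ ∈ ball (r + 1) c' := by
  rw [mem_ball] at h ⊢
  intro i
  have h1 := h i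
  have h2 := hc' i
  rw [abs_le] at h1 h2 ⊢
  push_cast
  constructor <;> linarith [h1.1, h1.2, h2.1, h2.2]

omit [Group G] [TopologicalSpace G] [IsTopologicalGroup G] [CompactSpace G] [MeasurableSpace G] [BorelSpace G] in
/-- A window-plus-shell cell `c` (sup-norm `≤ 2n+1`) of centre `c₀` — i.e. the cell `c + c₀` of `w` — has `c₀` within any
radius `r ≥ 2n+1` of it. -/
theorem centre_mem_ball {n r : ℕ} {c : Fin 4 → ℤ} (hc : c ∈ windowCellsPlus n) (hr : 2 * n + 1 ≤ r)
    (c₀ : Fin 4 → ℤ) : c₀ ∈ ball r (c + c₀) := by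
  rw [mem_ball]
  intro i
  have h := (Fintype.mem_piFinset.mp hc) i
  rw [Finset.mem_Icc] at h
  rw [abs_le, Pi.add_apply]
  have hr' : (2 * (n : ℤ) + 1) ≤ (r : ℤ) := by exact_mod_cast hr
  constructor <;> linarith [h.1, h.2]

variable (n : ℕ) (R M : (Fin 4 → ℤ) → (Fin 4 → ℤ) → Set (LGConfig 4 G))

/-- **Rough tier of the two-radius family**: `R' c₀`-typical at `c` for EVERY centre `c₀` within `2n+2` of `c`. -/
def interR (c : Fin 4 → ℤ) : Set (LGConfig 4 G) := ⋂ c₀ ∈ ball (2 * n + 2) c, R c₀ c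

/-- **Mild tier of the two-radius family**: `M' c₀`-typical at `c` for every centre `c₀` within `2n+1` of `c`. -/
def interM (c : Fin 4 → ℤ) : Set (LGConfig 4 G) := ⋂ c₀ ∈ ball (2 * n + 1) c, M c₀ c

variable {n R M}

omit [Group G] [TopologicalSpace G] [IsTopologicalGroup G] [CompactSpace G] [BorelSpace G] in
theorem measurableSet_interR (hRm : ∀ c₀ c, MeasurableSet (R c₀ c)) (c : Fin 4 → ℤ) :
    MeasurableSet (interR n R c) :=
  Finset.measurableSet_biInter _ fun c₀ _ => hRm c₀ c

omit [Group G] [TopologicalSpace G] [IsTopologicalGroup G] [CompactSpace G] [BorelSpace G] in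
theorem measurableSet_interM (hMm : ∀ c₀ c, MeasurableSet (M c₀ c)) (c : Fin 4 → ℤ) :
    MeasurableSet (interM n M c) :=
  Finset.measurableSet_biInter _ fun c₀ _ => hMm c₀ c

omit [Group G] [TopologicalSpace G] [IsTopologicalGroup G] [CompactSpace G] [MeasurableSpace G] [BorelSpace G] in
/-- (a) cell-locality of the rough tier. -/
theorem dependsOn_interR {w : Fin 4 → ℤ → ℤ}
    (hRd : ∀ c₀ c, DependsOn (fun σ : LGConfig 4 G => σ ∈ R c₀ c) ↑(cellEdges w c)) (c : Fin 4 → ℤ) :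
    DependsOn (fun σ : LGConfig 4 G => σ ∈ interR n R c) ↑(cellEdges w c) := by
  intro σ σ' hσ
  simp only [interR, Set.mem_iInter₂, eq_iff_iff]
  exact forall₂_congr fun c₀ _ => Iff.of_eq (hRd c₀ c hσ)

omit [Group G] [TopologicalSpace G] [IsTopologicalGroup G] [CompactSpace G] [MeasurableSpace G] [BorelSpace G] in
/-- (a) cell-locality of the mild tier. -/
theorem dependsOn_interM {w : Fin 4 → ℤ → ℤ}
    (hMd : ∀ c₀ c, DependsOn (fun σ : LGConfig 4 G => σ ∈ M c₀ c) ↑(cellEdges w c)) (c : Fin 4 → ℤ) :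
    DependsOn (fun σ : LGConfig 4 G => σ ∈ interM n M c) ↑(cellEdges w c) := by
  intro σ σ' hσ
  simp only [interM, Set.mem_iInter₂, eq_iff_iff]
  exact forall₂_congr fun c₀ _ => Iff.of_eq (hMd c₀ c hσ)

omit [Group G] [TopologicalSpace G] [IsTopologicalGroup G] [CompactSpace G] [MeasurableSpace G] [BorelSpace G] in
/-- (a) cell-locality of the two-radius family. -/
theorem dependsOn_inter {w : Fin 4 → ℤ → ℤ}
    (hRd : ∀ c₀ c, DependsOn (fun σ : LGConfig 4 G => σ ∈ R c₀ c) ↑(cellEdges w c))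
    (hMd : ∀ c₀ c, DependsOn (fun σ : LGConfig 4 G => σ ∈ M c₀ c) ↑(cellEdges w c)) (c : Fin 4 → ℤ) :
    DependsOn (fun σ : LGConfig 4 G => σ ∈ interR n R c ∩ interM n M c) ↑(cellEdges w c) := by
  intro σ σ' hσ
  have h1 := dependsOn_interR (n := n) hRd c hσ
  have h2 := dependsOn_interM (n := n) hMd c hσ
  simp only [Set.mem_inter_iff, eq_iff_iff] at h1 h2 ⊢
  exact and_congr h1 h2

/-- **(b) clause (i) AT ALL CENTRES for the two-radius family** from clause (i) at centre `c₀` for the `c₀`-th factor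
`R c₀ ∩ M c₀` (each stated on the shifted frame `shiftFrame w c₀`, re-indexed family `c ↦ · (c + c₀)`): on the window-plus-
shell of centre `c₀` the intersections CONTAIN the `c₀`-th factors, so typicality for the family implies typicality for the
factor and the factor's mixing bound applies verbatim. -/
theorem clauseIAll_inter {N : ℕ} {ρ : G →* Matrix (Fin N) (Fin N) ℂ} {β : ℝ} {w : Fin 4 → ℤ → ℤ} {ε : ℝ}
    (hI : ∀ c₀, ClauseI ρ β (shiftFrame w c₀) n ε (fun c => R c₀ (c + c₀) ∩ M c₀ (c + c₀))) :
    ClauseIAll ρ β w n ε (fun c => interR n R c ∩ interM n M c) := by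
  intro c₀ Y hY h0 σ σ' htyp hagree f hf hfm hf01
  refine hI c₀ Y hY h0 σ σ' (fun c hc hcY => ?_) hagree f hf hfm hf01
  obtain ⟨⟨hσR, hσM⟩, ⟨hσ'R, hσ'M⟩⟩ := htyp c hc hcY
  have h2 : c₀ ∈ ball (2 * n + 2) (c + c₀) := centre_mem_ball hc (by omega) c₀
  have h1 : c₀ ∈ ball (2 * n + 1) (c + c₀) := centre_mem_ball hc le_rfl c₀
  simp only [interR, interM, Set.mem_iInter₂] at hσR hσM hσ'R hσ'M
  exact ⟨⟨hσR c₀ h2, hσM c₀ h1⟩, ⟨hσ'R c₀ h2, hσ'M c₀ h1⟩⟩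

/-- **(c) any-exterior single-cell rarity of the rough tier**, budget `(4n+5)⁴ · δR` (union bound over the centres). -/
theorem supCellRarityAt_interR {N : ℕ} {ρ : G →* Matrix (Fin N) (Fin N) ℂ} {β : ℝ} {w : Fin 4 → ℤ → ℤ} {δR : ℝ}
    (hR : ∀ c₀, SupCellRarityAt ρ β w (R c₀) δR) :
    SupCellRarityAt ρ β w (interR n R) ((((2 * (2 * n + 2) + 1) ^ 4 : ℕ) : ℝ) * δR) := by
  intro c ζ
  rw [interR, Set.compl_iInter₂]
  calc (ymSpecification ρ β (regionEdges w {c}) ζ) (⋃ c₀ ∈ ball (2 * n + 2) c, (R c₀ c)ᶜ)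
      ≤ ∑ c₀ ∈ ball (2 * n + 2) c, (ymSpecification ρ β (regionEdges w {c}) ζ) (R c₀ c)ᶜ :=
        measure_biUnion_finset_le _ _
    _ ≤ ∑ c₀ ∈ ball (2 * n + 2) c, ENNReal.ofReal δR := Finset.sum_le_sum fun c₀ _ => hR c₀ c ζ
    _ = ENNReal.ofReal ((((2 * (2 * n + 2) + 1) ^ 4 : ℕ) : ℝ) * δR) := by
        rw [Finset.sum_const, card_ball, nsmul_eq_mul, ENNReal.ofReal_mul (Nat.cast_nonneg _),
          ENNReal.ofReal_natCast]

/-- **(d) THE GUARD CLOSES — conditional single-cell rarity of the mild tier given the rough tier**, budget `(4n+3)⁴ · δM`: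
if `σ ∈ interR c` is `interM`-atypical at `c`, some centre `c₀` within `2n+1` has `σ ∈ R c₀ c ∩ (M c₀ c)ᶜ`; the guard
«every radius-1 neighbour `c'` of `c` is `interR`-typical in `ζ`» gives `ζ ∈ R c₀ c'` because `‖c₀ − c'‖∞ ≤ 2n+2`, which is
exactly the guard of the `c₀`-th conditional rarity. -/
theorem condCellRarityAt_inter {N : ℕ} {ρ : G →* Matrix (Fin N) (Fin N) ℂ} {β : ℝ} {w : Fin 4 → ℤ → ℤ} {δM : ℝ}
    (hM : ∀ c₀, CondCellRarityAt ρ β w (R c₀) (M c₀) δM) :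
    CondCellRarityAt ρ β w (interR n R) (interM n M) ((((2 * (2 * n + 1) + 1) ^ 4 : ℕ) : ℝ) * δM) := by
  intro c ζ hguard
  have hsub : interR n R c ∩ (interM n M c)ᶜ ⊆ ⋃ c₀ ∈ ball (2 * n + 1) c, (R c₀ c ∩ (M c₀ c)ᶜ) := by
    rintro σ ⟨hσR, hσM⟩
    simp only [interM, Set.mem_compl_iff, Set.mem_iInter₂, not_forall, exists_prop] at hσM
    obtain ⟨c₀, hc₀, hnot⟩ := hσM
    simp only [interR, Set.mem_iInter₂] at hσR
    simp only [Set.mem_iUnion₂]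
    exact ⟨c₀, hc₀, hσR c₀ (ball_mono (by omega) c hc₀), hnot⟩
  have hg : ∀ c₀ ∈ ball (2 * n + 1) c, ∀ c' : Fin 4 → ℤ, (∀ i, |c' i - c i| ≤ 1) → c' ≠ c → ζ ∈ R c₀ c' := by
    intro c₀ hc₀ c' hc' hne
    have hζ := hguard c' hc' hne
    simp only [interR, Set.mem_iInter₂] at hζ
    exact hζ c₀ (mem_ball_of_near hc₀ hc')
  calc (ymSpecification ρ β (regionEdges w {c}) ζ) (interR n R c ∩ (interM n M c)ᶜ)
      ≤ (ymSpecification ρ β (regionEdges w {c}) ζ) (⋃ c₀ ∈ ball (2 * n + 1) c, (R c₀ c ∩ (M c₀ c)ᶜ)) :=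
        measure_mono hsub
    _ ≤ ∑ c₀ ∈ ball (2 * n + 1) c, (ymSpecification ρ β (regionEdges w {c}) ζ) (R c₀ c ∩ (M c₀ c)ᶜ) :=
        measure_biUnion_finset_le _ _
    _ ≤ ∑ c₀ ∈ ball (2 * n + 1) c, ENNReal.ofReal δM :=
        Finset.sum_le_sum fun c₀ hc₀ => hM c₀ c ζ (hg c₀ hc₀)
    _ = ENNReal.ofReal ((((2 * (2 * n + 1) + 1) ^ 4 : ℕ) : ℝ) * δM) := by
        rw [Finset.sum_const, card_ball, nsmul_eq_mul, ENNReal.ofReal_mul (Nat.cast_nonneg _),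
          ENNReal.ofReal_natCast]

end TwoRadius

/-! ## §3 The adapter: cplan's ARCH-C per-frame tiered data + the two tower targets ⟹ U^c (PROVED) -/

section Adapter

omit [Group G] [TopologicalSpace G] [IsTopologicalGroup G] [CompactSpace G] [MeasurableSpace G] [BorelSpace G] in
/-- The one-cell kernel region of the shifted frame, re-indexed: cell `c − c₀` of `shiftFrame w c₀` is cell `c` of `w`. -/
theorem regionEdges_shiftFrame_singleton (w : Fin 4 → ℤ → ℤ) (c₀ c : Fin 4 → ℤ) :
    regionEdges (shiftFrame w c₀) {c - c₀} = regionEdges w {c} := by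
  rw [regionEdges_shiftFrame, Finset.singleton_biUnion, sub_add_cancel]
  simp only [regionEdges, Finset.singleton_biUnion]

omit [Group G] [TopologicalSpace G] [IsTopologicalGroup G] [CompactSpace G] [MeasurableSpace G] [BorelSpace G] in
/-- Radius-1 neighbours translate. -/
theorem near_sub_iff {c c' c₀ : Fin 4 → ℤ} :
    (∀ i, |(c' - c₀) i - (c - c₀) i| ≤ 1) ↔ ∀ i, |c' i - c i| ≤ 1 := by
  refine forall_congr' fun i => ?_
  rw [Pi.sub_apply, Pi.sub_apply, sub_sub_sub_cancel_right]

/-- Re-indexing any-exterior rarity from the shifted frame to `w`-coordinates. -/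
theorem supCellRarityAt_reindex {N : ℕ} {ρ : G →* Matrix (Fin N) (Fin N) ℂ} {β : ℝ} {w : Fin 4 → ℤ → ℤ}
    {c₀ : Fin 4 → ℤ} {T : (Fin 4 → ℤ) → Set (LGConfig 4 G)} {δ : ℝ}
    (h : SupCellRarityAt ρ β (shiftFrame w c₀) T δ) : SupCellRarityAt ρ β w (fun c => T (c - c₀)) δ := by
  intro c ζ
  have h' := h (c - c₀) ζ
  rwa [regionEdges_shiftFrame_singleton] at h'

/-- Re-indexing conditional rarity from the shifted frame to `w`-coordinates. -/
theorem condCellRarityAt_reindex {N : ℕ} {ρ : G →* Matrix (Fin N) (Fin N) ℂ} {β : ℝ} {w : Fin 4 → ℤ → ℤ}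
    {c₀ : Fin 4 → ℤ} {T T' : (Fin 4 → ℤ) → Set (LGConfig 4 G)} {δ : ℝ}
    (h : CondCellRarityAt ρ β (shiftFrame w c₀) T T' δ) :
    CondCellRarityAt ρ β w (fun c => T (c - c₀)) (fun c => T' (c - c₀)) δ := by
  intro c ζ hg
  have h' := h (c - c₀) ζ (fun c'' hc'' hne => by
    have h1 : ∀ i, |(c'' + c₀) i - c i| ≤ 1 := by
      intro i
      have := hc'' i
      rwa [Pi.sub_apply, show c'' i - (c i - c₀ i) = (c'' + c₀) i - c i by rw [Pi.add_apply]; ring] at this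
    have h2 : c'' + c₀ ≠ c := fun heq => hne (by rw [← heq, add_sub_cancel_right])
    have := hg (c'' + c₀) h1 h2
    simpa only [add_sub_cancel_right] using this)
  rwa [regionEdges_shiftFrame_singleton] at h'

omit [Group G] [TopologicalSpace G] [IsTopologicalGroup G] [CompactSpace G] [MeasurableSpace G] [BorelSpace G] in
/-- Re-indexing cell-locality from the shifted frame to `w`-coordinates. -/
theorem dependsOn_reindex {w : Fin 4 → ℤ → ℤ} {c₀ : Fin 4 → ℤ} {T : (Fin 4 → ℤ) → Set (LGConfig 4 G)}
    (h : ∀ c, DependsOn (fun σ : LGConfig 4 G => σ ∈ T c) ↑(cellEdges (shiftFrame w c₀) c)) (c : Fin 4 → ℤ) :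
    DependsOn (fun σ : LGConfig 4 G => σ ∈ T (c - c₀)) ↑(cellEdges w c) := by
  have h' := h (c - c₀)
  rwa [cellEdges_shiftFrame, sub_add_cancel] at h'

/-- **THE ADAPTER (PROVED).**  cplan's ARCH-C hypotheses VERBATIM in shape — per mesh-`b` frame two measurable cell-local
tiers `R`, `M` with clause (i) AT THE CENTRE `0` for `R ∩ M`, any-exterior rarity `δR` of `R`, conditional rarity `δM` of
`M` given `R`-typical neighbours — with budgets `(4n+5)⁴ δR ≤ C δ^k`, `(4n+3)⁴ δM ≤ C δ^k`, plus the two tower targets at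
constants `(k, C)`, give **U^c**: ONE family per frame with clause (i) AT EVERY CENTRE, (ii_U) and (iii_U) at budget `δ`.
The family is the two-radius intersection of §2 built from the data on all the shifted frames `shiftFrame w c₀`; NO
covariance of the supplied tiers under shifts is assumed. -/
theorem typShellCondUKPc_of_clauseI_twoTier {k : ℕ} {C : ℝ} {N : ℕ} {ρ : G →* Matrix (Fin N) (Fin N) ℂ} {β : ℝ}
    {b n : ℕ} (hT : TwoTierTowerConst k C ρ β b) (hT' : TwoTierTorusConst k C ρ β b) {ε δ δR δM : ℝ}
    (hδ0 : 0 ≤ δ) (hδ1 : δ ≤ 1)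
    (hbR : (((4 * n + 5) ^ 4 : ℕ) : ℝ) * δR ≤ C * δ ^ k) (hbM : (((4 * n + 3) ^ 4 : ℕ) : ℝ) * δM ≤ C * δ ^ k)
    (h : ∀ w : Fin 4 → ℤ → ℤ,
      (∀ i j, w i j + ((b : ℕ) : ℤ) ≤ w i (j + 1) ∧ w i (j + 1) ≤ w i j + 2 * ((b : ℕ) : ℤ)) →
        ∃ R M : (Fin 4 → ℤ) → Set (LGConfig 4 G),
          (∀ c, MeasurableSet (R c)) ∧ (∀ c, MeasurableSet (M c)) ∧
          (∀ c, DependsOn (fun σ : LGConfig 4 G => σ ∈ R c) ↑(cellEdges w c)) ∧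
          (∀ c, DependsOn (fun σ : LGConfig 4 G => σ ∈ M c) ↑(cellEdges w c)) ∧
          ClauseI ρ β w n ε (fun c => R c ∩ M c) ∧
          SupCellRarityAt ρ β w R δR ∧ CondCellRarityAt ρ β w R M δM) :
    TypShellCondUKPc ρ β b n ε δ := by
  intro w hw
  -- the data on every shifted frame, indexed by the centre `c₀`
  choose R M hRm hMm hRd hMd hI hR hM using fun c₀ : Fin 4 → ℤ => h (shiftFrame w c₀) (shiftFrame_mesh hw c₀)
  -- re-index to `w`-coordinates
  let R' : (Fin 4 → ℤ) → (Fin 4 → ℤ) → Set (LGConfig 4 G) := fun c₀ c => R c₀ (c - c₀)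
  let M' : (Fin 4 → ℤ) → (Fin 4 → ℤ) → Set (LGConfig 4 G) := fun c₀ c => M c₀ (c - c₀)
  have hR'm : ∀ c₀ c, MeasurableSet (R' c₀ c) := fun c₀ c => hRm c₀ (c - c₀)
  have hM'm : ∀ c₀ c, MeasurableSet (M' c₀ c) := fun c₀ c => hMm c₀ (c - c₀)
  have hR'd : ∀ c₀ c, DependsOn (fun σ : LGConfig 4 G => σ ∈ R' c₀ c) ↑(cellEdges w c) :=
    fun c₀ c => dependsOn_reindex (hRd c₀) c
  have hM'd : ∀ c₀ c, DependsOn (fun σ : LGConfig 4 G => σ ∈ M' c₀ c) ↑(cellEdges w c) :=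
    fun c₀ c => dependsOn_reindex (hMd c₀) c
  have hI' : ∀ c₀, ClauseI ρ β (shiftFrame w c₀) n ε (fun c => R' c₀ (c + c₀) ∩ M' c₀ (c + c₀)) := by
    intro c₀
    have hfun : (fun c => R' c₀ (c + c₀) ∩ M' c₀ (c + c₀)) = fun c => R c₀ c ∩ M c₀ c := by
      funext c
      simp only [R', M', add_sub_cancel_right]
    rw [hfun]
    exact hI c₀
  have hR' : ∀ c₀, SupCellRarityAt ρ β w (R' c₀) δR := fun c₀ => supCellRarityAt_reindex (hR c₀)
  have hM' : ∀ c₀, CondCellRarityAt ρ β w (R' c₀) (M' c₀) δM := fun c₀ => condCellRarityAt_reindex (hM c₀)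
  -- the two-radius family and its tiered rarity at budget `C δ^k`
  have hKR : (2 * (2 * n + 2) + 1) = 4 * n + 5 := by ring
  have hKM : (2 * (2 * n + 1) + 1) = 4 * n + 3 := by ring
  have hsup : SupCellRarityAt ρ β w (interR n R') (C * δ ^ k) := by
    have h1 := supCellRarityAt_interR (n := n) hR'
    rw [hKR] at h1
    exact supCellRarityAt_mono_budget hbR h1
  have hcond : CondCellRarityAt ρ β w (interR n R') (interM n M') (C * δ ^ k) := by
    have h1 := condCellRarityAt_inter (n := n) hM'
    rw [hKM] at h1
    exact condCellRarityAt_mono_budget hbM h1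
  have hmeasR : ∀ c, MeasurableSet (interR n R' c) := measurableSet_interR hR'm
  have hmeasM : ∀ c, MeasurableSet (interM n M' c) := measurableSet_interM hM'm
  have hlocR : ∀ c, DependsOn (fun σ : LGConfig 4 G => σ ∈ interR n R' c) ↑(cellEdges w c) :=
    dependsOn_interR hR'd
  have hlocM : ∀ c, DependsOn (fun σ : LGConfig 4 G => σ ∈ interM n M' c) ↑(cellEdges w c) :=
    dependsOn_interM hM'd
  refine ⟨fun c => interR n R' c ∩ interM n M' c, ⟨fun c => (hmeasR c).inter (hmeasM c), dependsOn_inter hR'd hM'd⟩,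
    clauseIAll_inter hI', ?_, ?_⟩
  · -- (ii_U) from the two-tier tower; the guard weakens `ζ ∈ interR c' ∩ interM c'` to `ζ ∈ interR c'`
    intro F F' hFF' _ ζ hguard
    exact hT w hw (interR n R') (interM n M') hmeasR hmeasM hlocR hlocM δ hδ0 hδ1 hsup hcond F F' hFF' ζ
      fun c hc c' hc' => (hguard c hc c' hc').imp_right fun h' => h'.1
  · -- (iii_U) from the two-tier torus anchor
    intro S hS F hF hbox
    exact hT' w hw (interR n R') (interM n M') hmeasR hmeasM hlocR hlocM δ hδ0 hδ1 hsup hcond S hS F hF hbox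

/-- **ARCH-AE case (PROVED corollary).**  Any-exterior-rare classes with clause (i) at centre `0` per frame (cplan
`typShellCondUKP_of_clauseI_supCellRarity` hypotheses, budget `(4n+3)⁴ δT ≤ C δ^k`) already give U^c through the same
two-tier towers with the trivial rough tier. -/
theorem typShellCondUKPc_of_clauseI_supCellRarityAt_twoTier {k : ℕ} {C : ℝ} {N : ℕ}
    {ρ : G →* Matrix (Fin N) (Fin N) ℂ} {β : ℝ} {b n : ℕ} (hT : TwoTierTowerConst k C ρ β b)
    (hT' : TwoTierTorusConst k C ρ β b) {ε δ δT : ℝ} (hδ0 : 0 ≤ δ) (hδ1 : δ ≤ 1) (hC : 0 ≤ C * δ ^ k)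
    (hbT : (((4 * n + 3) ^ 4 : ℕ) : ℝ) * δT ≤ C * δ ^ k)
    (h : ∀ w : Fin 4 → ℤ → ℤ,
      (∀ i j, w i j + ((b : ℕ) : ℤ) ≤ w i (j + 1) ∧ w i (j + 1) ≤ w i j + 2 * ((b : ℕ) : ℤ)) →
        ∃ Typ : (Fin 4 → ℤ) → Set (LGConfig 4 G),
          (∀ c, MeasurableSet (Typ c)) ∧ (∀ c, DependsOn (fun σ : LGConfig 4 G => σ ∈ Typ c) ↑(cellEdges w c)) ∧
          ClauseI ρ β w n ε Typ ∧ SupCellRarityAt ρ β w Typ δT) :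
    TypShellCondUKPc ρ β b n ε δ := by
  refine typShellCondUKPc_of_clauseI_twoTier hT hT' (δR := 0) hδ0 hδ1 (by simpa using hC) hbT fun w hw => ?_
  obtain ⟨Typ, hm, hd, hi, h1⟩ := h w hw
  refine ⟨fun _ => Set.univ, Typ, fun _ => MeasurableSet.univ, hm, fun c σ σ' _ => by simp, hd, ?_,
    fun c ζ => by simp, condCellRarityAt_of_supCellRarityAt _ h1⟩
  have hfun : (fun c => (Set.univ : Set (LGConfig 4 G)) ∩ Typ c) = Typ := by funext c; rw [Set.univ_inter]
  rw [hfun]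
  exact hi

end Adapter

/-! ## §4 The box instance of the port (g6 §3/§5 defs VERBATIM) and its bookkeeping (all PROVED) -/

section Box

/-- The cells of the box with lowest corner `x₀` and `m` cells per side. [g6 §3] -/
def boxCells (x₀ : Fin 4 → ℤ) (m : ℕ) : Finset (Fin 4 → ℤ) :=
  Fintype.piFinset fun i : Fin 4 => Finset.Ico (x₀ i) (x₀ i + m)

/-- Sup-distance of cell indices in `ℤ⁴`. [g6 §3] -/
def cellDist (x y : Fin 4 → ℤ) : ℕ :=
  Finset.univ.sup fun i : Fin 4 => (x i - y i).natAbs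

/-- The links of the box. [g6 §5] -/
def boxEdges (w : Fin 4 → ℤ → ℤ) (x₀ : Fin 4 → ℤ) (m : ℕ) :
    Finset (Literature.MathematicalPhysics.QuantumLattice.ZdEdge 4) :=
  regionEdges w (boxCells x₀ m)

/-- **Site type `V` of the box specification**: the links of the box cells. [g6 §5] -/
abbrev BoxLink (w : Fin 4 → ℤ → ℤ) (x₀ : Fin 4 → ℤ) (m : ℕ) : Type :=
  ↥(boxEdges w x₀ m)

/-- **The padded coarse torus**: `2m + 4n + 3` labels per axis (box layers + phantom layers). [g6 §5] -/
def boxMod (m n : ℕ) : Fin 4 → ℕ := fun _ => 2 * m + 4 * n + 2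

/-- The coarse label of the `ℤ⁴` cell `y`. [g6 §5] -/
def boxLabel (x₀ : Fin 4 → ℤ) (m n : ℕ) (y : Fin 4 → ℤ) : CoarseIdx (boxMod m n) :=
  fun i => ((y i - x₀ i : ℤ) : ZMod (boxMod m n i + 1))

/-- **The cell map `cell : V → CoarseIdx μc`** of the instance. [g6 §5] -/
def boxCell (w : Fin 4 → ℤ → ℤ) (x₀ : Fin 4 → ℤ) (m n : ℕ) (e : BoxLink w x₀ m) : CoarseIdx (boxMod m n) :=
  boxLabel x₀ m n (frameCell w e.1)

/-- **Extension of box data** by the padding `pad` off the box. [g6 §5] -/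
def boxExt (w : Fin 4 → ℤ → ℤ) (x₀ : Fin 4 → ℤ) (m : ℕ) (pad : LGConfig 4 G) (ζ : BoxLink w x₀ m → G) :
    LGConfig 4 G :=
  fun e => if h : e ∈ boxEdges w x₀ m then ζ ⟨e, h⟩ else pad e

/-- Restriction of a `ℤ⁴` configuration to the box links. [g6 §5] -/
def boxRestrict (w : Fin 4 → ℤ → ℤ) (x₀ : Fin 4 → ℤ) (m : ℕ) (σ : LGConfig 4 G) : BoxLink w x₀ m → G :=
  fun e => σ e.1

/-- **The box specification `γ^box`**. [g6 §5] -/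
def boxSpec {N : ℕ} (ρ : G →* Matrix (Fin N) (Fin N) ℂ) (β : ℝ) (w : Fin 4 → ℤ → ℤ) (x₀ : Fin 4 → ℤ) (m : ℕ)
    (pad : LGConfig 4 G) : Specification (BoxLink w x₀ m) G :=
  fun A ζ => (ymSpecification ρ β (A.map (Function.Embedding.subtype fun e => e ∈ boxEdges w x₀ m))
    (boxExt w x₀ m pad ζ)).map
    (boxRestrict w x₀ m)

/-- **The good family of the instance** (phantom labels are good). [g6 §5] -/
def boxGood (w : Fin 4 → ℤ → ℤ) (x₀ : Fin 4 → ℤ) (m n : ℕ) (pad : LGConfig 4 G)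
    (Typ : (Fin 4 → ℤ) → Set (LGConfig 4 G)) : CoarseIdx (boxMod m n) → Set (BoxLink w x₀ m → G) :=
  fun c => {ζ | ∀ y ∈ boxCells x₀ m, boxLabel x₀ m n y = c → boxExt w x₀ m pad ζ ∈ Typ y}

section Obligations

variable {N : ℕ} (ρ : G →* Matrix (Fin N) (Fin N) ℂ) (β : ℝ) (w : Fin 4 → ℤ → ℤ) (x₀ : Fin 4 → ℤ) (m n : ℕ)
  (pad : LGConfig 4 G) (Typ : (Fin 4 → ℤ) → Set (LGConfig 4 G))

/-- **P1** — `γ^box` is a specification. [g6 §5] -/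
def BoxP1 : Prop :=
  IsSpecification (boxSpec ρ β w x₀ m pad)

/-- **P2** — block-Markov: `HasBlockLeak … 0 r` for every `r`. [g6 §5] -/
def BoxP2 : Prop :=
  ∀ r : ℝ, HasBlockLeak (boxCell w x₀ m n) (boxSpec ρ β w x₀ m pad) 0 r

/-- **P3** — the good-exterior finite-size condition of the instance at `(n, ε)`. [g6 §5] -/
def BoxP3 (ε : ℝ) : Prop :=
  IsGoodFS (boxCell w x₀ m n) (boxSpec ρ β w x₀ m pad) (boxGood w x₀ m n pad Typ) n ε

/-- **P4** — the kernel-uniform Peierls bound of the instance at level `δ`. [g6 §5] -/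
def BoxP4 (δ : ℝ) : Prop :=
  UniformKernelPeierls (boxCell w x₀ m n) (boxSpec ρ β w x₀ m pad) (boxGood w x₀ m n pad Typ) δ

end Obligations

/-! ### Bookkeeping of the instance -/

omit [IsTopologicalGroup G] [CompactSpace G] [BorelSpace G] in
/-- A mesh-`b` frame with `b ≥ 1` is strictly increasing. [g6 §5] -/
theorem isFrame_step {b : ℕ} {w : Fin 4 → ℤ → ℤ} (hb : 1 ≤ b) (hw : IsFrame b w) :
    ∀ i j, w i j + 1 ≤ w i (j + 1) := by
  intro i j
  have h := (hw i j).1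
  have hb' : (1 : ℤ) ≤ ((b : ℕ) : ℤ) := by exact_mod_cast hb
  linarith

variable {w : Fin 4 → ℤ → ℤ} {x₀ : Fin 4 → ℤ} {m n : ℕ}

omit [Group G] [TopologicalSpace G] [IsTopologicalGroup G] [CompactSpace G] [MeasurableSpace G] [BorelSpace G] in
/-- A link lies in the box iff its frame cell is a box cell. -/
theorem mem_boxEdges_iff (hw1 : ∀ i j, w i j + 1 ≤ w i (j + 1))
    {e : Literature.MathematicalPhysics.QuantumLattice.ZdEdge 4} :
    e ∈ boxEdges w x₀ m ↔ frameCell w e ∈ boxCells x₀ m := by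
  simp only [boxEdges, Summit.QuantumFields.YangMills.Cruxes.IR.Tempered.regionEdges, Finset.mem_biUnion]
  constructor
  · rintro ⟨y, hy, he⟩
    rwa [(frameCell_eq_iff hw1 e y).2 he]
  · intro h
    exact ⟨frameCell w e, h, mem_cellEdges_frameCell hw1 e⟩

omit [Group G] [TopologicalSpace G] [IsTopologicalGroup G] [CompactSpace G] [MeasurableSpace G] [BorelSpace G] in
theorem frameCell_mem_boxCells (hw1 : ∀ i j, w i j + 1 ≤ w i (j + 1)) (v : BoxLink w x₀ m) :
    frameCell w v.1 ∈ boxCells x₀ m :=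
  (mem_boxEdges_iff hw1).1 v.2

omit [Group G] [TopologicalSpace G] [IsTopologicalGroup G] [CompactSpace G] [MeasurableSpace G] [BorelSpace G] in
theorem boxCell_eq (v : BoxLink w x₀ m) : boxCell w x₀ m n v = boxLabel x₀ m n (frameCell w v.1) := rfl

omit [Group G] [TopologicalSpace G] [IsTopologicalGroup G] [CompactSpace G] [MeasurableSpace G] [BorelSpace G] in
/-- The base link of a cell lies in the cell (cells of a strictly increasing frame are nonempty). -/
theorem base_mem_cellEdges (hw1 : ∀ i j, w i j + 1 ≤ w i (j + 1)) (y : Fin 4 → ℤ) :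
    ((fun i => w i (y i), (0 : Fin 4)) : Literature.MathematicalPhysics.QuantumLattice.ZdEdge 4) ∈
      cellEdges w y := by
  simp only [Summit.QuantumFields.YangMills.Cruxes.IR.Tempered.cellEdges, Finset.mem_product, Fintype.mem_piFinset,
    Finset.mem_Ico, Finset.mem_univ, and_true]
  intro i
  have := hw1 i (y i)
  constructor <;> linarith

/-! #### Label arithmetic: on box cells the cyclic label distance is the `ℤ⁴` cell distance -/

omit [Group G] [TopologicalSpace G] [IsTopologicalGroup G] [CompactSpace G] [MeasurableSpace G] [BorelSpace G] in
theorem boxLabel_sub (y y' : Fin 4 → ℤ) (i : Fin 4) :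
    boxLabel x₀ m n y i - boxLabel x₀ m n y' i = ((y i - y' i : ℤ) : ZMod (boxMod m n i + 1)) := by
  simp only [boxLabel]
  push_cast
  ring

omit [Group G] [TopologicalSpace G] [IsTopologicalGroup G] [CompactSpace G] [MeasurableSpace G] [BorelSpace G] in
theorem abs_sub_lt_of_mem_boxCells {y y' : Fin 4 → ℤ} (hy : y ∈ boxCells x₀ m) (hy' : y' ∈ boxCells x₀ m)
    (i : Fin 4) : |y i - y' i| < m := by
  have h1 := (Fintype.mem_piFinset.mp hy) i
  have h2 := (Fintype.mem_piFinset.mp hy') i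
  rw [Finset.mem_Ico] at h1 h2
  rw [abs_lt]
  constructor <;> linarith [h1.1, h1.2, h2.1, h2.2]

omit [Group G] [TopologicalSpace G] [IsTopologicalGroup G] [CompactSpace G] [MeasurableSpace G] [BorelSpace G] in
theorem valMinAbs_boxLabel_sub {y y' : Fin 4 → ℤ} (hy : y ∈ boxCells x₀ m) (hy' : y' ∈ boxCells x₀ m)
    (i : Fin 4) : (boxLabel x₀ m n y i - boxLabel x₀ m n y' i).valMinAbs = y i - y' i := by
  rw [boxLabel_sub, ZMod.valMinAbs_spec]
  have h := abs_sub_lt_of_mem_boxCells hy hy' i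
  rw [abs_lt] at h
  refine ⟨rfl, ?_, ?_⟩
  · simp only [boxMod]
    push_cast
    linarith [h.1]
  · simp only [boxMod]
    push_cast
    linarith [h.2]

omit [Group G] [TopologicalSpace G] [IsTopologicalGroup G] [CompactSpace G] [MeasurableSpace G] [BorelSpace G] in
/-- **No wrap-around**: for box cells the engine's cyclic `cdist` of the labels is the `ℤ⁴` `cellDist`. -/
theorem cdist_boxLabel {y y' : Fin 4 → ℤ} (hy : y ∈ boxCells x₀ m) (hy' : y' ∈ boxCells x₀ m) :
    cdist (boxLabel x₀ m n y) (boxLabel x₀ m n y') = cellDist y y' := by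
  simp only [cdist, cellDist, valMinAbs_boxLabel_sub hy hy']

omit [Group G] [TopologicalSpace G] [IsTopologicalGroup G] [CompactSpace G] [MeasurableSpace G] [BorelSpace G] in
theorem cellDist_le_iff {y y' : Fin 4 → ℤ} {r : ℕ} : cellDist y y' ≤ r ↔ ∀ i, |y i - y' i| ≤ r := by
  simp only [cellDist, Finset.sup_le_iff, Finset.mem_univ, forall_true_left]
  refine forall_congr' fun i => ?_
  rw [← Nat.cast_le (α := ℤ), Int.natCast_natAbs]

omit [Group G] [TopologicalSpace G] [IsTopologicalGroup G] [CompactSpace G] [MeasurableSpace G] [BorelSpace G] in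
/-- Labels are injective on box cells. -/
theorem boxLabel_injOn : Set.InjOn (boxLabel x₀ m n) ↑(boxCells x₀ m) := by
  intro y hy y' hy' h
  funext i
  have h0 : (boxLabel x₀ m n y i - boxLabel x₀ m n y' i).valMinAbs = 0 := by
    rw [congr_fun h i, sub_self, ZMod.valMinAbs_zero]
  rw [valMinAbs_boxLabel_sub hy hy'] at h0
  linarith

/-! #### Saturated link sets are cell unions -/

/-- The box cells met by a set of box links. -/
def cellsOf (w : Fin 4 → ℤ → ℤ) (x₀ : Fin 4 → ℤ) (m : ℕ) (A : Finset (BoxLink w x₀ m)) : Finset (Fin 4 → ℤ) :=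
  A.image fun v => frameCell w v.1

omit [Group G] [TopologicalSpace G] [IsTopologicalGroup G] [CompactSpace G] [MeasurableSpace G] [BorelSpace G] in
theorem cellsOf_subset (hw1 : ∀ i j, w i j + 1 ≤ w i (j + 1)) (A : Finset (BoxLink w x₀ m)) :
    cellsOf w x₀ m A ⊆ boxCells x₀ m := by
  intro y hy
  obtain ⟨v, _, rfl⟩ := Finset.mem_image.1 hy
  exact frameCell_mem_boxCells hw1 v

omit [Group G] [TopologicalSpace G] [IsTopologicalGroup G] [CompactSpace G] [MeasurableSpace G] [BorelSpace G] in
/-- In a cell-saturated link set, a link whose cell is met is a member. -/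
theorem mem_of_frameCell_mem_cellsOf {A : Finset (BoxLink w x₀ m)}
    (hsat : ∀ u v : BoxLink w x₀ m, boxCell w x₀ m n u = boxCell w x₀ m n v → u ∈ A → v ∈ A)
    {v : BoxLink w x₀ m} (h : frameCell w v.1 ∈ cellsOf w x₀ m A) : v ∈ A := by
  obtain ⟨u, hu, heq⟩ := Finset.mem_image.1 h
  exact hsat u v (by rw [boxCell_eq, boxCell_eq, heq]) hu

omit [Group G] [TopologicalSpace G] [IsTopologicalGroup G] [CompactSpace G] [MeasurableSpace G] [BorelSpace G] in
/-- A box cell all of whose links are in `A` is met by `A`. -/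
theorem mem_cellsOf_of_forall (hw1 : ∀ i j, w i j + 1 ≤ w i (j + 1)) {A : Finset (BoxLink w x₀ m)}
    {y : Fin 4 → ℤ} (hy : y ∈ boxCells x₀ m)
    (h : ∀ v : BoxLink w x₀ m, boxCell w x₀ m n v = boxLabel x₀ m n y → v ∈ A) : y ∈ cellsOf w x₀ m A := by
  have he := base_mem_cellEdges hw1 y
  have hfe : frameCell w ((fun i => w i (y i), (0 : Fin 4)) :
      Literature.MathematicalPhysics.QuantumLattice.ZdEdge 4) = y := (frameCell_eq_iff hw1 _ _).2 he
  have hbox : ((fun i => w i (y i), (0 : Fin 4)) : Literature.MathematicalPhysics.QuantumLattice.ZdEdge 4) ∈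
      boxEdges w x₀ m := (mem_boxEdges_iff hw1).2 (by rw [hfe]; exact hy)
  have hv := h ⟨_, hbox⟩ (by rw [boxCell_eq, hfe])
  exact Finset.mem_image.2 ⟨_, hv, hfe⟩

omit [Group G] [TopologicalSpace G] [IsTopologicalGroup G] [CompactSpace G] [MeasurableSpace G] [BorelSpace G] in
/-- **A cell-saturated set of box links is the link set of the cells it meets.** -/
theorem map_subtype_eq_regionEdges (hw1 : ∀ i j, w i j + 1 ≤ w i (j + 1)) {A : Finset (BoxLink w x₀ m)}
    (hsat : ∀ u v : BoxLink w x₀ m, boxCell w x₀ m n u = boxCell w x₀ m n v → u ∈ A → v ∈ A) :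
    A.map (Function.Embedding.subtype fun e => e ∈ boxEdges w x₀ m) = regionEdges w (cellsOf w x₀ m A) := by
  ext e
  simp only [Finset.mem_map, Summit.QuantumFields.YangMills.Cruxes.IR.Tempered.regionEdges, Finset.mem_biUnion]
  constructor
  · rintro ⟨v, hv, rfl⟩
    exact ⟨frameCell w v.1, Finset.mem_image_of_mem _ hv, mem_cellEdges_frameCell hw1 _⟩
  · rintro ⟨y, hy, he⟩
    have hfe : frameCell w e = y := (frameCell_eq_iff hw1 e y).2 he
    have hbox : e ∈ boxEdges w x₀ m := (mem_boxEdges_iff hw1).2 (by rw [hfe]; exact cellsOf_subset hw1 A hy)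
    refine ⟨⟨e, hbox⟩, mem_of_frameCell_mem_cellsOf hsat (by rw [hfe]; exact hy), rfl⟩

/-! #### Extension / restriction -/

omit [Group G] [TopologicalSpace G] [IsTopologicalGroup G] [CompactSpace G] [MeasurableSpace G] [BorelSpace G] in
theorem boxExt_apply_of_mem {pad : LGConfig 4 G} {ζ : BoxLink w x₀ m → G}
    {e : Literature.MathematicalPhysics.QuantumLattice.ZdEdge 4} (h : e ∈ boxEdges w x₀ m) :
    boxExt w x₀ m pad ζ e = ζ ⟨e, h⟩ := by
  simp only [boxExt, h, dite_true]

omit [Group G] [TopologicalSpace G] [IsTopologicalGroup G] [CompactSpace G] [MeasurableSpace G] [BorelSpace G] in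
theorem boxExt_apply_of_not_mem {pad : LGConfig 4 G} {ζ : BoxLink w x₀ m → G}
    {e : Literature.MathematicalPhysics.QuantumLattice.ZdEdge 4} (h : e ∉ boxEdges w x₀ m) :
    boxExt w x₀ m pad ζ e = pad e := by
  simp only [boxExt, h, dite_false]

omit [Group G] [TopologicalSpace G] [IsTopologicalGroup G] [CompactSpace G] [MeasurableSpace G] [BorelSpace G] in
theorem boxExt_boxRestrict_of_mem {pad σ : LGConfig 4 G} {e : Literature.MathematicalPhysics.QuantumLattice.ZdEdge 4}
    (h : e ∈ boxEdges w x₀ m) : boxExt w x₀ m pad (boxRestrict w x₀ m σ) e = σ e := by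
  rw [boxExt_apply_of_mem h, boxRestrict]

omit [Group G] [TopologicalSpace G] [IsTopologicalGroup G] [CompactSpace G] [BorelSpace G] in
theorem measurable_boxExt (pad : LGConfig 4 G) :
    Measurable (boxExt w x₀ m pad : (BoxLink w x₀ m → G) → LGConfig 4 G) := by
  refine measurable_pi_lambda _ fun e => ?_
  by_cases h : e ∈ boxEdges w x₀ m
  · simp only [boxExt, h, dite_true]
    exact measurable_pi_apply _
  · simp only [boxExt, h, dite_false]
    exact measurable_const

omit [Group G] [TopologicalSpace G] [IsTopologicalGroup G] [CompactSpace G] [BorelSpace G] in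
theorem measurable_boxRestrict : Measurable (boxRestrict w x₀ m : LGConfig 4 G → BoxLink w x₀ m → G) :=
  measurable_pi_lambda _ fun v => measurable_pi_apply v.1

omit [Group G] [TopologicalSpace G] [IsTopologicalGroup G] [CompactSpace G] [MeasurableSpace G] [BorelSpace G] in
/-- Typicality at a BOX cell is read off the box data. -/
theorem mem_typ_boxExt_boxRestrict_iff (hw1 : ∀ i j, w i j + 1 ≤ w i (j + 1))
    {Typ : (Fin 4 → ℤ) → Set (LGConfig 4 G)}
    (hTd : ∀ c, DependsOn (fun σ : LGConfig 4 G => σ ∈ Typ c) ↑(cellEdges w c)) {pad σ : LGConfig 4 G}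
    {y : Fin 4 → ℤ} (hy : y ∈ boxCells x₀ m) : boxExt w x₀ m pad (boxRestrict w x₀ m σ) ∈ Typ y ↔ σ ∈ Typ y := by
  refine Iff.of_eq (hTd y fun e he => boxExt_boxRestrict_of_mem ((mem_boxEdges_iff hw1).2 ?_))
  rw [(frameCell_eq_iff hw1 e y).2 (Finset.mem_coe.1 he)]
  exact hy

omit [Group G] [TopologicalSpace G] [IsTopologicalGroup G] [CompactSpace G] [MeasurableSpace G] [BorelSpace G] in
/-- Typicality at a NON-box cell is typicality of the padding. -/
theorem mem_typ_boxExt_iff_of_not_mem (hw1 : ∀ i j, w i j + 1 ≤ w i (j + 1))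
    {Typ : (Fin 4 → ℤ) → Set (LGConfig 4 G)}
    (hTd : ∀ c, DependsOn (fun σ : LGConfig 4 G => σ ∈ Typ c) ↑(cellEdges w c)) {pad : LGConfig 4 G}
    {ζ : BoxLink w x₀ m → G} {y : Fin 4 → ℤ} (hy : y ∉ boxCells x₀ m) :
    boxExt w x₀ m pad ζ ∈ Typ y ↔ pad ∈ Typ y := by
  refine Iff.of_eq (hTd y fun e he => boxExt_apply_of_not_mem fun hbox => hy ?_)
  rw [← (frameCell_eq_iff hw1 e y).2 (Finset.mem_coe.1 he)]
  exact (mem_boxEdges_iff hw1).1 hbox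

/-! #### The good family: phantom labels, real labels, measurability, locality -/

omit [Group G] [TopologicalSpace G] [IsTopologicalGroup G] [CompactSpace G] [MeasurableSpace G] [BorelSpace G] in
theorem boxGood_of_phantom {pad : LGConfig 4 G} {Typ : (Fin 4 → ℤ) → Set (LGConfig 4 G)}
    {c : CoarseIdx (boxMod m n)} (h : ∀ y ∈ boxCells x₀ m, boxLabel x₀ m n y ≠ c) :
    boxGood w x₀ m n pad Typ c = Set.univ := by
  ext ζ
  simp only [boxGood, Set.mem_setOf_eq, Set.mem_univ, iff_true]
  intro y hy hyc
  exact absurd hyc (h y hy)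

omit [Group G] [TopologicalSpace G] [IsTopologicalGroup G] [CompactSpace G] [MeasurableSpace G] [BorelSpace G] in
theorem mem_boxGood_iff {pad : LGConfig 4 G} {Typ : (Fin 4 → ℤ) → Set (LGConfig 4 G)} {ζ : BoxLink w x₀ m → G}
    {y : Fin 4 → ℤ} (hy : y ∈ boxCells x₀ m) :
    ζ ∈ boxGood w x₀ m n pad Typ (boxLabel x₀ m n y) ↔ boxExt w x₀ m pad ζ ∈ Typ y := by
  constructor
  · intro h
    exact h y hy rfl
  · intro h y' hy' heq
    rw [boxLabel_injOn hy' hy heq]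
    exact h

omit [Group G] [TopologicalSpace G] [IsTopologicalGroup G] [CompactSpace G] [BorelSpace G] in
theorem measurableSet_boxGood {Typ : (Fin 4 → ℤ) → Set (LGConfig 4 G)} (hm : ∀ c, MeasurableSet (Typ c))
    (pad : LGConfig 4 G) (c : CoarseIdx (boxMod m n)) : MeasurableSet (boxGood w x₀ m n pad Typ c) := by
  classical
  have h : boxGood w x₀ m n pad Typ c =
      ⋂ y ∈ (boxCells x₀ m).filter (fun y => boxLabel x₀ m n y = c), boxExt w x₀ m pad ⁻¹' Typ y := by
    ext ζ
    simp only [boxGood, Set.mem_setOf_eq, Set.mem_iInter₂, Finset.mem_filter, Set.mem_preimage, and_imp]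
  rw [h]
  exact Finset.measurableSet_biInter _ fun y _ => (hm y).preimage (measurable_boxExt pad)

omit [Group G] [TopologicalSpace G] [IsTopologicalGroup G] [CompactSpace G] [MeasurableSpace G] [BorelSpace G] in
theorem boxGood_local (hw1 : ∀ i j, w i j + 1 ≤ w i (j + 1)) {Typ : (Fin 4 → ℤ) → Set (LGConfig 4 G)}
    (hTd : ∀ c, DependsOn (fun σ : LGConfig 4 G => σ ∈ Typ c) ↑(cellEdges w c)) (pad : LGConfig 4 G)
    (c : CoarseIdx (boxMod m n)) (σ τ : BoxLink w x₀ m → G) (h : ∀ v, boxCell w x₀ m n v = c → σ v = τ v) :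
    σ ∈ boxGood w x₀ m n pad Typ c ↔ τ ∈ boxGood w x₀ m n pad Typ c := by
  simp only [boxGood, Set.mem_setOf_eq]
  refine forall₂_congr fun y hy => forall_congr' fun hyc => Iff.of_eq (hTd y fun e he => ?_)
  have hfe : frameCell w e = y := (frameCell_eq_iff hw1 e y).2 (Finset.mem_coe.1 he)
  have hbox : e ∈ boxEdges w x₀ m := (mem_boxEdges_iff hw1).2 (by rw [hfe]; exact hy)
  rw [boxExt_apply_of_mem hbox, boxExt_apply_of_mem hbox]
  exact h ⟨e, hbox⟩ (by rw [boxCell_eq, ← hyc]; exact congrArg _ hfe)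

/-! #### The box kernels: value on sets, integrals, probability, frozen cells -/

section Kernels

variable {N : ℕ} {ρ : G →* Matrix (Fin N) (Fin N) ℂ} {β : ℝ}

theorem boxSpec_apply (pad : LGConfig 4 G) (A : Finset (BoxLink w x₀ m)) (ζ : BoxLink w x₀ m → G)
    {S : Set (BoxLink w x₀ m → G)} (hS : MeasurableSet S) :
    boxSpec ρ β w x₀ m pad A ζ S =
      ymSpecification ρ β (A.map (Function.Embedding.subtype fun e => e ∈ boxEdges w x₀ m))
        (boxExt w x₀ m pad ζ) (boxRestrict w x₀ m ⁻¹' S) := by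
  simp only [boxSpec]
  rw [Measure.map_apply measurable_boxRestrict hS]

theorem integral_boxSpec (pad : LGConfig 4 G) (A : Finset (BoxLink w x₀ m)) (ζ : BoxLink w x₀ m → G)
    {f : (BoxLink w x₀ m → G) → ℝ} (hf : Measurable f) :
    ∫ σ, f σ ∂(boxSpec ρ β w x₀ m pad A ζ) =
      ∫ σ, f (boxRestrict w x₀ m σ) ∂(ymSpecification ρ β
        (A.map (Function.Embedding.subtype fun e => e ∈ boxEdges w x₀ m)) (boxExt w x₀ m pad ζ)) := by
  simp only [boxSpec]
  exact integral_map measurable_boxRestrict.aemeasurable hf.aestronglyMeasurable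

theorem isProbabilityMeasure_boxSpec [SecondCountableTopology G] (hρ : Continuous ρ) (pad : LGConfig 4 G)
    (A : Finset (BoxLink w x₀ m)) (ζ : BoxLink w x₀ m → G) : IsProbabilityMeasure (boxSpec ρ β w x₀ m pad A ζ) := by
  haveI := isProbabilityMeasure_ymSpecification (d := 4) ρ hρ β
    (A.map (Function.Embedding.subtype fun e => e ∈ boxEdges w x₀ m)) (boxExt w x₀ m pad ζ)
  exact Measure.isProbabilityMeasure_map measurable_boxRestrict.aemeasurable

/-- **Frozen cells keep the exterior** (properness of the `ℤ⁴` kernels): under the kernel of `E`, a.e. `σ = η` on every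
cell none of whose links is in `E`. -/
theorem ae_eq_on_cell [T2Space G] [SecondCountableTopology G] (hρ : Continuous ρ) (β : ℝ)
    (E : Finset (Literature.MathematicalPhysics.QuantumLattice.ZdEdge 4)) (η : LGConfig 4 G) {y : Fin 4 → ℤ}
    (hoff : ∀ e ∈ cellEdges w y, e ∉ E) :
    ∀ᵐ σ ∂(ymSpecification ρ β E η), ∀ e ∈ cellEdges w y, σ e = η e := by
  filter_upwards [(isSpecification_ymSpecification_of_t2Space (d := 4) ρ hρ β).proper E η] with σ hσ e he
    using hσ e (hoff e he)

end Kernels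

/-! ## §5 P4 PROVED: the UKP clause (ii_U) IS the engine's `UniformKernelPeierls` for the box instance -/

/-- **P4 (PROVED).**  For a mesh-`b ≥ 1` frame, a cell-local family `Typ` with the UKP clause (ii_U) at level `δ` and a
padding typical on every cell, the box instance satisfies the engine's kernel-uniform Peierls bound at level `δ`, for
EVERY box.  (A phantom label in `D` empties the event; a charged real cell that is not resampled is typical a.s. by
properness and the guard; otherwise (ii_U) applies verbatim with `F :=` the charged cells, `F' :=` the resampled cells,
exterior `boxExt pad ζ` — a `ℤ⁴`-neighbour outside the box is typical by the padding.) -/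
theorem boxP4_of_clauseIIukp [T2Space G] [SecondCountableTopology G] {N : ℕ} {ρ : G →* Matrix (Fin N) (Fin N) ℂ}
    (hρ : Continuous ρ) {β : ℝ} {b : ℕ} {w : Fin 4 → ℤ → ℤ} (hb : 1 ≤ b) (hw : IsFrame b w) {n : ℕ} {δ : ℝ}
    {Typ : (Fin 4 → ℤ) → Set (LGConfig 4 G)} (hloc : TypLocal w Typ) (hII : ClauseIIukp ρ β w δ Typ)
    {pad : LGConfig 4 G} (hpad : ∀ c, pad ∈ Typ c) (x₀ : Fin 4 → ℤ) (m : ℕ) :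
    BoxP4 ρ β w x₀ m n pad Typ δ := by
  classical
  have hw1 := isFrame_step hb hw
  intro A hsat ζ D hguard
  have hgm : ∀ c, MeasurableSet (boxGood w x₀ m n pad Typ c) := measurableSet_boxGood hloc.1 pad
  have hSm : MeasurableSet {σ : BoxLink w x₀ m → G | ∀ c ∈ D, σ ∉ boxGood w x₀ m n pad Typ c} :=
    measurableSet_allBad hgm D
  rw [boxSpec_apply pad A ζ hSm]
  set E := A.map (Function.Embedding.subtype fun e => e ∈ boxEdges w x₀ m) with hE
  set η : LGConfig 4 G := boxExt w x₀ m pad ζ with hη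
  -- (α) a phantom label in `D`: the event is empty
  by_cases hph : ∃ c ∈ D, ∀ y ∈ boxCells x₀ m, boxLabel x₀ m n y ≠ c
  · obtain ⟨c, hcD, hc⟩ := hph
    have hempty : boxRestrict w x₀ m ⁻¹' {σ : BoxLink w x₀ m → G | ∀ c ∈ D, σ ∉ boxGood w x₀ m n pad Typ c} = ∅ := by
      ext σ
      simp only [Set.mem_preimage, Set.mem_setOf_eq, Set.mem_empty_iff_false, iff_false]
      intro h
      exact h c hcD (by rw [boxGood_of_phantom hc]; exact Set.mem_univ _)
    rw [hempty, measure_empty]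
    exact zero_le
  push Not at hph
  -- (β) a charged real cell that is not resampled: it is typical a.s. (properness + the guard at distance 0)
  by_cases hres : ∃ c ∈ D, ∃ v : BoxLink w x₀ m, boxCell w x₀ m n v = c ∧ v ∉ A
  · obtain ⟨c, hcD, v₀, hv₀c, hv₀A⟩ := hres
    obtain ⟨y, hy, hyc⟩ := hph c hcD
    have hζ : ζ ∈ boxGood w x₀ m n pad Typ c := by
      rcases hguard c hcD c (by rw [cdist_self]; exact zero_le_one) with h | h
      · exact absurd (h v₀ hv₀c) hv₀A
      · exact h
    have hηy : η ∈ Typ y := by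
      rw [← hyc] at hζ
      exact (mem_boxGood_iff hy).1 hζ
    have hoff : ∀ e ∈ cellEdges w y, e ∉ E := by
      intro e he heE
      rw [hE, Finset.mem_map] at heE
      obtain ⟨v, hvA, hve⟩ := heE
      have hve' : v.1 = e := hve
      have hvc : boxCell w x₀ m n v = c := by
        rw [boxCell_eq, hve', (frameCell_eq_iff hw1 e y).2 he, hyc]
      exact hv₀A (hsat v v₀ (by rw [hvc, hv₀c]) hvA)
    have hae : ∀ᵐ σ ∂(ymSpecification ρ β E η), σ ∈ Typ y := by
      filter_upwards [ae_eq_on_cell hρ β E η hoff] with σ hσ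
      exact (Iff.of_eq (hloc.2 y fun e he => hσ e (Finset.mem_coe.1 he))).2 hηy
    have hsub : boxRestrict w x₀ m ⁻¹' {σ : BoxLink w x₀ m → G | ∀ c ∈ D, σ ∉ boxGood w x₀ m n pad Typ c} ⊆
        {σ : LGConfig 4 G | ¬ σ ∈ Typ y} := by
      intro σ hσ hσy
      have h1 : boxRestrict w x₀ m σ ∈ boxGood w x₀ m n pad Typ c := by
        rw [← hyc]
        exact (mem_boxGood_iff hy).2 ((mem_typ_boxExt_boxRestrict_iff hw1 hloc.2 hy).2 hσy)
      exact hσ c hcD h1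
    rw [measure_mono_null hsub (ae_iff.1 hae)]
    exact zero_le
  push Not at hres
  -- (γ) every charged label is a resampled box cell: clause (ii_U) verbatim
  by_cases hD : D = ∅
  · subst hD
    haveI := isProbabilityMeasure_ymSpecification (d := 4) ρ hρ β E η
    simp only [Finset.card_empty, pow_zero, ENNReal.ofReal_one]
    exact prob_le_one
  set F : Finset (Fin 4 → ℤ) := (boxCells x₀ m).filter fun y => boxLabel x₀ m n y ∈ D with hF
  have hFbox : ∀ y ∈ F, y ∈ boxCells x₀ m := fun y hy => (Finset.mem_filter.1 hy).1
  have hFD : ∀ y ∈ F, boxLabel x₀ m n y ∈ D := fun y hy => (Finset.mem_filter.1 hy).2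
  have hFsub : F ⊆ cellsOf w x₀ m A := fun y hy =>
    mem_cellsOf_of_forall hw1 (hFbox y hy) fun v hv => hres _ (hFD y hy) v hv
  have hFne : F.Nonempty := by
    obtain ⟨c, hcD⟩ := Finset.nonempty_iff_ne_empty.2 hD
    obtain ⟨y, hy, hyc⟩ := hph c hcD
    exact ⟨y, Finset.mem_filter.2 ⟨hy, hyc ▸ hcD⟩⟩
  have hcard : F.card = D.card := by
    have himg : F.image (boxLabel x₀ m n) = D := by
      ext c
      simp only [Finset.mem_image]
      constructor
      · rintro ⟨y, hy, rfl⟩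
        exact hFD y hy
      · intro hcD
        obtain ⟨y, hy, hyc⟩ := hph c hcD
        exact ⟨y, Finset.mem_filter.2 ⟨hy, hyc ▸ hcD⟩, hyc⟩
    rw [← himg, Finset.card_image_of_injOn (boxLabel_injOn.mono fun y hy => hFbox y hy)]
  -- the guard of (ii_U) for the exterior `η`
  have hguard' : ∀ y ∈ F, ∀ c'' : Fin 4 → ℤ, (∀ i, |c'' i - y i| ≤ 1) → c'' ∈ cellsOf w x₀ m A ∨ η ∈ Typ c'' := by
    intro y hy c'' hnear
    by_cases hc'' : c'' ∈ boxCells x₀ m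
    · have hcd : cdist (boxLabel x₀ m n y) (boxLabel x₀ m n c'') ≤ 1 := by
        rw [cdist_boxLabel (hFbox y hy) hc'', cellDist_le_iff]
        intro i
        rw [abs_sub_comm]
        exact_mod_cast hnear i
      rcases hguard _ (hFD y hy) _ hcd with h | h
      · exact Or.inl (mem_cellsOf_of_forall hw1 hc'' h)
      · exact Or.inr ((mem_boxGood_iff hc'').1 h)
    · exact Or.inr ((mem_typ_boxExt_iff_of_not_mem hw1 hloc.2 hc'').2 (hpad c''))
  have hle := hII F (cellsOf w x₀ m A) hFsub hFne η hguard'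
  rw [← map_subtype_eq_regionEdges hw1 hsat, hcard] at hle
  refine le_trans (measure_mono fun σ hσ => ?_) hle
  -- the event pulled back to `ℤ⁴`: every charged cell is atypical
  intro y hy hσy
  have h1 : boxRestrict w x₀ m σ ∈ boxGood w x₀ m n pad Typ (boxLabel x₀ m n y) :=
    (mem_boxGood_iff (hFbox y hy)).2 ((mem_typ_boxExt_boxRestrict_iff hw1 hloc.2 (hFbox y hy)).2 hσy)
  exact hσ _ (hFD y hy) h1

/-! ## §6 P3 PROVED: clause (i) AT ALL CENTRES IS the engine's `IsGoodFS` for the box instance -/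

/-- **P3 (PROVED) — where «(i) at all centres» is consumed.**  For a mesh-`b ≥ 1` frame, a cell-local family `Typ` with
clause (i) AT EVERY CENTRE at `(n, ε)`, `0 ≤ ε`, and a padding typical on every cell, the box instance satisfies the
engine's good-exterior finite-size condition `IsGoodFS` at `(n, ε)`, for EVERY box.  (A phantom centre carries only
constant observables; a real centre whose cell is not resampled keeps its data a.s.; otherwise clause (i) at THAT centre
applies verbatim: `Y :=` the resampled cells re-centred, exteriors `boxExt pad ζ`, `boxExt pad ζ'`, cylinder observable
`f ∘ boxRestrict` — on box cells the engine's cyclic label distance is the `ℤ⁴` cell distance, no wrap-around.) -/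
theorem boxP3_of_clauseIAll [T2Space G] [SecondCountableTopology G] {N : ℕ} {ρ : G →* Matrix (Fin N) (Fin N) ℂ}
    (hρ : Continuous ρ) {β : ℝ} {b : ℕ} {w : Fin 4 → ℤ → ℤ} (hb : 1 ≤ b) (hw : IsFrame b w) {n : ℕ} {ε : ℝ}
    (hε : 0 ≤ ε) {Typ : (Fin 4 → ℤ) → Set (LGConfig 4 G)} (hloc : TypLocal w Typ) (hI : ClauseIAll ρ β w n ε Typ)
    {pad : LGConfig 4 G} (hpad : ∀ c, pad ∈ Typ c) (x₀ : Fin 4 → ℤ) (m : ℕ) :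
    BoxP3 ρ β w x₀ m n pad Typ ε := by
  classical
  have hw1 := isFrame_step hb hw
  refine ⟨fun c σ τ h => boxGood_local hw1 hloc.2 pad c σ τ h, measurableSet_boxGood hloc.1 pad, ?_⟩
  intro c A hA2n hsat ζ ζ' hagree hgood f hfm hf01 hfdep
  haveI := isProbabilityMeasure_boxSpec (β := β) hρ pad A ζ
  haveI := isProbabilityMeasure_boxSpec (β := β) hρ pad A ζ'
  set E := A.map (Function.Embedding.subtype fun e => e ∈ boxEdges w x₀ m) with hE
  -- (α) a phantom centre: `f` is constant
  by_cases hph : ∀ y ∈ boxCells x₀ m, boxLabel x₀ m n y ≠ c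
  · have hconst : ∀ σ τ : BoxLink w x₀ m → G, f σ = f τ := fun σ τ =>
      hfdep fun v hv => absurd hv (hph _ (frameCell_mem_boxCells hw1 v))
    have hf : f = fun _ => f ζ := funext fun σ => hconst σ ζ
    rw [hf]
    simp [integral_const, hε]
  push Not at hph
  obtain ⟨c₀, hc₀, rfl⟩ := hph
  -- links of label `boxLabel c₀` are exactly the links of the cell `c₀`
  have hcell : ∀ v : BoxLink w x₀ m, boxCell w x₀ m n v = boxLabel x₀ m n c₀ → v.1 ∈ cellEdges w c₀ := fun v hv =>
    (frameCell_eq_iff hw1 _ _).1 (boxLabel_injOn (frameCell_mem_boxCells hw1 v) hc₀ hv)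
  by_cases hres : c₀ ∈ cellsOf w x₀ m A
  · -- (γ) the centre cell is resampled: clause (i) at centre `c₀`
    set Y : Finset (Fin 4 → ℤ) := (cellsOf w x₀ m A).image fun y => y - c₀ with hYdef
    have hYmem : ∀ {c₁ : Fin 4 → ℤ}, c₁ ∈ Y ↔ c₁ + c₀ ∈ cellsOf w x₀ m A := by
      intro c₁
      simp only [hYdef, Finset.mem_image]
      constructor
      · rintro ⟨y, hy, rfl⟩
        rwa [sub_add_cancel]
      · intro h
        exact ⟨c₁ + c₀, h, add_sub_cancel_right c₁ c₀⟩
    have hY : Y ⊆ windowCells n := by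
      intro c₁ hc₁
      have h := hYmem.1 hc₁
      obtain ⟨v, hvA, hfv⟩ := Finset.mem_image.1 h
      have hd := hA2n v hvA
      rw [boxCell_eq, hfv, cdist_boxLabel hc₀ (cellsOf_subset hw1 A h), cellDist_le_iff] at hd
      simp only [Summit.QuantumFields.YangMills.Cruxes.IR.Tempered.windowCells, Fintype.mem_piFinset, Finset.mem_Icc]
      intro i
      have hi := hd i
      rw [Pi.add_apply, abs_le] at hi
      push_cast at hi
      constructor <;> linarith [hi.1, hi.2]
    have h0 : (0 : Fin 4 → ℤ) ∈ Y := hYmem.2 (by rw [zero_add]; exact hres)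
    -- typicality of both exteriors on the window-plus-shell cells off `Y`
    have htyp : ∀ c₁ ∈ windowCellsPlus n, c₁ ∉ Y →
        boxExt w x₀ m pad ζ ∈ Typ (c₁ + c₀) ∧ boxExt w x₀ m pad ζ' ∈ Typ (c₁ + c₀) := by
      intro c₁ hc₁ hc₁Y
      have hy' : c₁ + c₀ ∉ cellsOf w x₀ m A := fun h => hc₁Y (hYmem.2 h)
      by_cases hbox : c₁ + c₀ ∈ boxCells x₀ m
      · have hcd : cdist (boxLabel x₀ m n c₀) (boxLabel x₀ m n (c₁ + c₀)) ≤ 2 * n + 1 := by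
          rw [cdist_boxLabel hc₀ hbox, cellDist_le_iff]
          intro i
          have h := (Fintype.mem_piFinset.mp hc₁) i
          rw [Finset.mem_Icc] at h
          rw [Pi.add_apply, abs_le]
          push_cast
          constructor <;> linarith [h.1, h.2]
        have hnot : ∀ v : BoxLink w x₀ m, boxCell w x₀ m n v = boxLabel x₀ m n (c₁ + c₀) → v ∉ A := by
          intro v hv hvA
          have hfv : frameCell w v.1 = c₁ + c₀ := boxLabel_injOn (frameCell_mem_boxCells hw1 v) hbox hv
          exact hy' (hfv ▸ Finset.mem_image_of_mem _ hvA)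
        obtain ⟨h1, h2⟩ := hgood _ hcd hnot
        exact ⟨(mem_boxGood_iff hbox).1 h1, (mem_boxGood_iff hbox).1 h2⟩
      · exact ⟨(mem_typ_boxExt_iff_of_not_mem hw1 hloc.2 hbox).2 (hpad _),
          (mem_typ_boxExt_iff_of_not_mem hw1 hloc.2 hbox).2 (hpad _)⟩
    -- agreement of both exteriors on the window cells off `Y`
    have hagree' : ∀ c₁ ∈ windowCellsPlus n, c₁ ∉ Y → c₁ ∈ windowCells n →
        ∀ e ∈ cellEdges (shiftFrame w c₀) c₁, boxExt w x₀ m pad ζ e = boxExt w x₀ m pad ζ' e := by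
      intro c₁ _ _ hc₁W e he
      rw [cellEdges_shiftFrame] at he
      by_cases hbox : e ∈ boxEdges w x₀ m
      · rw [boxExt_apply_of_mem hbox, boxExt_apply_of_mem hbox]
        apply hagree ⟨e, hbox⟩
        have hfe : frameCell w e = c₁ + c₀ := (frameCell_eq_iff hw1 _ _).2 he
        have hb' : c₁ + c₀ ∈ boxCells x₀ m := by rw [← hfe]; exact (mem_boxEdges_iff hw1).1 hbox
        rw [boxCell_eq, hfe, cdist_boxLabel hc₀ hb', cellDist_le_iff]
        intro i
        have h := (Fintype.mem_piFinset.mp hc₁W) i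
        rw [Finset.mem_Icc] at h
        rw [Pi.add_apply, abs_le]
        push_cast
        constructor <;> linarith [h.1, h.2]
      · rw [boxExt_apply_of_not_mem hbox, boxExt_apply_of_not_mem hbox]
    -- the pulled-back observable is a cylinder observable of the centre cell
    have hcyl : IsCylinder (fun σ : LGConfig 4 G => f (boxRestrict w x₀ m σ)) (cellEdges (shiftFrame w c₀) 0) := by
      intro σ σ' hσ
      rw [cellEdges_shiftFrame, zero_add] at hσ
      exact hfdep fun v hv => hσ v.1 (Finset.mem_coe.2 (hcell v hv))
    have hmeas : Measurable fun σ : LGConfig 4 G => f (boxRestrict w x₀ m σ) := hfm.comp measurable_boxRestrict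
    have h01 : ∀ U : LGConfig 4 G, 0 ≤ f (boxRestrict w x₀ m U) ∧ f (boxRestrict w x₀ m U) ≤ 1 := fun U => hf01 _
    have key := hI c₀ Y hY h0 (boxExt w x₀ m pad ζ) (boxExt w x₀ m pad ζ') htyp hagree' _ hcyl hmeas h01
    have hreg : regionEdges (shiftFrame w c₀) Y = E := by
      rw [regionEdges_shiftFrame, hYdef, Finset.image_biUnion, hE, map_subtype_eq_regionEdges hw1 hsat]
      simp only [sub_add_cancel, Summit.QuantumFields.YangMills.Cruxes.IR.Tempered.regionEdges]
    rw [hreg] at key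
    rw [integral_boxSpec pad A ζ hfm, integral_boxSpec pad A ζ' hfm]
    exact key
  · -- (β) the centre cell is not resampled: both kernels keep the (agreeing) data on it
    have hoff : ∀ e ∈ cellEdges w c₀, e ∉ E := by
      intro e he heE
      rw [hE, Finset.mem_map] at heE
      obtain ⟨v, hvA, hve⟩ := heE
      have hve' : v.1 = e := hve
      exact hres (by rw [← (frameCell_eq_iff hw1 e c₀).2 he, ← hve']; exact Finset.mem_image_of_mem _ hvA)
    have hint : ∀ ξ : BoxLink w x₀ m → G, ∫ σ, f σ ∂(boxSpec ρ β w x₀ m pad A ξ) = f ξ := by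
      intro ξ
      rw [integral_boxSpec pad A ξ hfm]
      haveI := isProbabilityMeasure_ymSpecification (d := 4) ρ hρ β E (boxExt w x₀ m pad ξ)
      have hae : ∀ᵐ σ ∂(ymSpecification ρ β E (boxExt w x₀ m pad ξ)), f (boxRestrict w x₀ m σ) = f ξ := by
        filter_upwards [ae_eq_on_cell hρ β E (boxExt w x₀ m pad ξ) hoff] with σ hσ
        refine hfdep fun v hv => ?_
        show σ v.1 = ξ v
        rw [hσ v.1 (hcell v hv)]
        exact boxExt_apply_of_mem v.2
      rw [integral_congr_ae hae, integral_const]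
      simp
    have hζζ' : f ζ = f ζ' := hfdep fun v hv => hagree v (by rw [hv, cdist_self]; exact Nat.zero_le _)
    rw [hint ζ, hint ζ', hζζ', sub_self, abs_zero]
    exact hε

/-! ## §7 P1 and P2 PROVED: the box kernels form a block-Markov specification (format-independent) -/

/-- **P2 (PROVED) — block-Markov.**  The box kernels have block leak `0` at every rate: an observable reading `A` and
agreeing sites has the same `γ^box_A`-expectation under two exteriors agreeing on the cells at label distance `≤ D + 1`
from `A` (`dependsOn_integral_ymSpecification`: the Wilson interaction has range one, `exists_near_of_mem_collar`, and
plaquette-mates lie in frame cells at index distance `≤ 1`, `frame_hC1`; off the box both exteriors are the padding). -/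
theorem boxP2_of_frame [SecondCountableTopology G] {N : ℕ} {ρ : G →* Matrix (Fin N) (Fin N) ℂ} (hρ : Continuous ρ)
    (β : ℝ) {b : ℕ} {w : Fin 4 → ℤ → ℤ} (hb : 1 ≤ b) (hw : IsFrame b w) (n : ℕ) (pad : LGConfig 4 G)
    (x₀ : Fin 4 → ℤ) (m : ℕ) : BoxP2 ρ β w x₀ m n pad := by
  classical
  have hw1 := isFrame_step hb hw
  intro r A hsat D ζ ζ' hagree f hfm hf01 hfdep
  simp only [zero_mul, Real.exp_zero, one_mul]
  rw [integral_boxSpec pad A ζ hfm, integral_boxSpec pad A ζ' hfm]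
  -- the pulled-back observable is a cylinder observable of the links in `A` or where `ζ = ζ'`
  set S₀ : Finset (Literature.MathematicalPhysics.QuantumLattice.ZdEdge 4) :=
    ((Finset.univ : Finset (BoxLink w x₀ m)).filter fun v => v ∈ A ∨ ζ v = ζ' v).map
      (Function.Embedding.subtype fun e => e ∈ boxEdges w x₀ m) with hS₀
  have hcyl : IsCylinder (fun σ : LGConfig 4 G => f (boxRestrict w x₀ m σ)) S₀ := by
    intro σ σ' hσ
    exact hfdep fun v hv => hσ v.1 (Finset.mem_coe.2
      (Finset.mem_map.2 ⟨v, Finset.mem_filter.2 ⟨Finset.mem_univ _, hv⟩, rfl⟩))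
  have key := dependsOn_integral_ymSpecification ρ hρ β
    (A.map (Function.Embedding.subtype fun e => e ∈ boxEdges w x₀ m)) (hfm.comp measurable_boxRestrict) hcyl
  refine le_of_eq (key fun e he => ?_)
  rcases Finset.mem_union.1 (Finset.mem_coe.1 he) with heS | heC
  · -- a link of `A` or a link where `ζ = ζ'`
    obtain ⟨v, hv, hve⟩ := Finset.mem_map.1 heS
    have hve' : v.1 = e := hve
    subst hve'
    rw [boxExt_apply_of_mem v.2, boxExt_apply_of_mem v.2]
    rcases (Finset.mem_filter.1 hv).2 with hvA | hvζ
    · exact hagree v ⟨v, hvA, by rw [cdist_self]; exact Nat.zero_le _⟩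
    · exact hvζ
  · -- a collar link: within sup-distance one of a link of `A`, hence in a cell at label distance `≤ 1`
    obtain ⟨e', he'E, hnear⟩ := exists_near_of_mem_collar heC
    obtain ⟨u, huA, hue⟩ := Finset.mem_map.1 he'E
    have hue' : u.1 = e' := hue
    by_cases hbox : e ∈ boxEdges w x₀ m
    · rw [boxExt_apply_of_mem hbox, boxExt_apply_of_mem hbox]
      refine hagree ⟨e, hbox⟩ ⟨u, huA, ?_⟩
      rw [boxCell_eq, boxCell_eq, cdist_boxLabel (frameCell_mem_boxCells hw1 u)
        (frameCell_mem_boxCells hw1 ⟨e, hbox⟩), cellDist_le_iff]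
      intro i
      show |frameCell w u.1 i - frameCell w e i| ≤ ((D + 1 : ℕ) : ℤ)
      rw [hue', abs_sub_comm]
      have h1 := frame_hC1 hw1 e e' hnear i
      push_cast
      linarith
    · rw [boxExt_apply_of_not_mem hbox, boxExt_apply_of_not_mem hbox]

/-- **P1 (PROVED) — the box kernels form a specification** (probability: `isProbabilityMeasure_ymSpecification`;
exterior measurability: the `ℤ⁴` one composed with `boxExt`, which reads only the box links off `A` and the constant
padding; properness and consistency: transported from the `ℤ⁴` specification — under `γ_{E'}(· | boxExt pad ζ)` the
configuration equals the padding off the box a.s., so `boxExt pad ∘ boxRestrict = id` a.s.). -/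
theorem boxP1_of_continuous [T2Space G] [SecondCountableTopology G] {N : ℕ} {ρ : G →* Matrix (Fin N) (Fin N) ℂ}
    (hρ : Continuous ρ) (β : ℝ) (w : Fin 4 → ℤ → ℤ) (x₀ : Fin 4 → ℤ) (m : ℕ) (pad : LGConfig 4 G) :
    BoxP1 ρ β w x₀ m pad := by
  classical
  have hZ4 := isSpecification_ymSpecification_of_t2Space (d := 4) ρ hρ β
  refine ⟨fun A ζ => isProbabilityMeasure_boxSpec (β := β) hρ pad A ζ, ?_, ?_, ?_⟩
  · -- exterior measurability
    intro A S hS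
    have hT : MeasurableSet (boxRestrict w x₀ m ⁻¹' S) := measurable_boxRestrict hS
    have hext : @Measurable (BoxLink w x₀ m → G) (LGConfig 4 G)
        (cylinderEvents (X := fun _ : BoxLink w x₀ m => G) ((↑A : Set (BoxLink w x₀ m)))ᶜ)
        (cylinderEvents (X := fun _ : Literature.MathematicalPhysics.QuantumLattice.ZdEdge 4 => G)
          ((↑(A.map (Function.Embedding.subtype fun e => e ∈ boxEdges w x₀ m)) :
            Set (Literature.MathematicalPhysics.QuantumLattice.ZdEdge 4)))ᶜ)
        (boxExt w x₀ m pad) := by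
      refine measurable_cylinderEvents_iff.2 fun e he => ?_
      by_cases hbox : e ∈ boxEdges w x₀ m
      · have hfun : (fun ζ : BoxLink w x₀ m → G => boxExt w x₀ m pad ζ e) = fun ζ => ζ ⟨e, hbox⟩ :=
          funext fun ζ => boxExt_apply_of_mem hbox
        rw [hfun]
        refine measurable_cylinderEvent_apply (X := fun _ : BoxLink w x₀ m => G) (i := ⟨e, hbox⟩) ?_
        intro hA
        exact he (Finset.mem_coe.2 (Finset.mem_map.2 ⟨⟨e, hbox⟩, Finset.mem_coe.1 hA, rfl⟩))
      · have hfun : (fun ζ : BoxLink w x₀ m → G => boxExt w x₀ m pad ζ e) = fun _ => pad e :=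
          funext fun ζ => boxExt_apply_of_not_mem hbox
        rw [hfun]
        exact measurable_const
    have hfun : (fun ζ => boxSpec ρ β w x₀ m pad A ζ S) =
        (fun η => ymSpecification ρ β (A.map (Function.Embedding.subtype fun e => e ∈ boxEdges w x₀ m)) η
          (boxRestrict w x₀ m ⁻¹' S)) ∘ boxExt w x₀ m pad :=
      funext fun ζ => boxSpec_apply pad A ζ hS
    rw [hfun]
    exact (hZ4.measurable _ _ hT).comp hext
  · -- properness
    intro A ζ
    have hmeas : MeasurableSet {σ : BoxLink w x₀ m → G | ∀ v ∉ A, σ v = ζ v} := by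
      have h : {σ : BoxLink w x₀ m → G | ∀ v ∉ A, σ v = ζ v} =
          ⋂ v ∈ ((↑A : Set (BoxLink w x₀ m)))ᶜ, (fun σ : BoxLink w x₀ m → G => σ v) ⁻¹' {ζ v} := by
        ext σ
        simp only [Set.mem_setOf_eq, Set.mem_iInter, Set.mem_compl_iff, Finset.mem_coe, Set.mem_preimage,
          Set.mem_singleton_iff]
      rw [h]
      exact MeasurableSet.biInter (Set.to_countable _) fun v _ =>
        measurable_pi_apply v (measurableSet_singleton (ζ v))
    show ∀ᵐ σ ∂((ymSpecification ρ β (A.map (Function.Embedding.subtype fun e => e ∈ boxEdges w x₀ m))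
      (boxExt w x₀ m pad ζ)).map (boxRestrict w x₀ m)), ∀ v ∉ A, σ v = ζ v
    rw [ae_map_iff measurable_boxRestrict.aemeasurable hmeas]
    filter_upwards [hZ4.proper (A.map (Function.Embedding.subtype fun e => e ∈ boxEdges w x₀ m))
      (boxExt w x₀ m pad ζ)] with σ hσ v hv
    have hvE : v.1 ∉ A.map (Function.Embedding.subtype fun e => e ∈ boxEdges w x₀ m) := by
      intro h
      obtain ⟨u, hu, hue⟩ := Finset.mem_map.1 h
      have hue' : u.1 = v.1 := hue
      exact hv (Subtype.ext hue' ▸ hu)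
    show σ v.1 = ζ v
    rw [hσ v.1 hvE, boxExt_apply_of_mem v.2]
  · -- consistency
    intro A A' hAA' ζ S hS
    have hT : MeasurableSet (boxRestrict w x₀ m ⁻¹' S) := measurable_boxRestrict hS
    have hEE' : A.map (Function.Embedding.subtype fun e => e ∈ boxEdges w x₀ m) ⊆
        A'.map (Function.Embedding.subtype fun e => e ∈ boxEdges w x₀ m) := Finset.map_subset_map.2 hAA'
    have hfun : (fun σ : BoxLink w x₀ m → G => boxSpec ρ β w x₀ m pad A σ S) = fun σ =>
        ymSpecification ρ β (A.map (Function.Embedding.subtype fun e => e ∈ boxEdges w x₀ m))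
          (boxExt w x₀ m pad σ) (boxRestrict w x₀ m ⁻¹' S) :=
      funext fun σ => boxSpec_apply pad A σ hS
    rw [hfun, boxSpec_apply pad A' ζ hS]
    show ∫⁻ σ, ymSpecification ρ β (A.map (Function.Embedding.subtype fun e => e ∈ boxEdges w x₀ m))
        (boxExt w x₀ m pad σ) (boxRestrict w x₀ m ⁻¹' S)
        ∂((ymSpecification ρ β (A'.map (Function.Embedding.subtype fun e => e ∈ boxEdges w x₀ m))
          (boxExt w x₀ m pad ζ)).map (boxRestrict w x₀ m)) = _
    have hFm : Measurable fun σ : BoxLink w x₀ m → G => ymSpecification ρ β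
        (A.map (Function.Embedding.subtype fun e => e ∈ boxEdges w x₀ m)) (boxExt w x₀ m pad σ)
        (boxRestrict w x₀ m ⁻¹' S) :=
      (measurable_ymSpecification_apply ρ hρ β _ hT).comp (measurable_boxExt pad)
    rw [lintegral_map hFm measurable_boxRestrict]
    have hae : (fun σ : LGConfig 4 G => ymSpecification ρ β
          (A.map (Function.Embedding.subtype fun e => e ∈ boxEdges w x₀ m))
          (boxExt w x₀ m pad (boxRestrict w x₀ m σ)) (boxRestrict w x₀ m ⁻¹' S)) =ᵐ[ymSpecification ρ β
          (A'.map (Function.Embedding.subtype fun e => e ∈ boxEdges w x₀ m)) (boxExt w x₀ m pad ζ)]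
        fun σ => ymSpecification ρ β (A.map (Function.Embedding.subtype fun e => e ∈ boxEdges w x₀ m)) σ
          (boxRestrict w x₀ m ⁻¹' S) := by
      filter_upwards [hZ4.proper (A'.map (Function.Embedding.subtype fun e => e ∈ boxEdges w x₀ m))
        (boxExt w x₀ m pad ζ)] with σ hσ
      have hext : boxExt w x₀ m pad (boxRestrict w x₀ m σ) = σ := by
        funext e
        by_cases hbox : e ∈ boxEdges w x₀ m
        · exact boxExt_boxRestrict_of_mem hbox
        · have heE' : e ∉ A'.map (Function.Embedding.subtype fun e => e ∈ boxEdges w x₀ m) := by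
            intro h
            obtain ⟨u, _, hue⟩ := Finset.mem_map.1 h
            have hue' : u.1 = e := hue
            exact hbox (hue' ▸ u.2)
          rw [boxExt_apply_of_not_mem hbox, hσ e heE', boxExt_apply_of_not_mem hbox]
      rw [hext]
    refine (lintegral_congr_ae hae).trans ?_
    exact hZ4.consistent hEE' _ _ hT

/-- **The instance claim, PROVED** (g6 memo §3 table, all four rows): for a mesh-`b ≥ 1` frame, a cell-local family with
clause (i) AT ALL CENTRES at `(n, ε)`, `0 ≤ ε`, the UKP clause (ii_U) at level `δ`, and a padding typical on every cell,
the box kernels form a block-Markov specification satisfying the engine's `IsGoodFS` at `(n, ε)` and `UniformKernelPeierls`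
at `δ`, for EVERY box.  (`T2Space G` and `SecondCountableTopology G` follow from a faithful continuous `ρ`, as in E^U.) -/
theorem boxInstance_of_clauses [T2Space G] [SecondCountableTopology G] {N : ℕ} {ρ : G →* Matrix (Fin N) (Fin N) ℂ}
    (hρ : Continuous ρ) (β : ℝ) {b : ℕ} {w : Fin 4 → ℤ → ℤ} (hb : 1 ≤ b) (hw : IsFrame b w) {n : ℕ} {ε δ : ℝ}
    (hε : 0 ≤ ε) {Typ : (Fin 4 → ℤ) → Set (LGConfig 4 G)} (hloc : TypLocal w Typ) (hI : ClauseIAll ρ β w n ε Typ)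
    (hII : ClauseIIukp ρ β w δ Typ) {pad : LGConfig 4 G} (hpad : ∀ c, pad ∈ Typ c) (x₀ : Fin 4 → ℤ) (m : ℕ) :
    BoxP1 ρ β w x₀ m pad ∧ BoxP2 ρ β w x₀ m n pad ∧ BoxP3 ρ β w x₀ m n pad Typ ε ∧ BoxP4 ρ β w x₀ m n pad Typ δ :=
  ⟨boxP1_of_continuous hρ β w x₀ m pad, boxP2_of_frame hρ β hb hw n pad x₀ m,
    boxP3_of_clauseIAll hρ hb hw hε hloc hI hpad x₀ m, boxP4_of_clauseIIukp hρ hb hw hloc hII hpad x₀ m⟩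

end Box

/-! ## §8 `EnginePortT` PROVED: the box instance fed to the ν-free engine gives the per-box uniform influence bound;
E^c (`TypCriterionUKPc`) therefore reduces to the torus bookkeeping `TorusBookkeepingT` ALONE
(g6 architecture δ': pieces P1–P6a all discharged here; P6b = the Wilson-slice bookkeeping remains). -/

section Engine

universe u v

/-- **Uniform boundary influence with defects, block-Markov case** — `annealed_influence_markov_defects` WITHOUT the
Gibbs measure: same hypotheses minus `IsGibbsMeasure γ ν`, plus `Δg.Nonempty`; conclusion for EVERY two exteriors
`ζ, ζ'` of the volume `Λ := {v | cell v ∉ Δg}`: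
`|γ_Λ f(ζ) − γ_Λ f(ζ')| ≤ C e^{#Δf} #Δg e^{−κₑ D}` (same constants `q₀, κₑ = −log θ, C`).  Proof = the tree proof of
the annealed theorem with its three `integral_abs_sub_le_of_uniform` (DLR) steps deleted.  This is the form the box
port consumes (the box carries no Gibbs measure; the torus enters only through the far-factor DLR identity). -/
theorem uniform_influence_markov_defects (d n : ℕ) :
    ∃ q₀ κₑ C : ℝ, 0 < q₀ ∧ 0 < κₑ ∧ 0 ≤ C ∧
    ∀ {μc : Fin d → ℕ} {V : Type u} {S : Type v} [MeasurableSpace S] [Fintype V]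
      (cell : V → CoarseIdx μc) (γ : Specification V S) (good : CoarseIdx μc → Set (V → S))
      (ε q r : ℝ),
      (∀ i, 4 * n + 3 ≤ μc i + 1) → IsSpecification γ →
      0 ≤ ε → ε * (Literature.Probability.LatticeModels.shellCount d n : ℝ) ≤ 3 / 4 → IsGoodFS cell γ good n ε →
      HasBlockLeak cell γ 0 r → 0 ≤ q → q ≤ q₀ → UniformKernelPeierls cell γ good q →
      ∀ (f : (V → S) → ℝ) (Δf Δg : Finset (CoarseIdx μc)) (D : ℕ), Δg.Nonempty →
        Measurable f → (∀ σ, 0 ≤ f σ ∧ f σ ≤ 1) → DependsOn f {v | cell v ∈ Δf} →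
        (∀ x ∈ Δf, ∀ y ∈ Δg, D ≤ cdist x y) →
        ∀ ζ ζ' : V → S,
          |∫ σ, f σ ∂(γ (Finset.univ.filter fun v => cell v ∉ Δg) ζ) -
              ∫ σ, f σ ∂(γ (Finset.univ.filter fun v => cell v ∉ Δg) ζ')| ≤
            C * Real.exp (Δf.card) * Δg.card * Real.exp (-(κₑ * D)) := by
  obtain ⟨q₀d, θ, Cd, hq₀d, -, hθ, hθ1, hC1, hdec⟩ := influence_decay_markov_defects.{u, v} d n
  have h3d : (0 : ℝ) ≤ (3 : ℝ) ^ d := pow_nonneg (by norm_num) _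
  have hX1 : (1 : ℝ) ≤ ((3 : ℝ) ^ d + 1) ^ 2 := one_le_pow₀ (by linarith)
  have hX0 : (0 : ℝ) < ((3 : ℝ) ^ d + 1) ^ 2 := by positivity
  have htpos : 0 < θ⁻¹ := inv_pos.2 hθ
  have hθt : θ * θ⁻¹ = 1 := mul_inv_cancel₀ hθ.ne'
  have hC0 : 0 ≤ Cd := zero_le_one.trans hC1
  have hκ : 0 < -Real.log θ := neg_pos.2 (Real.log_neg hθ hθ1)
  refine ⟨min q₀d (θ ^ 2 / (8 * ((3 : ℝ) ^ d + 1) ^ 2)), -Real.log θ,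
    Cd + 8 * Cd * (1 + 3 ^ d) + 4 * θ⁻¹ ^ 2 + θ⁻¹, lt_min hq₀d (by positivity), hκ,
    by positivity, ?_⟩
  intro μc V S _ _ cell γ good ε q r hμ hγ hε hεs hFS hBL hq hqq₀ hUKP f Δf Δg D hΔg hfm hf01
    hfdep hfar
  classical
  -- the smallness facts on `q`
  have hqd : q ≤ q₀d := hqq₀.trans (min_le_left _ _)
  have hq8 : 8 * ((3 : ℝ) ^ d + 1) ^ 2 * q ≤ θ ^ 2 := by
    have h := hqq₀.trans (min_le_right _ _)
    rw [le_div_iff₀ (by positivity)] at h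
    linarith
  have hθ2 : θ ^ 2 ≤ θ := by nlinarith
  have hXq0 : 0 ≤ ((3 : ℝ) ^ d + 1) ^ 2 * q := by positivity
  have hXqθ : ((3 : ℝ) ^ d + 1) ^ 2 * q ≤ θ := by nlinarith
  have hXq : ((3 : ℝ) ^ d + 1) ^ 2 * q ≤ 1 / 2 := by nlinarith
  have hq1 : q ≤ 1 := by nlinarith
  have hXqt : 8 * ((3 : ℝ) ^ d + 1) ^ 2 * (q * θ⁻¹) ≤ 1 := by
    calc 8 * ((3 : ℝ) ^ d + 1) ^ 2 * (q * θ⁻¹) = 8 * ((3 : ℝ) ^ d + 1) ^ 2 * q * θ⁻¹ := by ring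
      _ ≤ θ ^ 2 * θ⁻¹ := mul_le_mul_of_nonneg_right hq8 htpos.le
      _ = θ * (θ * θ⁻¹) := by ring
      _ ≤ 1 := by rw [hθt, mul_one]; exact hθ1.le
  -- `e^{-κₑ D} = θ^D`
  have hexpD : Real.exp (-(-Real.log θ * D)) = θ ^ D := by
    rw [neg_mul, neg_neg, mul_comm, Real.exp_nat_mul, Real.exp_log hθ]
  rw [hexpD]
  have hexp1 : (1 : ℝ) ≤ Real.exp (Δf.card) := Real.one_le_exp (Nat.cast_nonneg _)
  have hθD : 0 ≤ θ ^ D := pow_nonneg hθ.le _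
  set Λ : Finset V := Finset.univ.filter fun v => cell v ∉ Δg with hΛ
  have hg1 : (1 : ℝ) ≤ Δg.card := by exact_mod_cast Finset.card_pos.2 hΔg
  have hbig : θ⁻¹ ≤ (Cd + 8 * Cd * (1 + 3 ^ d) + 4 * θ⁻¹ ^ 2 + θ⁻¹) * Real.exp (Δf.card) *
      Δg.card := by
    have h1 : θ⁻¹ ≤ Cd + 8 * Cd * (1 + 3 ^ d) + 4 * θ⁻¹ ^ 2 + θ⁻¹ := by
      have : 0 ≤ Cd + 8 * Cd * (1 + 3 ^ d) + 4 * θ⁻¹ ^ 2 := by positivity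
      linarith
    have h0 : 0 ≤ Cd + 8 * Cd * (1 + 3 ^ d) + 4 * θ⁻¹ ^ 2 + θ⁻¹ := htpos.le.trans h1
    calc θ⁻¹ ≤ Cd + 8 * Cd * (1 + 3 ^ d) + 4 * θ⁻¹ ^ 2 + θ⁻¹ := h1
      _ = (Cd + 8 * Cd * (1 + 3 ^ d) + 4 * θ⁻¹ ^ 2 + θ⁻¹) * 1 * 1 := by ring
      _ ≤ (Cd + 8 * Cd * (1 + 3 ^ d) + 4 * θ⁻¹ ^ 2 + θ⁻¹) * Real.exp (Δf.card) * Δg.card :=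
          mul_le_mul (mul_le_mul_of_nonneg_left hexp1 h0) hg1 zero_le_one (by positivity)
  intro ζ ζ'
  by_cases hD2 : D < 2
  · -- short distances: the trivial bound `1 ≤ t θ^D`
    have htriv : |∫ σ, f σ ∂(γ Λ ζ) - ∫ σ, f σ ∂(γ Λ ζ')| ≤ 1 := by
      haveI := hγ.isProbability Λ ζ
      haveI := hγ.isProbability Λ ζ'
      obtain ⟨h1, h2⟩ := integral_mem_unitInterval (μ := γ Λ ζ) hfm hf01
      obtain ⟨h3, h4⟩ := integral_mem_unitInterval (μ := γ Λ ζ') hfm hf01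
      rw [abs_le]; constructor <;> linarith
    refine htriv.trans ?_
    have hθD1 : θ ≤ θ ^ D := by
      have := pow_le_pow_of_le_one hθ.le hθ1.le (show D ≤ 1 by omega)
      rwa [pow_one] at this
    calc (1 : ℝ) = θ⁻¹ * θ := by rw [mul_comm, hθt]
      _ ≤ θ⁻¹ * θ ^ D := mul_le_mul_of_nonneg_left hθD1 htpos.le
      _ ≤ (Cd + 8 * Cd * (1 + 3 ^ d) + 4 * θ⁻¹ ^ 2 + θ⁻¹) * Real.exp (Δf.card) * Δg.card *
            θ ^ D := mul_le_mul_of_nonneg_right hbig hθD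
  · -- `D ≥ 2`: the uniform multi-cell bound
    have hD : 2 ≤ D := not_lt.1 hD2
    have hsup : |∫ σ, f σ ∂(γ Λ ζ) - ∫ σ, f σ ∂(γ Λ ζ')| ≤
        (Cd + 8 * Cd * (1 + 3 ^ d) + 4 * θ⁻¹ ^ 2) * Real.exp (Δf.card) * θ ^ D :=
      uniform_influence_multiCell hγ hFS.good_local hFS.good_meas hBL hq hq1 hθ hθ1.le
        rfl hC0 hXq hXqθ hXqt hUKP Δg
        (fun D' x hx Λ' hΛ' ζ₁ ζ₁' hadm g hgm hg01 hgdep =>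
          hdec cell γ good ε q r hμ hγ hFS.good_local hFS.good_meas hε hεs hFS hBL hq hqd hUKP D'
            Δg x hx Λ' hΛ' ζ₁ ζ₁' hadm g hgm hg01 hgdep)
        Δf hD hfar ζ ζ' f hfm hf01 hfdep
    refine hsup.trans ?_
    have hB0 : 0 ≤ (Cd + 8 * Cd * (1 + 3 ^ d) + 4 * θ⁻¹ ^ 2 + θ⁻¹) * Real.exp (Δf.card) := by
      positivity
    calc (Cd + 8 * Cd * (1 + 3 ^ d) + 4 * θ⁻¹ ^ 2) * Real.exp (Δf.card) * θ ^ D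
        ≤ (Cd + 8 * Cd * (1 + 3 ^ d) + 4 * θ⁻¹ ^ 2 + θ⁻¹) * Real.exp (Δf.card) * θ ^ D :=
          mul_le_mul_of_nonneg_right (mul_le_mul_of_nonneg_right (by linarith)
            (zero_le_one.trans hexp1)) hθD
      _ = (Cd + 8 * Cd * (1 + 3 ^ d) + 4 * θ⁻¹ ^ 2 + θ⁻¹) * Real.exp (Δf.card) * 1 * θ ^ D := by
          rw [mul_one]
      _ ≤ (Cd + 8 * Cd * (1 + 3 ^ d) + 4 * θ⁻¹ ^ 2 + θ⁻¹) * Real.exp (Δf.card) * Δg.card *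
            θ ^ D := mul_le_mul_of_nonneg_right (mul_le_mul_of_nonneg_left hg1 hB0) hθD

end Engine

section EnginePort

/-! ### g6 §2–§3 vocabulary (VERBATIM): inner / rind cells, the per-box influence bound, the two pieces, E^c -/

/-- The inner cells of the box (off its one-cell RIND); their links are the resampled volume `Λe` of the port. [g6 §3] -/
def innerCells (x₀ : Fin 4 → ℤ) (m : ℕ) : Finset (Fin 4 → ℤ) :=
  Fintype.piFinset fun i : Fin 4 => Finset.Ico (x₀ i + 1) (x₀ i + m - 1)

/-- The rind: box cells that are not inner (the engine's source set `Δg`). [g6 §3] -/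
def rindCells (x₀ : Fin 4 → ℤ) (m : ℕ) : Finset (Fin 4 → ℤ) :=
  boxCells x₀ m \ innerCells x₀ m

/-- **Per-box uniform two-exterior influence bound in ℤ⁴-kernel currency.** [g6 §3, VERBATIM] -/
def BoxUniformInfluence (θ C₁ : ℝ) {N : ℕ} (ρ : G →* Matrix (Fin N) (Fin N) ℂ) (β : ℝ) (b : ℕ) : Prop :=
  ∀ w : Fin 4 → ℤ → ℤ, IsFrame b w →
    ∀ (x₀ : Fin 4 → ℤ) (m : ℕ), 3 ≤ m →
      ∀ Δf : Finset (Fin 4 → ℤ), Δf ⊆ innerCells x₀ m →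
        ∀ D : ℕ, (∀ x ∈ Δf, ∀ y ∈ rindCells x₀ m, D ≤ cellDist x y) →
          ∀ f : LGConfig 4 G → ℝ, IsCylinder f (regionEdges w Δf) → Measurable f → (∀ U, 0 ≤ f U ∧ f U ≤ 1) →
            ∀ η η' : LGConfig 4 G,
              |(∫ U, f U ∂(ymSpecification ρ β (regionEdges w (innerCells x₀ m)) η)) -
                  ∫ U, f U ∂(ymSpecification ρ β (regionEdges w (innerCells x₀ m)) η')| ≤
                C₁ * Real.exp (Δf.card) * (rindCells x₀ m).card * θ ^ D

/-- **EnginePortT — the engine instance.** [g6 §3, VERBATIM] -/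
def EnginePortT : Prop :=
  ∀ (n : ℕ) (ε : ℝ), 1 ≤ n → 0 ≤ ε → ε * OnsetFormats.shellCount n ≤ 3 / 4 →
    ∃ (δ₀ θ C₁ : ℝ), 0 < δ₀ ∧ 0 < θ ∧ θ < 1 ∧ 0 ≤ C₁ ∧
      ∀ (G : Type) [Group G] [TopologicalSpace G] [IsTopologicalGroup G] [CompactSpace G] [MeasurableSpace G]
        [BorelSpace G] (N : ℕ) (ρ : G →* Matrix (Fin N) (Fin N) ℂ),
        Continuous ρ → Function.Injective ρ → (∀ g, ρ g ∈ Matrix.unitaryGroup (Fin N) ℂ) →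
          ∀ (β : ℝ) (b : ℕ), 1 ≤ b → ∀ δ : ℝ, 0 < δ → δ ≤ δ₀ →
            TypShellCondUKPc ρ β b n ε δ → BoxUniformInfluence θ C₁ ρ β b

/-- **TorusBookkeepingT — the torus side (piece P6b).** [g6 §3, VERBATIM] -/
def TorusBookkeepingT : Prop :=
  ∀ (θ C₁ : ℝ), 0 < θ → θ < 1 → 0 ≤ C₁ →
    ∃ (κ : ℝ) (s₀ : ℕ), 0 < κ ∧
      ∀ (G : Type) [Group G] [TopologicalSpace G] [IsTopologicalGroup G] [CompactSpace G] [MeasurableSpace G]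
        [BorelSpace G] (N : ℕ) (ρ : G →* Matrix (Fin N) (Fin N) ℂ),
        Continuous ρ → Function.Injective ρ → (∀ g, ρ g ∈ Matrix.unitaryGroup (Fin N) ℂ) →
          ∀ A B : LocalGaugeObservable 4 G, ∃ C : ℝ, ∀ (β : ℝ) (b : ℕ), 1 ≤ b →
            BoxUniformInfluence θ C₁ ρ β b → ∀ S : ℕ, s₀ * b ≤ 2 * S + 1 → ∀ t : ℕ, t ≤ S →
              |latticeConnectedCorr ρ β (2 * S + 1) A.F B.F t| ≤ C * Real.exp (-(κ * t / b))

/-- **E^c — the typical-data criterion, reshaped** (`TypShellCond ↦ TypShellCondUKPc`). [g6 §2, VERBATIM] -/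
def TypCriterionUKPc : Prop :=
  ∀ (n : ℕ) (ε : ℝ), 1 ≤ n → 0 ≤ ε → ε * OnsetFormats.shellCount n ≤ 3 / 4 →
    ∃ (δ₀ κ : ℝ) (s₀ : ℕ), 0 < δ₀ ∧ 0 < κ ∧ ∀ (G : Type) [Group G] [TopologicalSpace G] [IsTopologicalGroup G]
      [CompactSpace G] [MeasurableSpace G] [BorelSpace G] (N : ℕ) (ρ : G →* Matrix (Fin N) (Fin N) ℂ),
      Continuous ρ → Function.Injective ρ → (∀ g, ρ g ∈ Matrix.unitaryGroup (Fin N) ℂ) →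
        ∀ A B : LocalGaugeObservable 4 G, ∃ C : ℝ,
          ∀ (β : ℝ) (b : ℕ), 1 ≤ b → ∀ δ : ℝ, 0 < δ → δ ≤ δ₀ → TypShellCondUKPc ρ β b n ε δ →
            ∀ S : ℕ, s₀ * b ≤ 2 * S + 1 → ∀ t : ℕ, t ≤ S →
              |latticeConnectedCorr ρ β (2 * S + 1) A.F B.F t| ≤ C * Real.exp (-(κ * t / b))

/-- **E^c from the two pieces (quantifier plumbing).** [g6 §3, VERBATIM] -/
theorem typCriterionUKPc_of_port (hP : EnginePortT) (hT : TorusBookkeepingT) : TypCriterionUKPc := by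
  intro n ε hn hε hM
  obtain ⟨δ₀, θ, C₁, hδ₀, hθ, hθ1, hC₁, hbox⟩ := hP n ε hn hε hM
  obtain ⟨κ, s₀, hκ, hcl⟩ := hT θ C₁ hθ hθ1 hC₁
  refine ⟨δ₀, κ, s₀, hδ₀, hκ, ?_⟩
  intro G _ _ _ _ _ _ N ρ hρ hinj hU A B
  obtain ⟨C, hC⟩ := hcl G N ρ hρ hinj hU A B
  refine ⟨C, fun β b hb δ hδ hδ₀' hcond S hS t ht => ?_⟩
  exact hC β b hb (hbox G N ρ hρ hinj hU β b hb δ hδ hδ₀' hcond) S hS t ht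

/-! ### Typical padding exists (g6 §5, VERBATIM) -/

/-- Cellwise gluing of one configuration per `ℤ⁴` cell (used to build TYPICAL PADDING outside the box). -/
def padConfig (w : Fin 4 → ℤ → ℤ) (u : (Fin 4 → ℤ) → LGConfig 4 G) : LGConfig 4 G :=
  fun e => u (frameCell w e) e

omit [Group G] [TopologicalSpace G] [IsTopologicalGroup G] [CompactSpace G] [BorelSpace G] in
/-- **Cellwise gluing of typical data is typical everywhere** (`Typ c` reads only the cell's own edges). -/
theorem padConfig_mem {b : ℕ} {w : Fin 4 → ℤ → ℤ} (hb : 1 ≤ b) (hw : IsFrame b w)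
    {Typ : (Fin 4 → ℤ) → Set (LGConfig 4 G)} (hloc : TypLocal w Typ) {u : (Fin 4 → ℤ) → LGConfig 4 G}
    (hu : ∀ c, u c ∈ Typ c) (c : Fin 4 → ℤ) : padConfig w u ∈ Typ c := by
  have heq : ∀ e ∈ (↑(cellEdges w c) : Set (Literature.MathematicalPhysics.QuantumLattice.ZdEdge 4)),
      padConfig w u e = u c e := by
    intro e he
    have hc : frameCell w e = c := (frameCell_eq_iff (isFrame_step hb hw) e c).2 (Finset.mem_coe.1 he)
    simp only [padConfig, hc]
  have h : (padConfig w u ∈ Typ c) = (u c ∈ Typ c) := hloc.2 c heq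
  rw [h]
  exact hu c

/-- **Under the UKP clause with `δ < 1` every `Typ c` is nonempty** (take `F := {c}`, `F'` := the `3⁴` cells around
`c`, any exterior: the kernel is a probability measure and charges «`c` atypical» at most `δ < 1`). -/
theorem typ_nonempty_of_clauseII [SecondCountableTopology G] {N : ℕ} {ρ : G →* Matrix (Fin N) (Fin N) ℂ}
    (hρ : Continuous ρ) {β : ℝ}
    {w : Fin 4 → ℤ → ℤ} {δ : ℝ} {Typ : (Fin 4 → ℤ) → Set (LGConfig 4 G)} (hII : ClauseIIukp ρ β w δ Typ)
    (hδ : δ < 1) (c : Fin 4 → ℤ) : (Typ c).Nonempty := by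
  classical
  by_contra hempty
  rw [Set.not_nonempty_iff_eq_empty] at hempty
  set F' : Finset (Fin 4 → ℤ) := Fintype.piFinset fun i : Fin 4 => Finset.Icc (c i - 1) (c i + 1) with hF'
  have hcF' : c ∈ F' := by
    simp only [hF', Fintype.mem_piFinset, Finset.mem_Icc]
    intro i; constructor <;> linarith
  have hsub : ({c} : Finset (Fin 4 → ℤ)) ⊆ F' := Finset.singleton_subset_iff.2 hcF'
  set ζ : LGConfig 4 G := fun _ => 1 with hζ
  have hprem : ∀ c₁ ∈ ({c} : Finset (Fin 4 → ℤ)), ∀ c' : Fin 4 → ℤ, (∀ i, |c' i - c₁ i| ≤ 1) →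
      c' ∈ F' ∨ ζ ∈ Typ c' := by
    intro c₁ hc₁ c' hc'
    rw [Finset.mem_singleton] at hc₁
    subst hc₁
    left
    simp only [hF', Fintype.mem_piFinset, Finset.mem_Icc]
    intro i
    have h := hc' i
    rw [abs_le] at h
    constructor <;> linarith
  have hle := hII {c} F' hsub (Finset.singleton_nonempty c) ζ hprem
  haveI := isProbabilityMeasure_ymSpecification (d := 4) ρ hρ β (regionEdges w F') ζ
  have huniv : {σ : LGConfig 4 G | ∀ c₁ ∈ ({c} : Finset (Fin 4 → ℤ)), σ ∉ Typ c₁} = Set.univ := by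
    ext σ
    simp [hempty]
  rw [huniv, measure_univ, Finset.card_singleton, pow_one] at hle
  have h1 : (1 : ℝ≥0∞) ≤ ENNReal.ofReal δ := hle
  have : (1 : ℝ) ≤ δ := by
    by_contra hlt
    rw [not_le] at hlt
    have : ENNReal.ofReal δ < 1 := by
      rw [← ENNReal.ofReal_one]
      exact (ENNReal.ofReal_lt_ofReal_iff zero_lt_one).2 hlt
    exact absurd h1 (not_le.2 this)
  linarith

/-- Hence, under the hypotheses of the port, TYPICAL PADDING exists: some `pad` is typical on every `ℤ⁴` cell. -/
theorem exists_typical_pad [SecondCountableTopology G] {N : ℕ} {ρ : G →* Matrix (Fin N) (Fin N) ℂ}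
    (hρ : Continuous ρ) {β : ℝ} {b : ℕ}
    {w : Fin 4 → ℤ → ℤ} (hb : 1 ≤ b) (hw : IsFrame b w) {δ : ℝ} {Typ : (Fin 4 → ℤ) → Set (LGConfig 4 G)}
    (hloc : TypLocal w Typ) (hII : ClauseIIukp ρ β w δ Typ) (hδ : δ < 1) :
    ∃ pad : LGConfig 4 G, ∀ c, pad ∈ Typ c := by
  choose u hu using fun c => typ_nonempty_of_clauseII hρ hII hδ c
  exact ⟨padConfig w u, padConfig_mem hb hw hloc hu⟩

/-! ### Identification lemmas: inner / rind / box cells, the inner volume in box-link form, cylinder pull-back -/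

variable {w : Fin 4 → ℤ → ℤ} {x₀ : Fin 4 → ℤ} {m n : ℕ}

omit [Group G] [TopologicalSpace G] [IsTopologicalGroup G] [CompactSpace G] [MeasurableSpace G] [BorelSpace G] in
theorem innerCells_subset_boxCells (x₀ : Fin 4 → ℤ) (m : ℕ) : innerCells x₀ m ⊆ boxCells x₀ m := by
  intro y hy
  simp only [innerCells, boxCells, Fintype.mem_piFinset, Finset.mem_Ico] at hy ⊢
  intro i
  have h := hy i
  constructor <;> omega

omit [Group G] [TopologicalSpace G] [IsTopologicalGroup G] [CompactSpace G] [MeasurableSpace G] [BorelSpace G] in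
theorem rindCells_subset_boxCells : rindCells x₀ m ⊆ boxCells x₀ m := Finset.sdiff_subset

omit [Group G] [TopologicalSpace G] [IsTopologicalGroup G] [CompactSpace G] [MeasurableSpace G] [BorelSpace G] in
/-- A cell within index distance one of an inner cell is a box cell (the rind is one cell thick). -/
theorem mem_boxCells_of_near_inner {x y : Fin 4 → ℤ} (hx : x ∈ innerCells x₀ m) (h : ∀ i, |y i - x i| ≤ 1) :
    y ∈ boxCells x₀ m := by
  simp only [innerCells, boxCells, Fintype.mem_piFinset, Finset.mem_Ico] at hx ⊢
  intro i
  have h1 := hx i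
  have h2 := h i
  rw [abs_le] at h2
  constructor <;> omega

omit [Group G] [TopologicalSpace G] [IsTopologicalGroup G] [CompactSpace G] [MeasurableSpace G] [BorelSpace G] in
/-- The lowest corner cell is a rind cell (so the rind is nonempty). -/
theorem corner_mem_rindCells (x₀ : Fin 4 → ℤ) (hm : 1 ≤ m) : x₀ ∈ rindCells x₀ m := by
  simp only [rindCells, Finset.mem_sdiff, boxCells, innerCells, Fintype.mem_piFinset, Finset.mem_Ico, not_forall]
  exact ⟨fun i => ⟨le_rfl, by omega⟩, ⟨0, by omega⟩⟩

omit [Group G] [TopologicalSpace G] [IsTopologicalGroup G] [CompactSpace G] [MeasurableSpace G] [BorelSpace G] in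
theorem frameCell_mem_of_mem_regionEdges (hw1 : ∀ i j, w i j + 1 ≤ w i (j + 1)) {F : Finset (Fin 4 → ℤ)}
    {e : Literature.MathematicalPhysics.QuantumLattice.ZdEdge 4} (he : e ∈ regionEdges w F) :
    frameCell w e ∈ F := by
  simp only [Summit.QuantumFields.YangMills.Cruxes.IR.Tempered.regionEdges, Finset.mem_biUnion] at he
  obtain ⟨y, hy, hey⟩ := he
  rwa [(frameCell_eq_iff hw1 e y).2 hey]

omit [Group G] [TopologicalSpace G] [IsTopologicalGroup G] [CompactSpace G] [MeasurableSpace G] [BorelSpace G] in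
theorem mem_boxEdges_of_mem_regionEdges (hw1 : ∀ i j, w i j + 1 ≤ w i (j + 1)) {F : Finset (Fin 4 → ℤ)}
    (hF : F ⊆ boxCells x₀ m) {e : Literature.MathematicalPhysics.QuantumLattice.ZdEdge 4}
    (he : e ∈ regionEdges w F) : e ∈ boxEdges w x₀ m :=
  (mem_boxEdges_iff hw1).2 (hF (frameCell_mem_of_mem_regionEdges hw1 he))

omit [Group G] [TopologicalSpace G] [IsTopologicalGroup G] [CompactSpace G] [MeasurableSpace G] [BorelSpace G] in
/-- **The engine's inner volume `{v | cell v ∉ rind labels}` is the link set of the inner cells.** -/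
theorem innerVolume_map (hw1 : ∀ i j, w i j + 1 ≤ w i (j + 1)) :
    ((Finset.univ : Finset (BoxLink w x₀ m)).filter fun v =>
        boxCell w x₀ m n v ∉ (rindCells x₀ m).image (boxLabel x₀ m n)).map
      (Function.Embedding.subtype fun e => e ∈ boxEdges w x₀ m) = regionEdges w (innerCells x₀ m) := by
  ext e
  simp only [Finset.mem_map, Finset.mem_filter, Finset.mem_univ, true_and,
    Summit.QuantumFields.YangMills.Cruxes.IR.Tempered.regionEdges, Finset.mem_biUnion]
  constructor
  · rintro ⟨v, hv, rfl⟩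
    have hbox := frameCell_mem_boxCells hw1 v
    have hin : frameCell w v.1 ∈ innerCells x₀ m := by
      by_contra h
      exact hv (by rw [boxCell_eq]; exact Finset.mem_image_of_mem _ (Finset.mem_sdiff.2 ⟨hbox, h⟩))
    exact ⟨frameCell w v.1, hin, mem_cellEdges_frameCell hw1 _⟩
  · rintro ⟨y, hy, he⟩
    have hfe : frameCell w e = y := (frameCell_eq_iff hw1 e y).2 he
    have hbox : e ∈ boxEdges w x₀ m :=
      (mem_boxEdges_iff hw1).2 (by rw [hfe]; exact innerCells_subset_boxCells x₀ m hy)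
    refine ⟨⟨e, hbox⟩, fun h => ?_, rfl⟩
    obtain ⟨y', hy', hyy'⟩ := Finset.mem_image.1 h
    rw [boxCell_eq] at hyy'
    have hy'e : y' = frameCell w e :=
      boxLabel_injOn (rindCells_subset_boxCells hy') ((mem_boxEdges_iff hw1).1 hbox) hyy'
    rw [hfe] at hy'e
    exact (Finset.mem_sdiff.1 hy').2 (hy'e ▸ hy)

omit [Group G] [TopologicalSpace G] [IsTopologicalGroup G] [CompactSpace G] [MeasurableSpace G] [BorelSpace G] in
/-- A `ℤ⁴` cylinder observable of box cells, pulled back along `boxExt`, depends only on the links of those cells. -/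
theorem dependsOn_comp_boxExt (hw1 : ∀ i j, w i j + 1 ≤ w i (j + 1)) {pad : LGConfig 4 G}
    {f : LGConfig 4 G → ℝ} {Δf : Finset (Fin 4 → ℤ)} (hΔf : Δf ⊆ boxCells x₀ m)
    (hf : IsCylinder f (regionEdges w Δf)) :
    DependsOn (fun ζ : BoxLink w x₀ m → G => f (boxExt w x₀ m pad ζ))
      {v | boxCell w x₀ m n v ∈ Δf.image (boxLabel x₀ m n)} := by
  intro ζ ζ' h
  apply hf
  intro e he
  have he' : e ∈ regionEdges w Δf := Finset.mem_coe.1 he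
  have hbox : e ∈ boxEdges w x₀ m := mem_boxEdges_of_mem_regionEdges hw1 hΔf he'
  rw [boxExt_apply_of_mem hbox, boxExt_apply_of_mem hbox]
  refine h ⟨e, hbox⟩ ?_
  show boxCell w x₀ m n ⟨e, hbox⟩ ∈ Δf.image (boxLabel x₀ m n)
  rw [boxCell_eq]
  exact Finset.mem_image_of_mem _ (frameCell_mem_of_mem_regionEdges hw1 he')

/-- **Kernel identification:** for a cylinder observable `f` of inner cells `Δf`, the `γ^box`-expectation of its
pull-back over the engine's inner volume with exterior `boxRestrict ξ` IS the `ℤ⁴` inner-kernel expectation of `f`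
with exterior `ξ` (pointwise `f ∘ boxExt pad ∘ boxRestrict = f` on what `f` reads; then block-Markov: the collar of
the inner region lies in the box, where `boxExt pad (boxRestrict ξ) = ξ`). -/
theorem integral_inner_eq [SecondCountableTopology G] {N : ℕ} {ρ : G →* Matrix (Fin N) (Fin N) ℂ}
    (hρ : Continuous ρ) (β : ℝ) (hw1 : ∀ i j, w i j + 1 ≤ w i (j + 1)) (pad : LGConfig 4 G)
    {f : LGConfig 4 G → ℝ} {Δf : Finset (Fin 4 → ℤ)} (hΔf : Δf ⊆ innerCells x₀ m)
    (hfcyl : IsCylinder f (regionEdges w Δf)) (hfm : Measurable f) (ξ : LGConfig 4 G) :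
    ∫ ζ, f (boxExt w x₀ m pad ζ) ∂(boxSpec ρ β w x₀ m pad
        ((Finset.univ : Finset (BoxLink w x₀ m)).filter fun v =>
          boxCell w x₀ m n v ∉ (rindCells x₀ m).image (boxLabel x₀ m n)) (boxRestrict w x₀ m ξ)) =
      ∫ U, f U ∂(ymSpecification ρ β (regionEdges w (innerCells x₀ m)) ξ) := by
  have hgm : Measurable fun ζ : BoxLink w x₀ m → G => f (boxExt w x₀ m pad ζ) := hfm.comp (measurable_boxExt pad)
  rw [integral_boxSpec pad _ _ hgm, innerVolume_map hw1]
  have hΔfbox : Δf ⊆ boxCells x₀ m := hΔf.trans (innerCells_subset_boxCells x₀ m)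
  have hpt : ∀ σ : LGConfig 4 G, f (boxExt w x₀ m pad (boxRestrict w x₀ m σ)) = f σ := by
    intro σ
    apply hfcyl
    intro e he
    exact boxExt_boxRestrict_of_mem (mem_boxEdges_of_mem_regionEdges hw1 hΔfbox (Finset.mem_coe.1 he))
  simp_rw [hpt]
  refine dependsOn_integral_ymSpecification ρ hρ β (regionEdges w (innerCells x₀ m)) hfm hfcyl fun e he => ?_
  rcases Finset.mem_union.1 (Finset.mem_coe.1 he) with heS | heC
  · exact boxExt_boxRestrict_of_mem (mem_boxEdges_of_mem_regionEdges hw1 hΔfbox heS)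
  · obtain ⟨e', he'E, hnear⟩ := exists_near_of_mem_collar heC
    have hin : frameCell w e' ∈ innerCells x₀ m := frameCell_mem_of_mem_regionEdges hw1 he'E
    have hbox : e ∈ boxEdges w x₀ m :=
      (mem_boxEdges_iff hw1).2 (mem_boxCells_of_near_inner hin fun i => frame_hC1 hw1 e e' hnear i)
    exact boxExt_boxRestrict_of_mem hbox

/-- **`EnginePortT` holds** — for admissible `(n, ε)` take the ν-free engine's `q₀(4,n), κₑ, C`
(`uniform_influence_markov_defects`), `δ₀ := min q₀ ½`, `θ := e^{−κₑ}`, `C₁ := C`; given U^c data on a frame, pad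
typically (`exists_typical_pad`), build the box instance (`boxInstance_of_clauses`: P1–P4), run the engine with
sources = rind labels and `Δf ↦` its labels, and identify kernels (`integral_inner_eq`). -/
theorem enginePortT_holds : EnginePortT := by
  intro n ε hn hε hM
  obtain ⟨q₀, κₑ, C, hq₀, hκ, hC, hdec⟩ := uniform_influence_markov_defects.{0, 0} 4 n
  refine ⟨min q₀ (1 / 2), Real.exp (-κₑ), C, lt_min hq₀ (by norm_num), Real.exp_pos _,
    Real.exp_lt_one_iff.2 (by linarith), hC, ?_⟩
  intro G _ _ _ _ _ _ N ρ hρ hinj hU β b hb δ hδ hδ₀ hcond w hw x₀ m hm Δf hΔf D hfar f hfcyl hfm hf01 η η'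
  haveI : T2Space G := (hρ.isClosedEmbedding hinj).isEmbedding.t2Space
  haveI : SecondCountableTopology G := (hρ.isClosedEmbedding hinj).isEmbedding.secondCountableTopology
  have hw1 := isFrame_step hb hw
  obtain ⟨Typ, hloc, hI, hII, -⟩ := hcond w hw
  have hδ1 : δ < 1 := lt_of_le_of_lt (hδ₀.trans (min_le_right _ _)) (by norm_num)
  obtain ⟨pad, hpad⟩ := exists_typical_pad hρ hb hw hloc hII hδ1
  obtain ⟨hP1, hP2, hP3, hP4⟩ := boxInstance_of_clauses hρ β hb hw hε hloc hI hII hpad x₀ m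
  -- engine data: sources = rind labels, observable cells = labels of `Δf`, observable = pull-back of `f`
  have hμ : ∀ i, 4 * n + 3 ≤ boxMod m n i + 1 := fun i => by simp only [boxMod]; omega
  have hεs : ε * (Literature.Probability.LatticeModels.shellCount 4 n : ℝ) ≤ 3 / 4 := by
    have h : (Literature.Probability.LatticeModels.shellCount 4 n : ℝ) = OnsetFormats.shellCount n := rfl
    rw [h]; exact hM
  have hΔg_ne : ((rindCells x₀ m).image (boxLabel x₀ m n)).Nonempty :=
    ⟨_, Finset.mem_image_of_mem _ (corner_mem_rindCells x₀ (by omega))⟩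
  have hgm : Measurable fun ζ : BoxLink w x₀ m → G => f (boxExt w x₀ m pad ζ) := hfm.comp (measurable_boxExt pad)
  have hg01 : ∀ ζ : BoxLink w x₀ m → G, 0 ≤ f (boxExt w x₀ m pad ζ) ∧ f (boxExt w x₀ m pad ζ) ≤ 1 :=
    fun ζ => hf01 _
  have hgdep := dependsOn_comp_boxExt (n := n) hw1 (pad := pad) (hΔf.trans (innerCells_subset_boxCells x₀ m)) hfcyl
  have hfarL : ∀ x ∈ Δf.image (boxLabel x₀ m n), ∀ y ∈ (rindCells x₀ m).image (boxLabel x₀ m n), D ≤ cdist x y := by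
    intro x hx y hy
    obtain ⟨x', hx', rfl⟩ := Finset.mem_image.1 hx
    obtain ⟨y', hy', rfl⟩ := Finset.mem_image.1 hy
    rw [cdist_boxLabel (innerCells_subset_boxCells x₀ m (hΔf hx')) (rindCells_subset_boxCells hy')]
    exact hfar x' hx' y' hy'
  have key := hdec (boxCell w x₀ m n) (boxSpec ρ β w x₀ m pad) (boxGood w x₀ m n pad Typ) ε δ 0 hμ hP1 hε hεs
    hP3 (hP2 0) hδ.le (hδ₀.trans (min_le_left _ _)) hP4 (fun ζ => f (boxExt w x₀ m pad ζ))
    (Δf.image (boxLabel x₀ m n)) ((rindCells x₀ m).image (boxLabel x₀ m n)) D hΔg_ne hgm hg01 hgdep hfarL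
    (boxRestrict w x₀ m η) (boxRestrict w x₀ m η')
  rw [integral_inner_eq hρ β hw1 pad hΔf hfcyl hfm η, integral_inner_eq hρ β hw1 pad hΔf hfcyl hfm η'] at key
  have hθD : Real.exp (-(κₑ * D)) = Real.exp (-κₑ) ^ D := by
    rw [← Real.exp_nat_mul]; congr 1; ring
  have hcardf : (Δf.image (boxLabel x₀ m n)).card = Δf.card :=
    Finset.card_image_of_injOn (boxLabel_injOn.mono
      (Finset.coe_subset.2 (hΔf.trans (innerCells_subset_boxCells x₀ m))))
  have hcardg : ((rindCells x₀ m).image (boxLabel x₀ m n)).card = (rindCells x₀ m).card :=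
    Finset.card_image_of_injOn (boxLabel_injOn.mono (Finset.coe_subset.2 rindCells_subset_boxCells))
  rw [hcardf, hcardg, hθD] at key
  exact key

/-- **HEADLINE (g7).**  The reshaped typical-data criterion E^c follows from the torus bookkeeping ALONE:
the engine half of the bridge is kernel-checked. -/
theorem typCriterionUKPc_of_torusBookkeeping (hT : TorusBookkeepingT) : TypCriterionUKPc :=
  typCriterionUKPc_of_port enginePortT_holds hT

end EnginePort

/-! ## §9 `TorusBookkeepingT` PROVED: the cube `[-L,L]⁴` is the inner region of a mesh-`b` frame box, so the per-box
bound gives cube influence decay at rate `κ/b`; an explicit-constant copy of the tree funnel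
(`NonSimplyConnectedLatticeGap.clustering_of_boxInfluenceDecay_at`) turns that into torus clustering at rate `κ/b`.
Hence E^c is PROVED outright (§8 + §9). -/

section CubeFrame

/-! ### 9a  The cube frame: `[-L, L]⁴ × univ` is the inner region of a mesh-`b` frame box -/

/-- The cube frame: cells `0 … m'-1` tile `[-L, L]` (the first `m'-1` of width `b`, the last of width
`2L+1-(m'-1)b ∈ [b, 2b)`), continued with width `b` on both sides. -/
def cubeFrame (b L m' : ℕ) : Fin 4 → ℤ → ℤ := fun _ j =>
  if j < (m' : ℤ) then -(L : ℤ) + j * b else (L : ℤ) + 1 + (j - m') * b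

variable {b L m' : ℕ}

omit [Group G] [TopologicalSpace G] [IsTopologicalGroup G] [CompactSpace G] [MeasurableSpace G] [BorelSpace G] in
theorem cubeFrame_of_lt (i : Fin 4) {j : ℤ} (hj : j < m') : cubeFrame b L m' i j = -(L : ℤ) + j * b := by
  simp [cubeFrame, hj]

omit [Group G] [TopologicalSpace G] [IsTopologicalGroup G] [CompactSpace G] [MeasurableSpace G] [BorelSpace G] in
theorem cubeFrame_of_le (i : Fin 4) {j : ℤ} (hj : (m' : ℤ) ≤ j) :
    cubeFrame b L m' i j = (L : ℤ) + 1 + (j - m') * b := by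
  simp [cubeFrame, not_lt.2 hj]

omit [Group G] [TopologicalSpace G] [IsTopologicalGroup G] [CompactSpace G] [MeasurableSpace G] [BorelSpace G] in
theorem cubeFrame_zero (i : Fin 4) (hm' : 1 ≤ m') : cubeFrame b L m' i 0 = -(L : ℤ) := by
  rw [cubeFrame_of_lt i (by exact_mod_cast hm')]; ring

omit [Group G] [TopologicalSpace G] [IsTopologicalGroup G] [CompactSpace G] [MeasurableSpace G] [BorelSpace G] in
theorem cubeFrame_top (i : Fin 4) : cubeFrame b L m' i m' = (L : ℤ) + 1 := by
  rw [cubeFrame_of_le i le_rfl]; ring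

omit [Group G] [TopologicalSpace G] [IsTopologicalGroup G] [CompactSpace G] [MeasurableSpace G] [BorelSpace G] in
theorem cubeFrame_neg_one (i : Fin 4) (hm' : 1 ≤ m') : cubeFrame b L m' i (-1) = -(L : ℤ) - b := by
  have h1 : (1 : ℤ) ≤ m' := by exact_mod_cast hm'
  rw [cubeFrame_of_lt i (by linarith)]; ring

omit [Group G] [TopologicalSpace G] [IsTopologicalGroup G] [CompactSpace G] [MeasurableSpace G] [BorelSpace G] in
/-- The cube frame is a mesh-`b` frame when `m' b ≤ 2L+1 < (m'+1) b`. -/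
theorem isFrame_cubeFrame (hlo : m' * b ≤ 2 * L + 1) (hhi : 2 * L + 1 < (m' + 1) * b) :
    IsFrame b (cubeFrame b L m') := by
  intro i j
  have hlo' : (m' : ℤ) * b ≤ 2 * L + 1 := by exact_mod_cast hlo
  have hhi' : 2 * (L : ℤ) + 1 < ((m' : ℤ) + 1) * b := by exact_mod_cast hhi
  rcases lt_trichotomy (j + 1) (m' : ℤ) with h | h | h
  · rw [cubeFrame_of_lt i h, cubeFrame_of_lt i (by linarith)]
    have he : (j + 1) * (b : ℤ) = j * b + b := by ring
    constructor <;> linarith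
  · rw [cubeFrame_of_le i h.symm.le, cubeFrame_of_lt i (by linarith)]
    have hj : j = (m' : ℤ) - 1 := by linarith
    subst hj
    have he1 : ((m' : ℤ) - 1 + 1 - m') * (b : ℤ) = 0 := by ring
    have he2 : ((m' : ℤ) - 1) * (b : ℤ) = m' * b - b := by ring
    rw [he1, he2]
    constructor <;> linarith
  · rw [cubeFrame_of_le i h.le, cubeFrame_of_le i (by linarith)]
    have he : (j + 1 - m') * (b : ℤ) = (j - m') * b + b := by ring
    constructor <;> linarith

omit [Group G] [TopologicalSpace G] [IsTopologicalGroup G] [CompactSpace G] [MeasurableSpace G] [BorelSpace G] in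
/-- Frames are monotone. -/
theorem frame_le_of_le {w : Fin 4 → ℤ → ℤ} (hw1 : ∀ i j, w i j + 1 ≤ w i (j + 1)) (i : Fin 4) {j k : ℤ}
    (hjk : j ≤ k) : w i j ≤ w i k := by
  obtain ⟨d, rfl⟩ := Int.le.dest hjk
  have h := frame_add_nat_le (hw1 i) j d
  have hd : (0 : ℤ) ≤ d := by positivity
  linarith

omit [Group G] [TopologicalSpace G] [IsTopologicalGroup G] [CompactSpace G] [MeasurableSpace G] [BorelSpace G] in
/-- Mesh-`≤ 2b` frames grow at most `2b` per step. -/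
theorem frame_sub_le {w : Fin 4 → ℤ → ℤ} (hw : IsFrame b w) (i : Fin 4) {j k : ℤ} (hjk : j ≤ k) :
    w i k - w i j ≤ 2 * b * (k - j) := by
  obtain ⟨d, rfl⟩ := Int.le.dest hjk
  induction d with
  | zero => simp
  | succ d ih =>
    have h := (hw i (j + d)).2
    have he : j + ((d + 1 : ℕ) : ℤ) = j + d + 1 := by push_cast; ring
    rw [he]
    have hd : (0 : ℤ) ≤ d := by positivity
    have ih' := ih (by linarith)
    have he2 : 2 * (b : ℤ) * (j + d + 1 - j) = 2 * b * (j + d - j) + 2 * b := by ring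
    rw [he2]
    linarith

omit [Group G] [TopologicalSpace G] [IsTopologicalGroup G] [CompactSpace G] [MeasurableSpace G] [BorelSpace G] in
/-- **Cells `0 … m'-1` of the cube frame tile exactly `[-L, L]`.** -/
theorem frameCell_cubeFrame_mem_iff (hb : 1 ≤ b) (hm' : 1 ≤ m') (hlo : m' * b ≤ 2 * L + 1)
    (hhi : 2 * L + 1 < (m' + 1) * b) (e : Literature.MathematicalPhysics.QuantumLattice.ZdEdge 4) (i : Fin 4) :
    (0 ≤ frameCell (cubeFrame b L m') e i ∧ frameCell (cubeFrame b L m') e i < m') ↔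
      (-(L : ℤ) ≤ e.1 i ∧ e.1 i ≤ L) := by
  have hw1 := isFrame_step hb (isFrame_cubeFrame hlo hhi)
  have h1 : cubeFrame b L m' i (frameCell (cubeFrame b L m') e i) ≤ e.1 i := frameIdx_le (hw1 i) (e.1 i)
  have h2 : e.1 i < cubeFrame b L m' i (frameCell (cubeFrame b L m') e i + 1) :=
    lt_frameIdx_succ (hw1 i) (e.1 i)
  constructor
  · rintro ⟨hj0, hjm⟩
    constructor
    · have h := frame_le_of_le hw1 i hj0
      rw [cubeFrame_zero i hm'] at h
      linarith
    · have h := frame_le_of_le hw1 i (show frameCell (cubeFrame b L m') e i + 1 ≤ (m' : ℤ) by omega)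
      rw [cubeFrame_top i] at h
      linarith
  · rintro ⟨hlo', hhi'⟩
    constructor
    · by_contra hneg
      push Not at hneg
      have h := frame_le_of_le hw1 i (show frameCell (cubeFrame b L m') e i + 1 ≤ 0 by omega)
      rw [cubeFrame_zero i hm'] at h
      linarith
    · by_contra hneg
      push Not at hneg
      have h := frame_le_of_le hw1 i hneg
      rw [cubeFrame_top i] at h
      linarith

omit [Group G] [TopologicalSpace G] [IsTopologicalGroup G] [CompactSpace G] [MeasurableSpace G] [BorelSpace G] in
/-- **The cube `[-L,L]⁴ × univ` is the link set of the inner cells of the cube-frame box** (`m'+2` cells per side,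
lowest corner cell `-1`). -/
theorem regionEdges_cubeFrame (hb : 1 ≤ b) (hm' : 1 ≤ m') (hlo : m' * b ≤ 2 * L + 1)
    (hhi : 2 * L + 1 < (m' + 1) * b) :
    regionEdges (cubeFrame b L m') (innerCells (fun _ => (-1 : ℤ)) (m' + 2)) =
      (Fintype.piFinset fun _ : Fin 4 => Finset.Icc (-((L : ℕ) : ℤ)) ((L : ℕ) : ℤ)) ×ˢ
        (Finset.univ : Finset (Fin 4)) := by
  have hw1 := isFrame_step hb (isFrame_cubeFrame hlo hhi)
  ext e
  rw [Finset.mem_product, Fintype.mem_piFinset]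
  simp only [Finset.mem_univ, and_true, Finset.mem_Icc]
  constructor
  · intro he i
    have hin := frameCell_mem_of_mem_regionEdges hw1 he
    simp only [innerCells, Fintype.mem_piFinset, Finset.mem_Ico] at hin
    have h := hin i
    push_cast at h
    exact (frameCell_cubeFrame_mem_iff hb hm' hlo hhi e i).1 ⟨by linarith [h.1], by linarith [h.2]⟩
  · intro he
    simp only [Summit.QuantumFields.YangMills.Cruxes.IR.Tempered.regionEdges, Finset.mem_biUnion]
    refine ⟨frameCell (cubeFrame b L m') e, ?_, mem_cellEdges_frameCell hw1 e⟩
    simp only [innerCells, Fintype.mem_piFinset, Finset.mem_Ico]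
    intro i
    have h := (frameCell_cubeFrame_mem_iff hb hm' hlo hhi e i).2 (he i)
    push_cast
    constructor
    · linarith [h.1]
    · linarith [h.2]

omit [Group G] [TopologicalSpace G] [IsTopologicalGroup G] [CompactSpace G] [MeasurableSpace G] [BorelSpace G] in
/-- A rind cell of the cube-frame box has a coordinate `-1` or `m'`. -/
theorem exists_coord_of_mem_rindCells {y : Fin 4 → ℤ} (hy : y ∈ rindCells (fun _ => (-1 : ℤ)) (m' + 2)) :
    ∃ i, y i = -1 ∨ y i = m' := by
  simp only [rindCells, Finset.mem_sdiff, boxCells, innerCells, Fintype.mem_piFinset, Finset.mem_Ico,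
    not_forall] at hy
  obtain ⟨hbox, i, hi⟩ := hy
  refine ⟨i, ?_⟩
  have h := hbox i
  push_cast at h hi
  omega

omit [Group G] [TopologicalSpace G] [IsTopologicalGroup G] [CompactSpace G] [MeasurableSpace G] [BorelSpace G] in
/-- **Distance bookkeeping:** a cell meeting a link within sup-radius `RA ≤ L` of the origin is at cell distance
`≥ (L+1-RA)/(2b) - 1` from the rind (cells have width `≤ 2b`; rind cells start at `|site| ≥ L+1`). -/
theorem dist_supp_rind (hb : 1 ≤ b) (hm' : 1 ≤ m') (hlo : m' * b ≤ 2 * L + 1) (hhi : 2 * L + 1 < (m' + 1) * b)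
    {RA : ℕ} {e : Literature.MathematicalPhysics.QuantumLattice.ZdEdge 4} (he : ∀ i, |e.1 i| ≤ RA) (hRAL : RA ≤ L)
    {y : Fin 4 → ℤ} (hy : y ∈ rindCells (fun _ => (-1 : ℤ)) (m' + 2)) :
    (L + 1 - RA) / (2 * b) - 1 ≤ cellDist (frameCell (cubeFrame b L m') e) y := by
  have hw := isFrame_cubeFrame hlo hhi
  have hw1 := isFrame_step hb hw
  obtain ⟨i, hi⟩ := exists_coord_of_mem_rindCells hy
  have h1 : cubeFrame b L m' i (frameCell (cubeFrame b L m') e i) ≤ e.1 i := frameIdx_le (hw1 i) (e.1 i)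
  have h2 : e.1 i < cubeFrame b L m' i (frameCell (cubeFrame b L m') e i + 1) :=
    lt_frameIdx_succ (hw1 i) (e.1 i)
  have hei := abs_le.1 (he i)
  have hRAL' : (RA : ℤ) ≤ L := by exact_mod_cast hRAL
  have hxin := (frameCell_cubeFrame_mem_iff hb hm' hlo hhi e i).2 ⟨by linarith, by linarith⟩
  have hdi : |frameCell (cubeFrame b L m') e i - y i| ≤ (cellDist (frameCell (cubeFrame b L m') e) y : ℤ) :=
    (cellDist_le_iff.1 le_rfl) i
  have hb1 : (1 : ℤ) ≤ b := by exact_mod_cast hb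
  obtain ⟨K, hK⟩ : ∃ K : ℕ, K = 2 * b * (cellDist (frameCell (cubeFrame b L m') e) y + 1) := ⟨_, rfl⟩
  have key : (L : ℤ) + 1 - RA ≤ K := by
    rw [hK]
    push_cast
    rcases hi with hi | hi
    · have hm := frame_sub_le hw i (show (-1 : ℤ) ≤ frameCell (cubeFrame b L m') e i + 1 by omega)
      rw [cubeFrame_neg_one i hm'] at hm
      have habs := (abs_le.1 hdi).2
      rw [hi] at habs
      have h4 := mul_le_mul_of_nonneg_left habs (by positivity : (0 : ℤ) ≤ 2 * b)
      nlinarith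
    · have hm := frame_sub_le hw i (show frameCell (cubeFrame b L m') e i ≤ (m' : ℤ) by omega)
      rw [cubeFrame_top i] at hm
      have habs := (abs_le.1 hdi).1
      rw [hi] at habs
      have h4 := mul_le_mul_of_nonneg_left (show (m' : ℤ) - frameCell (cubeFrame b L m') e i ≤
        cellDist (frameCell (cubeFrame b L m') e) y by linarith) (by positivity : (0 : ℤ) ≤ 2 * b)
      nlinarith
  have key' : L + 1 - RA ≤ 2 * b * (cellDist (frameCell (cubeFrame b L m') e) y + 1) := by
    rw [← hK]; omega
  have hdiv := Nat.div_le_of_le_mul key'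
  omega

omit [Group G] [TopologicalSpace G] [IsTopologicalGroup G] [CompactSpace G] [MeasurableSpace G] [BorelSpace G] in
theorem card_boxCells (x₀ : Fin 4 → ℤ) (m : ℕ) : (boxCells x₀ m).card = m ^ 4 := by
  simp [boxCells, Fintype.card_piFinset, Int.card_Ico]

omit [Group G] [TopologicalSpace G] [IsTopologicalGroup G] [CompactSpace G] [MeasurableSpace G] [BorelSpace G] in
theorem card_rindCells_le (x₀ : Fin 4 → ℤ) (m : ℕ) : (rindCells x₀ m).card ≤ m ^ 4 := by
  rw [← card_boxCells x₀ m]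
  exact Finset.card_le_card rindCells_subset_boxCells

end CubeFrame

section CubeInfluence

/-! ### 9b  Cube influence decay at rate `λ/(4b)` from the per-box bound (`θ = e^{-λ}`) -/

/-- Sup-radius of the support of a local observable. -/
def suppRadius (A : LocalGaugeObservable 4 G) : ℕ :=
  A.supp.sup fun e => Finset.univ.sup fun i => (e.1 i).natAbs

omit [TopologicalSpace G] [IsTopologicalGroup G] [CompactSpace G] [BorelSpace G] in
theorem abs_le_suppRadius (A : LocalGaugeObservable 4 G) :
    ∀ e ∈ A.supp, ∀ i, |e.1 i| ≤ (suppRadius A : ℤ) := fun e he i => by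
  rw [Int.abs_eq_natAbs, Int.ofNat_le]
  exact (Finset.le_sup (f := fun i => (e.1 i).natAbs) (Finset.mem_univ i)).trans
    (Finset.le_sup (f := fun e : Literature.MathematicalPhysics.QuantumLattice.ZdEdge 4 =>
      Finset.univ.sup fun i => (e.1 i).natAbs) he)

/-- The cube-influence constant (uniform in `β` and `b`): `nA = #supp A`, `RA` = its sup-radius, `CA` = a bound. -/
def cubeConst (lam C₁ : ℝ) (nA RA : ℕ) (CA : ℝ) : ℝ :=
  2 * (CA + 1) * C₁ * Real.exp nA * (3 + 32 / lam) ^ 4 * Real.exp (2 * lam + lam * RA / 2) +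
    2 * CA * Real.exp (lam / 4 * (RA + 1))

omit [Group G] [TopologicalSpace G] [IsTopologicalGroup G] [CompactSpace G] [MeasurableSpace G] [BorelSpace G] in
theorem cubeConst_nonneg {lam C₁ CA : ℝ} (hlam : 0 < lam) (hC₁ : 0 ≤ C₁) (hCA : 0 ≤ CA) (nA RA : ℕ) :
    0 ≤ cubeConst lam C₁ nA RA CA := by
  unfold cubeConst; positivity

omit [Group G] [TopologicalSpace G] [IsTopologicalGroup G] [CompactSpace G] [MeasurableSpace G] [BorelSpace G] in
/-- Polynomial ≤ exponential: `(2u+3)⁴ ≤ (3 + 2/s)⁴ e^{4su}` for `s > 0`, `u ≥ 0`. -/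
theorem poly_le_exp {s u : ℝ} (hs : 0 < s) (hu : 0 ≤ u) :
    (2 * u + 3) ^ 4 ≤ (3 + 2 / s) ^ 4 * Real.exp (4 * (s * u)) := by
  have h1 : s * u + 1 ≤ Real.exp (s * u) := Real.add_one_le_exp _
  have he : 1 ≤ Real.exp (s * u) := Real.one_le_exp (by positivity)
  have hs2 : 0 < 2 / s := by positivity
  have hu' : u ≤ (Real.exp (s * u) - 1) / s := by
    rw [le_div_iff₀ hs]; linarith
  have h2 : 2 * u + 3 ≤ (3 + 2 / s) * Real.exp (s * u) := by
    have h3 : 2 * ((Real.exp (s * u) - 1) / s) = 2 / s * Real.exp (s * u) - 2 / s := by ring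
    nlinarith
  calc (2 * u + 3) ^ 4 ≤ ((3 + 2 / s) * Real.exp (s * u)) ^ 4 := pow_le_pow_left₀ (by positivity) h2 4
    _ = (3 + 2 / s) ^ 4 * Real.exp (4 * (s * u)) := by
        rw [mul_pow, ← Real.exp_nat_mul]; norm_num

/-- **Cube influence decay from the per-box bound.**  For `θ = e^{-λ}` and a `BoxUniformInfluence θ C₁` frame family
of mesh `b ≥ 1`: every local observable `A` with `|A| ≤ CA` has cube influence
`≤ cubeConst(λ, C₁, #supp A, R_A, CA) · e^{-(λ/4b) L}` on EVERY cube `[-L,L]⁴`, all exteriors — the cube is the inner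
region of the cube-frame box (9a), the observable is rescaled into `[0,1]`, and `#rind ≤ (m'+2)⁴`,
`D ≥ (L+1-R_A)/(2b) - 2` feed the exponent arithmetic; small cubes by the trivial bound `2 CA`. -/
theorem cubeInfluence_of_boxUniformInfluence [SecondCountableTopology G] {N : ℕ}
    {ρ : G →* Matrix (Fin N) (Fin N) ℂ} (hρ : Continuous ρ) (β : ℝ) {lam C₁ : ℝ} (hlam : 0 < lam) (hC₁ : 0 ≤ C₁)
    {b : ℕ} (hb : 1 ≤ b) (hBUI : BoxUniformInfluence (Real.exp (-lam)) C₁ ρ β b) (A : LocalGaugeObservable 4 G)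
    {CA : ℝ} (hCA : ∀ U, |A.F U| ≤ CA) (L : ℕ) (η η' : LGConfig 4 G) :
    |(∫ U, A.F U ∂(ymSpecification ρ β ((Fintype.piFinset fun _ : Fin 4 => Finset.Icc (-((L : ℕ) : ℤ)) ((L : ℕ) : ℤ)) ×ˢ
        (Finset.univ : Finset (Fin 4))) η)) -
        ∫ U, A.F U ∂(ymSpecification ρ β ((Fintype.piFinset fun _ : Fin 4 => Finset.Icc (-((L : ℕ) : ℤ)) ((L : ℕ) : ℤ)) ×ˢ
        (Finset.univ : Finset (Fin 4))) η')| ≤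
      cubeConst lam C₁ A.supp.card (suppRadius A) CA * Real.exp (-(lam / 4 / b * L)) := by
  have hCA0 : 0 ≤ CA := (abs_nonneg _).trans (hCA fun _ => 1)
  have hRA0 := abs_le_suppRadius A
  obtain ⟨RA, hRAdef⟩ : ∃ RA : ℕ, RA = suppRadius A := ⟨_, rfl⟩
  rw [← hRAdef] at hRA0 ⊢
  have hb0 : (0 : ℝ) < b := by exact_mod_cast hb
  have hb1 : (1 : ℝ) ≤ b := by exact_mod_cast hb
  have hK1 : 0 ≤ 2 * (CA + 1) * C₁ * Real.exp (A.supp.card : ℝ) * (3 + 32 / lam) ^ 4 *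
      Real.exp (2 * lam + lam * RA / 2) := by positivity
  have hK2 : 0 ≤ 2 * CA * Real.exp (lam / 4 * (RA + 1)) := by positivity
  have hE : 0 < Real.exp (-(lam / 4 / b * L)) := Real.exp_pos _
  -- the trivial bound
  have htriv : |(∫ U, A.F U ∂(ymSpecification ρ β ((Fintype.piFinset fun _ : Fin 4 => Finset.Icc (-((L : ℕ) : ℤ)) ((L : ℕ) : ℤ)) ×ˢ
        (Finset.univ : Finset (Fin 4))) η)) -
      ∫ U, A.F U ∂(ymSpecification ρ β ((Fintype.piFinset fun _ : Fin 4 => Finset.Icc (-((L : ℕ) : ℤ)) ((L : ℕ) : ℤ)) ×ˢ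
        (Finset.univ : Finset (Fin 4))) η')| ≤ 2 * CA := by
    have h1 := abs_integral_ymSpecification_le ρ hρ β ((Fintype.piFinset fun _ : Fin 4 => Finset.Icc (-((L : ℕ) : ℤ)) ((L : ℕ) : ℤ)) ×ˢ
        (Finset.univ : Finset (Fin 4))) hCA η
    have h2 := abs_integral_ymSpecification_le ρ hρ β ((Fintype.piFinset fun _ : Fin 4 => Finset.Icc (-((L : ℕ) : ℤ)) ((L : ℕ) : ℤ)) ×ˢ
        (Finset.univ : Finset (Fin 4))) hCA η'
    calc _ ≤ |∫ U, A.F U ∂(ymSpecification ρ β ((Fintype.piFinset fun _ : Fin 4 => Finset.Icc (-((L : ℕ) : ℤ)) ((L : ℕ) : ℤ)) ×ˢ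
        (Finset.univ : Finset (Fin 4))) η)| +
          |∫ U, A.F U ∂(ymSpecification ρ β ((Fintype.piFinset fun _ : Fin 4 => Finset.Icc (-((L : ℕ) : ℤ)) ((L : ℕ) : ℤ)) ×ˢ
        (Finset.univ : Finset (Fin 4))) η')| := abs_sub _ _
      _ ≤ CA + CA := add_le_add h1 h2
      _ = 2 * CA := by ring
  by_cases hmain : RA ≤ L ∧ b ≤ 2 * L + 1
  swap
  · -- small cubes: `L/b ≤ RA + 1`, the trivial bound suffices
    have hu : (L : ℝ) / b ≤ RA + 1 := by
      rcases not_and_or.1 hmain with h | h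
      · have h' : (L : ℝ) ≤ RA := by exact_mod_cast (not_le.1 h).le
        have : (L : ℝ) / b ≤ L := div_le_self (by positivity) hb1
        linarith
      · have hLb : (L : ℝ) ≤ b := by exact_mod_cast (by omega : L ≤ b)
        have : (L : ℝ) / b ≤ 1 := by rw [div_le_one hb0]; exact hLb
        have : (0 : ℝ) ≤ RA := by positivity
        linarith
    have hge : 1 ≤ Real.exp (lam / 4 * (RA + 1)) * Real.exp (-(lam / 4 / b * L)) := by
      rw [← Real.exp_add]
      refine Real.one_le_exp ?_
      have h1 : lam / 4 / b * L = lam / 4 * (L / b) := by ring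
      have h2 := mul_le_mul_of_nonneg_left hu (by positivity : (0 : ℝ) ≤ lam / 4)
      rw [h1]; linarith
    calc _ ≤ 2 * CA := htriv
      _ ≤ 2 * CA * (Real.exp (lam / 4 * (RA + 1)) * Real.exp (-(lam / 4 / b * L))) :=
          le_mul_of_one_le_right (by positivity) hge
      _ ≤ cubeConst lam C₁ A.supp.card RA CA * Real.exp (-(lam / 4 / b * L)) := by
          unfold cubeConst
          have := mul_nonneg hK1 hE.le
          nlinarith
  · -- the main case: the cube is the inner region of the cube-frame box with `m' = (2L+1)/b` cells across
    obtain ⟨hRAL, hbL⟩ := hmain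
    obtain ⟨m', hm'def⟩ : ∃ m' : ℕ, m' = (2 * L + 1) / b := ⟨_, rfl⟩
    have hm' : 1 ≤ m' := by rw [hm'def]; exact Nat.div_pos hbL hb
    have hlo : m' * b ≤ 2 * L + 1 := by rw [hm'def]; exact Nat.div_mul_le_self _ _
    have hhi : 2 * L + 1 < (m' + 1) * b := by rw [hm'def, add_mul, one_mul]; exact Nat.lt_div_mul_add hb
    have hw := isFrame_cubeFrame hlo hhi
    have hw1 := isFrame_step hb hw
    -- the rescaled observable
    obtain ⟨f, hfdef⟩ : ∃ f : LGConfig 4 G → ℝ, f = fun U => (A.F U + (CA + 1)) / (2 * (CA + 1)) := ⟨_, rfl⟩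
    have hfm : Measurable f := by rw [hfdef]; exact (A.measurable.add_const _).div_const _
    have hf01 : ∀ U, 0 ≤ f U ∧ f U ≤ 1 := by
      intro U
      have h := abs_le.1 (hCA U)
      rw [hfdef]
      constructor
      · exact div_nonneg (by linarith) (by positivity)
      · rw [div_le_one (by positivity)]; linarith
    have hΔf : A.supp.image (frameCell (cubeFrame b L m')) ⊆ innerCells (fun _ => (-1 : ℤ)) (m' + 2) := by
      intro x hx
      obtain ⟨e, he, rfl⟩ := Finset.mem_image.1 hx
      simp only [innerCells, Fintype.mem_piFinset, Finset.mem_Ico]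
      intro i
      have hei := abs_le.1 (hRA0 e he i)
      have hRAL' : (RA : ℤ) ≤ L := by exact_mod_cast hRAL
      have h := (frameCell_cubeFrame_mem_iff hb hm' hlo hhi e i).2 ⟨by linarith, by linarith⟩
      push_cast
      constructor
      · linarith [h.1]
      · linarith [h.2]
    have hcylA : IsCylinder A.F (regionEdges (cubeFrame b L m') (A.supp.image (frameCell (cubeFrame b L m')))) := by
      intro σ σ' h
      refine A.isCylinder fun e he => h e (Finset.mem_coe.2 ?_)
      simp only [Summit.QuantumFields.YangMills.Cruxes.IR.Tempered.regionEdges, Finset.mem_biUnion]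
      exact ⟨_, Finset.mem_image_of_mem _ (Finset.mem_coe.1 he), mem_cellEdges_frameCell hw1 e⟩
    have hcylf : IsCylinder f (regionEdges (cubeFrame b L m') (A.supp.image (frameCell (cubeFrame b L m')))) := by
      intro σ σ' h
      rw [hfdef]
      show (A.F σ + _) / _ = (A.F σ' + _) / _
      rw [hcylA h]
    have hD : ∀ x ∈ A.supp.image (frameCell (cubeFrame b L m')), ∀ y ∈ rindCells (fun _ => (-1 : ℤ)) (m' + 2),
        (L + 1 - RA) / (2 * b) - 1 ≤ cellDist x y := by
      intro x hx y hy
      obtain ⟨e, he, rfl⟩ := Finset.mem_image.1 hx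
      exact dist_supp_rind hb hm' hlo hhi (hRA0 e he) hRAL hy
    have hbox := hBUI (cubeFrame b L m') hw (fun _ => (-1 : ℤ)) (m' + 2) (by omega) _ hΔf _ hD f hcylf hfm
      hf01 η η'
    rw [regionEdges_cubeFrame hb hm' hlo hhi] at hbox
    -- un-rescale: `∫ f = (∫ A + (CA+1)) / (2 (CA+1))`
    have hint : ∀ ξ : LGConfig 4 G, Integrable A.F (ymSpecification ρ β ((Fintype.piFinset fun _ : Fin 4 => Finset.Icc (-((L : ℕ) : ℤ)) ((L : ℕ) : ℤ)) ×ˢ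
        (Finset.univ : Finset (Fin 4))) ξ) := fun ξ => by
      haveI := isProbabilityMeasure_ymSpecification (d := 4) ρ hρ β ((Fintype.piFinset fun _ : Fin 4 => Finset.Icc (-((L : ℕ) : ℤ)) ((L : ℕ) : ℤ)) ×ˢ
        (Finset.univ : Finset (Fin 4))) ξ
      exact (integrable_const CA).mono' A.measurable.aestronglyMeasurable
        (Eventually.of_forall fun U => by rw [Real.norm_eq_abs]; exact hCA U)
    have hId : ∀ ξ : LGConfig 4 G, ∫ U, f U ∂(ymSpecification ρ β ((Fintype.piFinset fun _ : Fin 4 => Finset.Icc (-((L : ℕ) : ℤ)) ((L : ℕ) : ℤ)) ×ˢ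
        (Finset.univ : Finset (Fin 4))) ξ) =
        ((∫ U, A.F U ∂(ymSpecification ρ β ((Fintype.piFinset fun _ : Fin 4 => Finset.Icc (-((L : ℕ) : ℤ)) ((L : ℕ) : ℤ)) ×ˢ
        (Finset.univ : Finset (Fin 4))) ξ)) + (CA + 1)) / (2 * (CA + 1)) := by
      intro ξ
      haveI := isProbabilityMeasure_ymSpecification (d := 4) ρ hρ β ((Fintype.piFinset fun _ : Fin 4 => Finset.Icc (-((L : ℕ) : ℤ)) ((L : ℕ) : ℤ)) ×ˢ
        (Finset.univ : Finset (Fin 4))) ξ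
      rw [hfdef, integral_div, integral_add (hint ξ) (integrable_const _)]
      simp
    have hdiff : (∫ U, A.F U ∂(ymSpecification ρ β ((Fintype.piFinset fun _ : Fin 4 => Finset.Icc (-((L : ℕ) : ℤ)) ((L : ℕ) : ℤ)) ×ˢ
        (Finset.univ : Finset (Fin 4))) η)) - ∫ U, A.F U ∂(ymSpecification ρ β ((Fintype.piFinset fun _ : Fin 4 => Finset.Icc (-((L : ℕ) : ℤ)) ((L : ℕ) : ℤ)) ×ˢ
        (Finset.univ : Finset (Fin 4))) η') =
        2 * (CA + 1) * ((∫ U, f U ∂(ymSpecification ρ β ((Fintype.piFinset fun _ : Fin 4 => Finset.Icc (-((L : ℕ) : ℤ)) ((L : ℕ) : ℤ)) ×ˢ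
        (Finset.univ : Finset (Fin 4))) η)) - ∫ U, f U ∂(ymSpecification ρ β ((Fintype.piFinset fun _ : Fin 4 => Finset.Icc (-((L : ℕ) : ℤ)) ((L : ℕ) : ℤ)) ×ˢ
        (Finset.univ : Finset (Fin 4))) η')) := by
      rw [hId η, hId η']
      field_simp
      ring
    rw [hdiff, abs_mul, abs_of_pos (by positivity : (0 : ℝ) < 2 * (CA + 1))]
    -- (s1) fewer observable cells than support links
    have hs1 : Real.exp (((A.supp.image (frameCell (cubeFrame b L m'))).card : ℕ) : ℝ) ≤
        Real.exp ((A.supp.card : ℕ) : ℝ) :=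
      Real.exp_le_exp.2 (by exact_mod_cast Finset.card_image_le)
    -- (s2) the rind is polynomial in `L/b`, hence sub-exponential
    have hs2 : (((rindCells (fun _ => (-1 : ℤ)) (m' + 2)).card : ℕ) : ℝ) ≤
        (3 + 32 / lam) ^ 4 * Real.exp (lam * (L / b) / 4) := by
      have h1 : (((rindCells (fun _ => (-1 : ℤ)) (m' + 2)).card : ℕ) : ℝ) ≤ ((m' + 2 : ℕ) : ℝ) ^ 4 := by
        exact_mod_cast card_rindCells_le _ _
      have h2 : ((m' + 2 : ℕ) : ℝ) ≤ 2 * (L / b) + 3 := by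
        have hm'le : (m' : ℝ) ≤ ((2 * L + 1 : ℕ) : ℝ) / b := by
          rw [hm'def]; exact Nat.cast_div_le
        have h1b : (1 : ℝ) / b ≤ 1 := by rw [div_le_one hb0]; exact hb1
        have he : ((2 * L + 1 : ℕ) : ℝ) / b = 2 * (L / b) + 1 / b := by push_cast; ring
        push_cast
        linarith
      have h3 := poly_le_exp (s := lam / 16) (u := (L : ℝ) / b) (by positivity) (by positivity)
      have h4 : (3 + 2 / (lam / 16)) = 3 + 32 / lam := by
        field_simp; ring
      have h5 : 4 * (lam / 16 * ((L : ℝ) / b)) = lam * (L / b) / 4 := by ring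
      rw [h4, h5] at h3
      calc _ ≤ ((m' + 2 : ℕ) : ℝ) ^ 4 := h1
        _ ≤ (2 * (L / b) + 3) ^ 4 := pow_le_pow_left₀ (by positivity) h2 4
        _ ≤ _ := h3
    -- (s3) the source distance is linear in `L/b`
    have hs3 : Real.exp (-lam) ^ ((L + 1 - RA) / (2 * b) - 1) ≤
        Real.exp (2 * lam + lam * RA / 2) * Real.exp (-(lam * (L / b) / 2)) := by
      rw [← Real.exp_nat_mul, ← Real.exp_add]
      refine Real.exp_le_exp.2 ?_
      have hq : ((L + 1 - RA : ℕ) : ℝ) / (2 * b) - 1 ≤ ((((L + 1 - RA) / (2 * b) : ℕ)) : ℝ) := by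
        have h := Nat.lt_div_mul_add (a := L + 1 - RA) (by positivity : 0 < 2 * b)
        have h' : ((L + 1 - RA : ℕ) : ℝ) < ((((L + 1 - RA) / (2 * b) : ℕ) : ℝ) + 1) * (2 * b) := by
          have h'' := (Nat.cast_lt (α := ℝ)).2 h
          push_cast at h''
          linarith
        rw [sub_le_iff_le_add, div_le_iff₀ (by positivity)]
        exact h'.le
      have hsub : ((((L + 1 - RA) / (2 * b) : ℕ)) : ℝ) - 1 ≤ ((((L + 1 - RA) / (2 * b) - 1 : ℕ)) : ℝ) := by
        rcases Nat.eq_zero_or_pos ((L + 1 - RA) / (2 * b)) with h0 | hpos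
        · rw [h0]; simp
        · rw [Nat.cast_sub hpos]; simp
      have hcast : ((L + 1 - RA : ℕ) : ℝ) = (L : ℝ) + 1 - RA := by
        rw [Nat.cast_sub (by omega : RA ≤ L + 1)]; push_cast; try ring
      rw [hcast] at hq
      -- `(L+1-RA)/(2b) ≤ D + 2`
      have hF1 : ((L : ℝ) + 1 - RA) / (2 * b) ≤ ((((L + 1 - RA) / (2 * b) - 1 : ℕ)) : ℝ) + 2 := by linarith
      have hF1' := mul_le_mul_of_nonneg_left hF1 hlam.le
      have hid : lam * (((L : ℝ) + 1 - RA) / (2 * b)) = lam * (L / b) / 2 + lam / (2 * b) - lam * (RA / (2 * b)) := by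
        field_simp
        try ring
      have hF2 : (RA : ℝ) / (2 * b) ≤ RA / 2 :=
        div_le_div_of_nonneg_left (by positivity) (by norm_num) (by linarith : (2 : ℝ) ≤ 2 * b)
      have hF2' := mul_le_mul_of_nonneg_left hF2 hlam.le
      have hpos : 0 ≤ lam / (2 * b) := by positivity
      linarith
    -- (s4) combine
    have hbox' : |(∫ U, f U ∂(ymSpecification ρ β ((Fintype.piFinset fun _ : Fin 4 => Finset.Icc (-((L : ℕ) : ℤ)) ((L : ℕ) : ℤ)) ×ˢ
        (Finset.univ : Finset (Fin 4))) η)) - ∫ U, f U ∂(ymSpecification ρ β ((Fintype.piFinset fun _ : Fin 4 => Finset.Icc (-((L : ℕ) : ℤ)) ((L : ℕ) : ℤ)) ×ˢ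
        (Finset.univ : Finset (Fin 4))) η')| ≤
        C₁ * (Real.exp (((A.supp.image (frameCell (cubeFrame b L m'))).card : ℕ) : ℝ) *
          ((((rindCells (fun _ => (-1 : ℤ)) (m' + 2)).card : ℕ) : ℝ) *
            Real.exp (-lam) ^ ((L + 1 - RA) / (2 * b) - 1))) := by
      simpa only [mul_assoc] using hbox
    have hinner : Real.exp (((A.supp.image (frameCell (cubeFrame b L m'))).card : ℕ) : ℝ) *
          ((((rindCells (fun _ => (-1 : ℤ)) (m' + 2)).card : ℕ) : ℝ) *
            Real.exp (-lam) ^ ((L + 1 - RA) / (2 * b) - 1)) ≤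
        Real.exp ((A.supp.card : ℕ) : ℝ) * (((3 + 32 / lam) ^ 4 * Real.exp (lam * (L / b) / 4)) *
          (Real.exp (2 * lam + lam * RA / 2) * Real.exp (-(lam * (L / b) / 2)))) :=
      mul_le_mul hs1 (mul_le_mul hs2 hs3 (by positivity) (by positivity)) (by positivity) (by positivity)
    have hee : Real.exp (lam * (L / b) / 4) * Real.exp (-(lam * (L / b) / 2)) = Real.exp (-(lam / 4 / b * L)) := by
      rw [← Real.exp_add]; congr 1; ring
    calc 2 * (CA + 1) * |(∫ U, f U ∂(ymSpecification ρ β ((Fintype.piFinset fun _ : Fin 4 => Finset.Icc (-((L : ℕ) : ℤ)) ((L : ℕ) : ℤ)) ×ˢ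
        (Finset.univ : Finset (Fin 4))) η)) - ∫ U, f U ∂(ymSpecification ρ β ((Fintype.piFinset fun _ : Fin 4 => Finset.Icc (-((L : ℕ) : ℤ)) ((L : ℕ) : ℤ)) ×ˢ
        (Finset.univ : Finset (Fin 4))) η')|
        ≤ 2 * (CA + 1) * (C₁ * (Real.exp ((A.supp.card : ℕ) : ℝ) * (((3 + 32 / lam) ^ 4 *
            Real.exp (lam * (L / b) / 4)) * (Real.exp (2 * lam + lam * RA / 2) *
              Real.exp (-(lam * (L / b) / 2)))))) :=
          mul_le_mul_of_nonneg_left (hbox'.trans (mul_le_mul_of_nonneg_left hinner hC₁)) (by positivity)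
      _ = 2 * (CA + 1) * C₁ * Real.exp (A.supp.card : ℝ) * (3 + 32 / lam) ^ 4 *
            Real.exp (2 * lam + lam * RA / 2) *
            (Real.exp (lam * (L / b) / 4) * Real.exp (-(lam * (L / b) / 2))) := by ring
      _ = 2 * (CA + 1) * C₁ * Real.exp (A.supp.card : ℝ) * (3 + 32 / lam) ^ 4 *
            Real.exp (2 * lam + lam * RA / 2) * Real.exp (-(lam / 4 / b * L)) := by rw [hee]
      _ ≤ cubeConst lam C₁ A.supp.card RA CA * Real.exp (-(lam / 4 / b * L)) := by
          unfold cubeConst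
          have := mul_nonneg hK2 hE.le
          nlinarith

end CubeInfluence

section TorusFunnel

/-! ### 9c  The torus funnel with its constant exposed (tree `NonSimplyConnectedLatticeGap.clustering_of_boxInfluenceDecay_at`,
proof verbatim except that `K_A` is a hypothesis and the constant is the conclusion's) -/

omit [Group G] [TopologicalSpace G] [IsTopologicalGroup G] [CompactSpace G] [MeasurableSpace G] [BorelSpace G] in
/-- Reduction mod `M` is injective on a box of sites of width `< M` (tree `FiniteSizeCriterion.injOn_torusProj_of_width`,
copied to keep the import list short). -/
theorem injOn_torusProj_of_width {M : ℕ} {lo hi : ℤ} (hw : hi - lo < M) :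
    Set.InjOn (Torus.proj M) {x : Site 4 | ∀ i, lo ≤ x i ∧ x i ≤ hi} := by
  intro x hx y hy hxy
  funext i
  have h1 : ((x i : ℤ) : ZMod M) = ((y i : ℤ) : ZMod M) := congr_fun hxy i
  rw [ZMod.intCast_eq_intCast_iff_dvd_sub] at h1
  have h3 : |y i - x i| < (M : ℤ) := by
    rw [abs_lt]
    constructor <;> linarith [(hx i).1, (hx i).2, (hy i).1, (hy i).2]
  linarith [Int.eq_zero_of_abs_lt_dvd h1 h3]

/-- **Cube influence decay `K_A e^{-mL}` ⇒ torus clustering `C e^{-mt}` with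
`C = 2‖A‖‖B‖ e^{m(R_A+R_B+2)} + ‖B‖ K_A e^{m(R_B+1)}`** (all `S`, all `t ≤ S`). -/
theorem corr_le_of_cubeInfluence [SecondCountableTopology G] [T2Space G] {N : ℕ}
    {ρ : G →* Matrix (Fin N) (Fin N) ℂ} (hρ : Continuous ρ) (β : ℝ) {m : ℝ} (hm : 0 ≤ m)
    (A B : LocalGaugeObservable 4 G) {CA CB KA : ℝ} (hCA : ∀ U, |A.F U| ≤ CA) (hCB : ∀ U, |B.F U| ≤ CB)
    (hKA : ∀ (L : ℕ) (η η' : LGConfig 4 G),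
      |(∫ U, A.F U ∂(ymSpecification ρ β ((Fintype.piFinset fun _ : Fin 4 => Finset.Icc (-((L : ℕ) : ℤ)) ((L : ℕ) : ℤ)) ×ˢ
        (Finset.univ : Finset (Fin 4))) η)) -
        ∫ U, A.F U ∂(ymSpecification ρ β ((Fintype.piFinset fun _ : Fin 4 => Finset.Icc (-((L : ℕ) : ℤ)) ((L : ℕ) : ℤ)) ×ˢ
        (Finset.univ : Finset (Fin 4))) η')| ≤ KA * Real.exp (-(m * L)))
    (S t : ℕ) (ht : t ≤ S) :
    |latticeConnectedCorr ρ β (2 * S + 1) A.F B.F t| ≤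
      (2 * CA * CB * Real.exp (m * (suppRadius A + suppRadius B + 2)) +
        CB * KA * Real.exp (m * (suppRadius B + 1))) * Real.exp (-(m * t)) := by
  have hCA0 : 0 ≤ CA := (abs_nonneg _).trans (hCA fun _ => 1)
  have hCB0 : 0 ≤ CB := (abs_nonneg _).trans (hCB fun _ => 1)
  have hRA := abs_le_suppRadius A
  have hRB := abs_le_suppRadius B
  obtain ⟨RA, hRAdef⟩ : ∃ RA : ℕ, RA = suppRadius A := ⟨_, rfl⟩
  obtain ⟨RB, hRBdef⟩ : ∃ RB : ℕ, RB = suppRadius B := ⟨_, rfl⟩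
  rw [← hRAdef] at hRA ⊢
  rw [← hRBdef] at hRB ⊢
  have hKA0 : 0 ≤ KA := by
    have h1 : (0 : ℝ) ≤ KA * Real.exp (-(m * ((0 : ℕ) : ℝ))) := (abs_nonneg _).trans (hKA 0 1 1)
    simpa using h1
  haveI := isProbabilityMeasure_wilsonMeasure (d := 4) (L := 2 * S + 1) ρ hρ β
  -- the trivial bound
  have htriv : |latticeConnectedCorr ρ β (2 * S + 1) A.F B.F t| ≤ 2 * CA * CB := by
    unfold Literature.MathematicalPhysics.QuantumFieldTheory.latticeConnectedCorr
    have h1 : |∫ U, A.F (torusLift (2 * S + 1) U) *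
        B.F (Literature.MathematicalPhysics.QuantumLattice.configShift (-Pi.single 0 (t : ℤ))
          (torusLift (2 * S + 1) U)) ∂(wilsonMeasure (d := 4) (L := 2 * S + 1) ρ β)| ≤
        CA * CB :=
      Literature.MathematicalPhysics.QuantumLattice.abs_integral_le_of_abs_le fun U => by
        rw [abs_mul]
        exact mul_le_mul (hCA _) (hCB _) (abs_nonneg _) hCA0
    have h2 : |∫ U, A.F (torusLift (2 * S + 1) U) ∂(wilsonMeasure (d := 4) (L := 2 * S + 1) ρ β)|
        ≤ CA := Literature.MathematicalPhysics.QuantumLattice.abs_integral_le_of_abs_le fun U => hCA _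
    have h3 : |∫ U, B.F (torusLift (2 * S + 1) U) ∂(wilsonMeasure (d := 4) (L := 2 * S + 1) ρ β)|
        ≤ CB := Literature.MathematicalPhysics.QuantumLattice.abs_integral_le_of_abs_le fun U => hCB _
    calc _ ≤ |∫ U, A.F (torusLift (2 * S + 1) U) *
          B.F (Literature.MathematicalPhysics.QuantumLattice.configShift (-Pi.single 0 (t : ℤ))
            (torusLift (2 * S + 1) U)) ∂(wilsonMeasure (d := 4) (L := 2 * S + 1) ρ β)| +
          |(∫ U, A.F (torusLift (2 * S + 1) U) ∂(wilsonMeasure (d := 4) (L := 2 * S + 1) ρ β)) *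
            ∫ U, B.F (torusLift (2 * S + 1) U) ∂(wilsonMeasure (d := 4) (L := 2 * S + 1) ρ β)| :=
          abs_sub _ _
      _ ≤ CA * CB + CA * CB := by
          rw [abs_mul]
          exact add_le_add h1 (mul_le_mul h2 h3 (abs_nonneg _) hCA0)
      _ = 2 * CA * CB := by ring
  by_cases hcase : RA + RB + 2 ≤ t
  swap
  · -- the supports are close in time: the trivial bound suffices
    have htle : (t : ℝ) ≤ RA + RB + 2 := by exact_mod_cast (not_le.1 hcase).le
    have hexp : 1 ≤ Real.exp (m * (RA + RB + 2)) * Real.exp (-(m * t)) := by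
      rw [← Real.exp_add]
      refine Real.one_le_exp ?_
      have h := mul_le_mul_of_nonneg_left htle hm
      linarith only [h]
    calc |latticeConnectedCorr ρ β (2 * S + 1) A.F B.F t| ≤ 2 * CA * CB := htriv
      _ = 2 * CA * CB * 1 + 0 := by ring
      _ ≤ 2 * CA * CB * (Real.exp (m * (RA + RB + 2)) * Real.exp (-(m * t))) +
            CB * KA * Real.exp (m * (RB + 1)) * Real.exp (-(m * t)) := by
          gcongr
          positivity
      _ = (2 * CA * CB * Real.exp (m * (RA + RB + 2)) + CB * KA * Real.exp (m * (RB + 1))) *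
            Real.exp (-(m * t)) := by ring
  · -- the main case: the cube of radius `L = t - R_B - 1` with its collar fits strictly between
    -- the support of `A` and the time-`t` translate of the support of `B`
    obtain ⟨L, hL⟩ : ∃ L : ℕ, L = t - RB - 1 := ⟨_, rfl⟩
    have hLt : L + RB + 1 = t := by omega
    have hRAL : RA + 1 ≤ L := by omega
    have hLS : L + 1 ≤ S := by omega
    have hI1 : (L : ℤ) + RB + 1 = t := by exact_mod_cast hLt
    have hI2 : (t : ℤ) ≤ S := by exact_mod_cast ht
    have hRAL' : (RA : ℤ) + 1 ≤ L := by exact_mod_cast hRAL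
    have hLS' : (L : ℤ) + 1 ≤ S := by exact_mod_cast hLS
    obtain ⟨Λ, hΛ⟩ : ∃ Λ : Finset (Literature.MathematicalPhysics.QuantumLattice.ZdEdge 4),
      Λ = (Fintype.piFinset fun _ : Fin 4 =>
      Finset.Icc (-((L : ℕ) : ℤ)) ((L : ℕ) : ℤ)) ×ˢ (Finset.univ : Finset (Fin 4)) := ⟨_, rfl⟩
    have hmemΛ : ∀ e ∈ Λ, ∀ i, -(L : ℤ) ≤ e.1 i ∧ e.1 i ≤ L := by
      intro e he i
      rw [hΛ, Finset.mem_product, Fintype.mem_piFinset] at he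
      exact Finset.mem_Icc.1 (he.1 i)
    -- (i) `Λ`, the support of `A` and the collar of `Λ` inject into the torus
    have hwide : ∀ e ∈ Λ ∪ A.supp ∪ (plaquettesTouching Λ).biUnion plaquetteEdges, ∀ i,
        -(L : ℤ) - 1 ≤ e.1 i ∧ e.1 i ≤ L + 1 := by
      intro e he i
      simp only [Finset.mem_union] at he
      rcases he with (he | he) | he
      · have h := hmemΛ e he i
        constructor <;> linarith only [h.1, h.2]
      · have h := abs_le.1 (hRA e he i)
        constructor <;> linarith only [h.1, h.2, hRAL']
      · obtain ⟨e', he', hn'⟩ := exists_near_of_mem_collar he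
        have h := hmemΛ e' he' i
        have h' := hn' i
        constructor <;> linarith only [h.1, h.2, h'.1, h'.2]
    have hinj : Set.InjOn (Torus.proj (2 * S + 1))
        ((Λ ∪ A.supp ∪ (plaquettesTouching Λ).biUnion plaquetteEdges).image Prod.fst :
          Set (Site 4)) := by
      refine (injOn_torusProj_of_width (M := 2 * S + 1) (lo := -(L : ℤ) - 1)
        (hi := (L : ℤ) + 1) (by push_cast; linarith only [hLS'])).mono fun x hx => ?_
      obtain ⟨e, he, rfl⟩ := Finset.mem_image.1 (Finset.mem_coe.1 hx)
      exact hwide e he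
    -- (ii) the torus image of `Λ` misses the translate of the support of `B`
    have hfar : ∀ e ∈ B.supp.image (fun e : Literature.MathematicalPhysics.QuantumLattice.ZdEdge 4 =>
        (e.1 - -Pi.single 0 (t : ℤ), e.2)),
        ∀ e' ∈ Λ, torusEdge (2 * S + 1) e ≠ torusEdge (2 * S + 1) e' := by
      intro e he e' he' heq
      obtain ⟨e₀, he₀, rfl⟩ := Finset.mem_image.1 he
      have h0 := abs_le.1 (hRB e₀ he₀ 0)
      have h1 := hmemΛ e' he' 0
      have hproj : ((e₀.1 0 + t : ℤ) : ZMod (2 * S + 1)) = ((e'.1 0 : ℤ) : ZMod (2 * S + 1)) := by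
        have h := congr_fun (congr_arg Prod.fst heq) 0
        simp only [torusEdge] at h
        simpa [Torus.proj_apply] using h
      rw [ZMod.intCast_eq_intCast_iff_dvd_sub] at hproj
      have hpos : 0 < e₀.1 0 + t - e'.1 0 := by linarith only [h0.1, h1.2, hI1]
      have hlt' : e₀.1 0 + t - e'.1 0 < ((2 * S + 1 : ℕ) : ℤ) := by
        push_cast; linarith only [h0.2, h1.1, hI1, hI2]
      have hdvd : (((2 * S + 1 : ℕ) : ℤ)) ∣ e₀.1 0 + t - e'.1 0 := by
        have h := hproj
        rwa [← neg_sub, dvd_neg] at h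
      exact absurd (Int.le_of_dvd hpos hdvd) (not_le.2 hlt')
    -- (iii) the cube-influence bound on `ℤ⁴` and the covariance bound on the torus
    have hinfl := hKA L
    rw [← hΛ] at hinfl
    have hcov := Summit.QuantumFields.YangMills.Theorems.FiniteSizeCriterion.abs_latticeConnectedCorr_le_of_influence
      ρ hρ β (M := 2 * S + 1) Λ A.measurable B.measurable hCA hCB A.isCylinder B.isCylinder t hinj hfar
      (fun η η' => hinfl η η')
    -- (iv) compare with `C e^{−m t}` using `L = t − R_B − 1`
    have hLr : (L : ℝ) + RB + 1 = t := by exact_mod_cast hLt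
    have hexp : Real.exp (-(m * L)) = Real.exp (m * (RB + 1)) * Real.exp (-(m * t)) := by
      rw [← Real.exp_add, ← hLr]
      ring_nf
    calc |latticeConnectedCorr ρ β (2 * S + 1) A.F B.F t| ≤ CB * (KA * Real.exp (-(m * L))) := hcov
      _ = 0 + CB * KA * Real.exp (m * (RB + 1)) * Real.exp (-(m * t)) := by rw [hexp]; ring
      _ ≤ 2 * CA * CB * Real.exp (m * (RA + RB + 2)) * Real.exp (-(m * t)) +
            CB * KA * Real.exp (m * (RB + 1)) * Real.exp (-(m * t)) := by
          gcongr
          positivity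
      _ = (2 * CA * CB * Real.exp (m * (RA + RB + 2)) + CB * KA * Real.exp (m * (RB + 1))) *
            Real.exp (-(m * t)) := by ring

/-! ### 9d  `TorusBookkeepingT` PROVED, hence E^c PROVED -/

/-- **`TorusBookkeepingT` holds**: `κ := -log θ / 4`, `s₀ := 0`; `T2`/second countability from the faithful
continuous `ρ`; cube influence at rate `κ/b` by 9b, torus clustering at rate `κ/b` by 9c, constants compared using
`b ≥ 1`. -/
theorem torusBookkeepingT_holds : TorusBookkeepingT := by
  intro θ C₁ hθ hθ1 hC₁
  obtain ⟨lam, hlamdef⟩ : ∃ lam : ℝ, lam = -Real.log θ := ⟨_, rfl⟩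
  have hlam : 0 < lam := by rw [hlamdef]; exact neg_pos.2 (Real.log_neg hθ hθ1)
  have hθexp : Real.exp (-lam) = θ := by rw [hlamdef, neg_neg, Real.exp_log hθ]
  refine ⟨lam / 4, 0, by positivity, ?_⟩
  intro G _ _ _ _ _ _ N ρ hρ hinj _ A B
  haveI : T2Space G := (hρ.isClosedEmbedding hinj).isEmbedding.t2Space
  haveI : SecondCountableTopology G := (hρ.isClosedEmbedding hinj).isEmbedding.secondCountableTopology
  obtain ⟨CA, hCA⟩ := A.bounded
  obtain ⟨CB, hCB⟩ := B.bounded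
  have hCA0 : 0 ≤ CA := (abs_nonneg _).trans (hCA fun _ => 1)
  have hCB0 : 0 ≤ CB := (abs_nonneg _).trans (hCB fun _ => 1)
  have hK0 := cubeConst_nonneg hlam hC₁ hCA0 A.supp.card (suppRadius A)
  refine ⟨2 * CA * CB * Real.exp (lam / 4 * (suppRadius A + suppRadius B + 2)) +
      CB * cubeConst lam C₁ A.supp.card (suppRadius A) CA * Real.exp (lam / 4 * (suppRadius B + 1)), ?_⟩
  intro β b hb hBUI S _ t ht
  rw [← hθexp] at hBUI
  have hm : (0 : ℝ) ≤ lam / 4 / b := by positivity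
  have hKA : ∀ (L : ℕ) (η η' : LGConfig 4 G),
      |(∫ U, A.F U ∂(ymSpecification ρ β ((Fintype.piFinset fun _ : Fin 4 => Finset.Icc (-((L : ℕ) : ℤ)) ((L : ℕ) : ℤ)) ×ˢ
        (Finset.univ : Finset (Fin 4))) η)) -
        ∫ U, A.F U ∂(ymSpecification ρ β ((Fintype.piFinset fun _ : Fin 4 => Finset.Icc (-((L : ℕ) : ℤ)) ((L : ℕ) : ℤ)) ×ˢ
        (Finset.univ : Finset (Fin 4))) η')| ≤
        cubeConst lam C₁ A.supp.card (suppRadius A) CA * Real.exp (-(lam / 4 / b * L)) :=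
    fun L η η' => cubeInfluence_of_boxUniformInfluence hρ β hlam hC₁ hb hBUI A hCA L η η'
  have h := corr_le_of_cubeInfluence hρ β hm A B hCA hCB hKA S t ht
  have hb1 : (1 : ℝ) ≤ b := by exact_mod_cast hb
  have hmle : lam / 4 / b ≤ lam / 4 := div_le_self (by positivity) hb1
  have hX1 : Real.exp (lam / 4 / b * (suppRadius A + suppRadius B + 2)) ≤
      Real.exp (lam / 4 * (suppRadius A + suppRadius B + 2)) :=
    Real.exp_le_exp.2 (mul_le_mul_of_nonneg_right hmle (by positivity))
  have hX2 : Real.exp (lam / 4 / b * (suppRadius B + 1)) ≤ Real.exp (lam / 4 * (suppRadius B + 1)) :=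
    Real.exp_le_exp.2 (mul_le_mul_of_nonneg_right hmle (by positivity))
  have hrate : Real.exp (-(lam / 4 / b * t)) = Real.exp (-(lam / 4 * t / b)) := by
    congr 1; ring
  have h1 := mul_le_mul_of_nonneg_left hX1 (by positivity : (0 : ℝ) ≤ 2 * CA * CB)
  have h2 := mul_le_mul_of_nonneg_left hX2
    (mul_nonneg hCB0 hK0 : (0 : ℝ) ≤ CB * cubeConst lam C₁ A.supp.card (suppRadius A) CA)
  calc |latticeConnectedCorr ρ β (2 * S + 1) A.F B.F t|
      ≤ (2 * CA * CB * Real.exp (lam / 4 / b * (suppRadius A + suppRadius B + 2)) +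
          CB * cubeConst lam C₁ A.supp.card (suppRadius A) CA *
            Real.exp (lam / 4 / b * (suppRadius B + 1))) * Real.exp (-(lam / 4 / b * t)) := h
    _ ≤ (2 * CA * CB * Real.exp (lam / 4 * (suppRadius A + suppRadius B + 2)) +
          CB * cubeConst lam C₁ A.supp.card (suppRadius A) CA * Real.exp (lam / 4 * (suppRadius B + 1))) *
          Real.exp (-(lam / 4 / b * t)) := by
        apply mul_le_mul_of_nonneg_right _ (Real.exp_pos _).le
        linarith
    _ = _ := by rw [hrate]

/-- **HEADLINE (g7 §9). E^c is PROVED**: the reshaped typical-data criterion `TypCriterionUKPc` holds outright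
(§8 `typCriterionUKPc_of_torusBookkeeping` + `torusBookkeepingT_holds`). -/
theorem typCriterionUKPc_holds : TypCriterionUKPc :=
  typCriterionUKPc_of_torusBookkeeping torusBookkeepingT_holds

end TorusFunnel

/-! ## §10 The reshaped cut COMPOSED with E^c discharged: `IR ⇐ I^c ∧ X^c` (kernel-checked)

The slot's generic seams and the reshaped triple are g6 §0/§2 VERBATIM (namespace moved to `PortG7`); the only new line
is `ir_of_onset_af`, which feeds `typCriterionUKPc_holds` (§9) into `ir_of_pincerTUKPc`. -/

open scoped SchwartzMap
open Summit.QuantumFields.YangMills.Cruxes.OSLegsFromFemtoAndGap.DlrCollarTransfer (GapInUnits LowerBounds Q2)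
open Summit.QuantumFields.YangMills.Cruxes.IR.CellTempered (IRCal)

section Generic

variable {G : Type} [Group G] [TopologicalSpace G] [IsTopologicalGroup G] [CompactSpace G]
  [MeasurableSpace G] [BorelSpace G]

/-- The meshes `b ≥ 1` at which a format `P` holds at coupling `β` (slot copy). -/
def fmtSet (P : ℝ → ℕ → Prop) (β : ℝ) : Set ℕ := {b : ℕ | 1 ≤ b ∧ P β b}

/-- The onset of a format (slot copy). -/
def fmtOnset (P : ℝ → ℕ → Prop) (β : ℝ) : ℕ := sInf (fmtSet P β)

/-- slot copy -/
theorem fmtOnset_spec (P : ℝ → ℕ → Prop) (β : ℝ) (h : (fmtSet P β).Nonempty) :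
    1 ≤ fmtOnset P β ∧ P β (fmtOnset P β) :=
  Nat.sInf_mem h

/-- Clustering contract of a format (slot copy). -/
def FmtClustering (r : LatticeRep G) (P : ℝ → ℕ → Prop) (κ : ℝ) (s₀ : ℕ) : Prop :=
  ∀ A B : YMSpecies G, ∃ C : ℝ, ∀ (β : ℝ) (b : ℕ), 1 ≤ b → P β b →
    ∀ S : ℕ, s₀ * b ≤ 2 * S + 1 → ∀ t : ℕ, t ≤ S →
      |latticeConnectedCorr r.ρ β (2 * S + 1) A.F B.F t| ≤ C * Real.exp (-(κ * t / b))

/-- The generic pincer (slot copy). -/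
theorem fmtOnset_pinned (P : ℝ → ℕ → Prop) (r : LatticeRep G) (a : ℝ → ℝ) (ha : ∀ β, 0 < a β)
    (hlb : LowerBounds G r a)
    (hX : ∀ v : 𝓢(EuclideanSpace ℝ (Fin 4), ℝ), tsupport v ⊆ {y : EuclideanSpace ℝ (Fin 4) | 0 < y 0} →
      ∀ η : ℝ, 0 < η → ∃ T β₁ : ℝ, ∀ β : ℝ, β₁ ≤ β → ∀ s : ℝ, 0 < s →
        T ≤ s * (fmtOnset P β : ℝ) →
          ∃ᶠ (L : ℕ) in atTop, |Q2 G r β L s (thetaTest 4 v) v| ≤ η) :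
    ∃ T β₆ : ℝ, ∀ β : ℝ, β₆ ≤ β → a β * (fmtOnset P β : ℝ) < T := by
  obtain ⟨⟨v, ε₅, β₅, Λ₅, hv, hε₅, hlow⟩, -⟩ := hlb
  obtain ⟨T, β₁, hT⟩ := hX v hv (ε₅ / 2) (half_pos hε₅)
  refine ⟨T, max β₁ β₅, fun β hβ => ?_⟩
  have hβ1 : β₁ ≤ β := le_trans (le_max_left _ _) hβ
  have hβ5 : β₅ ≤ β := le_trans (le_max_right _ _) hβ
  by_contra hge
  rw [not_lt] at hge
  have hfreq := hT β hβ1 (a β) (ha β) hge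
  have hev : ∀ᶠ (L : ℕ) in atTop, Λ₅ ≤ a β * (L : ℝ) :=
    (tendsto_natCast_atTop_atTop.const_mul_atTop (ha β)).eventually_ge_atTop Λ₅
  obtain ⟨L, hL1, hL2⟩ := (hfreq.and_eventually hev).exists
  have hlo := hlow β hβ5 L hL2
  have habs := le_abs_self (Q2 G r β L (a β) (thetaTest 4 v) v)
  linarith

/-- The generic rate seam (slot copy). -/
theorem gapInUnits_of_fmtOnset {P : ℝ → ℕ → Prop} (r : LatticeRep G) (a : ℝ → ℝ) (ha : ∀ β, 0 < a β)
    {κ : ℝ} {s₀ : ℕ} (hκ : 0 < κ) (hcl : FmtClustering r P κ s₀)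
    {β₂ : ℝ} (hon : ∀ β : ℝ, β₂ ≤ β → (fmtSet P β).Nonempty)
    {T β₆ : ℝ} (hpin : ∀ β : ℝ, β₆ ≤ β → a β * (fmtOnset P β : ℝ) < T) :
    GapInUnits G r a := by
  have hT : 0 < T := by
    have h1 := hpin (max β₂ β₆) (le_max_right _ _)
    have h0 : 0 ≤ a (max β₂ β₆) * (fmtOnset P (max β₂ β₆) : ℝ) :=
      mul_nonneg (ha _).le (Nat.cast_nonneg _)
    linarith
  have hc₁ : 0 < κ / T := div_pos hκ hT
  refine ⟨κ / T, max β₂ β₆, fun β => s₀ * fmtOnset P β, hc₁, ?_⟩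
  intro A B
  obtain ⟨C, hCb⟩ := hcl A B
  refine ⟨C, fun β hβ S t hS ht => ?_⟩
  have hβ2 : β₂ ≤ β := le_trans (le_max_left _ _) hβ
  have hβ6 : β₆ ≤ β := le_trans (le_max_right _ _) hβ
  obtain ⟨hb1, hP1⟩ := fmtOnset_spec P β (hon β hβ2)
  have hbpos : (0 : ℝ) < (fmtOnset P β : ℝ) := by exact_mod_cast hb1
  have hS' : s₀ * fmtOnset P β ≤ S := hS
  have hside : s₀ * fmtOnset P β ≤ 2 * S + 1 := by omega
  have hbound := hCb β (fmtOnset P β) hb1 hP1 S hside t ht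
  have hC0 : 0 ≤ C := by
    have h0 : 0 ≤ C * Real.exp (-(κ * (t : ℝ) / (fmtOnset P β : ℝ))) := (abs_nonneg _).trans hbound
    exact nonneg_of_mul_nonneg_left h0 (Real.exp_pos _)
  refine hbound.trans ?_
  gcongr
  have ht0 : (0 : ℝ) ≤ (t : ℝ) := by exact_mod_cast Nat.zero_le t
  have hab : a β * (fmtOnset P β : ℝ) < T := hpin β hβ6
  rw [le_div_iff₀ hbpos]
  calc κ / T * a β * (t : ℝ) * (fmtOnset P β : ℝ)
      = κ / T * (t : ℝ) * (a β * (fmtOnset P β : ℝ)) := by ring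
    _ ≤ κ / T * (t : ℝ) * T := by gcongr
    _ = κ * (t : ℝ) := by field_simp

end Generic

section Triple

variable {G : Type} [Group G] [TopologicalSpace G] [IsTopologicalGroup G] [CompactSpace G]
  [MeasurableSpace G] [BorelSpace G]

/-- The typical mixing onset in the reshaped currency. -/
def mixOnsetTc {N : ℕ} (ρ : G →* Matrix (Fin N) (Fin N) ℂ) (β : ℝ) (n : ℕ) (ε δ : ℝ) : ℕ :=
  fmtOnset (fun β' b => TypShellCondUKPc ρ β' b n ε δ) β

/-- **I^c — typical onset mixing, reshaped** (`OnsetMixingTypical` with `TypShellCond ↦ TypShellCondUKPc` and the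
engine's admissibility constant `ε · shellCount n ≤ 3/4`). STRONGER than the registered I_T
(`onsetMixingTypical_of_UKPc`). -/
def OnsetMixingTypicalUKPc : Prop :=
  ∀ (G : Type) [Group G] [TopologicalSpace G] [IsTopologicalGroup G] [CompactSpace G],
    IsCompactSimpleLieGroup G → letI : MeasurableSpace G := borel G; haveI : BorelSpace G := ⟨rfl⟩;
    ∀ r : LatticeRep G, ∃ (n : ℕ) (ε : ℝ), 1 ≤ n ∧ 0 ≤ ε ∧ ε * OnsetFormats.shellCount n ≤ 3 / 4 ∧
      ∀ δ : ℝ, 0 < δ → ∃ β₂ : ℝ, ∀ β : ℝ, β₂ ≤ β → ∃ b : ℕ, 1 ≤ b ∧ TypShellCondUKPc r.ρ β b n ε δ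

/-- **X^c — asymptotic freedom up to the reshaped typical onset** (`AFToOnsetT` with `mixOnsetT ↦ mixOnsetTc`,
`ε · shellCount n ≤ 3/4`).  Neither weaker nor stronger than the registered X_T (the onset moved). -/
def AFToOnsetTUKPc : Prop :=
  ∀ (G : Type) [Group G] [TopologicalSpace G] [IsTopologicalGroup G] [CompactSpace G],
    IsCompactSimpleLieGroup G → letI : MeasurableSpace G := borel G; haveI : BorelSpace G := ⟨rfl⟩;
    ∀ (r : LatticeRep G) (n : ℕ) (ε : ℝ), 1 ≤ n → 0 ≤ ε → ε * OnsetFormats.shellCount n ≤ 3 / 4 → ∀ δ : ℝ, 0 < δ →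
      ∀ v : 𝓢(EuclideanSpace ℝ (Fin 4), ℝ), tsupport v ⊆ {y : EuclideanSpace ℝ (Fin 4) | 0 < y 0} →
        ∀ η : ℝ, 0 < η → ∃ T β₁ : ℝ, ∀ β : ℝ, β₁ ≤ β → ∀ s : ℝ, 0 < s →
          T ≤ s * (mixOnsetTc r.ρ β n ε δ : ℝ) →
            ∃ᶠ (L : ℕ) in atTop, |Q2 G r β L s (thetaTest 4 v) v| ≤ η

/-- `shellCount 1 = 1776 > 0`, so `ε · shellCount n ≤ 3/4 ⇒ ε · shellCount n < 1` … for `n ≥ 1` (arithmetic). -/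
theorem shellCount_lt_one_of_le {n : ℕ} {ε : ℝ} (h : ε * OnsetFormats.shellCount n ≤ 3 / 4) : ε * OnsetFormats.shellCount n < 1 := by
  linarith

/-- The reshaped bridge at `(G, r, n, ε, δ₀)` is a clustering contract for the reshaped format (bookkeeping). -/
theorem fmtClustering_of_typCriterionUKPc (hE : TypCriterionUKPc) (r : LatticeRep G) {n : ℕ} {ε : ℝ}
    (hn : 1 ≤ n) (hε : 0 ≤ ε) (hM : ε * OnsetFormats.shellCount n ≤ 3 / 4) :
    ∃ (δ₀ κ : ℝ) (s₀ : ℕ), 0 < δ₀ ∧ 0 < κ ∧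
      FmtClustering r (fun β b => TypShellCondUKPc r.ρ β b n ε δ₀) κ s₀ := by
  obtain ⟨δ₀, κ, s₀, hδ₀, hκ, hF⟩ := hE n ε hn hε hM
  refine ⟨δ₀, κ, s₀, hδ₀, hκ, fun A B => ?_⟩
  obtain ⟨C, hC⟩ := hF G r.N r.ρ r.continuous r.injective r.mem_unitary A B
  exact ⟨C, fun β b hb hP S hS t ht => hC β b hb δ₀ hδ₀ le_rfl hP S hS t ht⟩

/-- **Composition of the reshaped cut (real proof): `E^c → I^c → X^c → IRCal`** through the slot's generic seams at
`P β b := TypShellCondUKPc r.ρ β b n ε δ₀`. -/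
theorem irCal_of_pincerTUKPc (hE : TypCriterionUKPc) (hI : OnsetMixingTypicalUKPc) (hX : AFToOnsetTUKPc) :
    IRCal := by
  intro G _ _ _ _ hG
  letI : MeasurableSpace G := borel G
  haveI : BorelSpace G := ⟨rfl⟩
  intro r a ha _ hlb
  obtain ⟨n, ε, hn, hε, hM, hIδ⟩ := hI G hG r
  obtain ⟨δ₀, κ, s₀, hδ₀, hκ, hcl⟩ := fmtClustering_of_typCriterionUKPc hE r hn hε hM
  obtain ⟨β₂, hon⟩ := hIδ δ₀ hδ₀
  obtain ⟨T, β₆, hpin⟩ :=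
    fmtOnset_pinned (fun β' b => TypShellCondUKPc r.ρ β' b n ε δ₀) r a ha hlb (hX G hG r n ε hn hε hM δ₀ hδ₀)
  exact gapInUnits_of_fmtOnset r a ha hκ hcl
    (fun β hβ => by obtain ⟨b, hb, hP⟩ := hon β hβ; exact ⟨b, hb, hP⟩) hpin

/-- The composition concludes the ROUTE DECL by name (as the slot's `IR_of_stubsT`, hypotheses form). -/
theorem ir_of_pincerTUKPc (hE : TypCriterionUKPc) (hI : OnsetMixingTypicalUKPc) (hX : AFToOnsetTUKPc) :
    Summit.QuantumFields.YangMills.Theses.BalabanLadder.IR := by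
  have h : IRCal := irCal_of_pincerTUKPc hE hI hX
  delta Summit.QuantumFields.YangMills.Theses.BalabanLadder.IR
  delta Summit.QuantumFields.YangMills.Cruxes.IR.CellTempered.IRCal at h
  exact h

end Triple

/-- **HEADLINE (g7 §10). Under the re-cut `U ↦ U^c` the crux needs only the supplier stub I^c and the AF stub X^c:**
`OnsetMixingTypicalUKPc → AFToOnsetTUKPc → BalabanLadder.IR`, the engine stub E^c being PROVED (§9). -/
theorem ir_of_onset_af (hI : OnsetMixingTypicalUKPc) (hX : AFToOnsetTUKPc) :
    Summit.QuantumFields.YangMills.Theses.BalabanLadder.IR :=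
  ir_of_pincerTUKPc typCriterionUKPc_holds hI hX

end Summit.QuantumFields.YangMills.Cruxes.IR.AfPincerT.PortG7
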